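/-
Copyright: gate-hubbard-kl typer wave (D-0069 (2)), seat t3 g4. Proof companion; no new definitions of
mathematical content, no named facts.
-/
import Mathlib
import Literature.MathematicalPhysics.QuantumLattice.FermiRG.DR2000PartI
import HarnessLib

/-!
# Disertori–Rivasseau 2000, Part I, §IV.3 Lemma 6 (the sector counting lemma) — PROOF

M. Disertori, V. Rivasseau, *Interacting Fermi liquid in two dimensions at finite temperature,
Part I: Convergent Attributions*, Comm. Math. Phys. **215** (2000) 251–290 = arXiv:cond-mat/9907130,
§IV.3 Lemma 6 (IV.31) p0014:L1–38 and Appendix B p0017:L27–p0018 («almost identical to the one of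
Lemma 3' in [FMRT1]», pp. 701–704) [cite: DisertoriRivasseau2000, §IV.3 Lemma 6 + App. B].

This file DISCHARGES the named fact `DR2000.Lemma6SectorCounting` of the frozen statement file
`FermiRG/DR2000PartI.lean` (typer wave gate-hubbard-kl, FACT-LIST licence F-046, row DR1.L6):

* `theorem Lemma6SectorCounting_holds : Lemma6SectorCounting`.

## The statement (recalled)

Sectors of angular width `w = α^{-1/4}` and radial thickness `w² = α^{-1/2}` on the unit Fermi circle;
`l = l' + 1 ≥ 2` legs, the centre `θ₁` of leg `0` fixed, the other centres `θ_i` integrated over arcs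
`[a_i, b_i]` of length `w < b_i - a_i ≤ 2π`; `Υ = 1` iff momenta `k_i` in the sectors with `Σ k_i = 0`
exist.  Then `((4/3)/w)^{l'} ∫ Υ ≤ K^{l'+1} ∏_{i ∈ I} (b_i - a_i)/w` for a set `I` of `l' - 2` arcs
(`I = ∅` for `l' = 1`).

## The proof (App. B of the source = [FMRT1]; we follow the careful curve-generic version of the same
argument, Benfatto–Giuliani–Mastropietro 2003 §7.4, specialised to the circle and written in MEASURE form)

All the geometry is expressed through the angles: a compatible family of momenta is
`k_i = ρ_i (cos ψ_i, sin ψ_i)` with `|ρ_i - 1| ≤ w²` and `|ψ_i - θ_i| ≤ w (mod 2π)`, and momentum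
conservation reads `Σ ρ_i cos(ψ_i - c) = Σ ρ_i sin(ψ_i - c) = 0` for every reference angle `c`
(`compat_extract`).  Consequences (§2): the centre sums `S_u = Σ cos(θ_i - θ₁)`, `S_v = Σ sin(θ_i - θ₁)`
are `≤ 2lw`; if `(p,q)` is a pair of integrated legs maximising `|sin(θ_p - θ_q)| =: φ` (the «angle as
close as possible to π/2» of App. B) then ALL legs are within `2l(φ + 2w)` of `θ₁` modulo `π` (for leg `0`
this is momentum conservation, App. B «max_j ∠(k'_1,k'_j) ≤ l O(2^{-i})», BGM (s1.34)), and then the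
component of `S` ALONG the common direction is second-order small, `|S_u| ≤ 2l²w(φ + 3w)` (App. B
«k_j - r_j = (O(2^{-i}α^{-1/4}), O(α^{-1/4}))», BGM (s1.38)–(s1.40)).  Hence `Υ ≤ Σ_{(p,q)} 1_{G_{pq}}` for
explicit measurable sets `G_{pq}` (§3, `secG`).  §4 is the parallelogram analysis (App. B cases `|N| = 1` / `N = 0`,
BGM Lemma 7.5) on the circle, as TWO-POINT estimates: inside `G_{pq}`, with the other centres frozen,
any two admissible `(θ_p, θ_q)` differ — modulo `π` and the exchange of the two half-difference signs —
by `≤ R = 5700 l² w + 3.1·10⁶ l³ w` in each coordinate (`l = l'+1`); the key no-logarithm step is that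
`{δ ≥ 0 : |cos δ - D| ≤ C l² w (δ + w)}` has diameter `O(l² w)`.  So the `(θ_p,θ_q)`-section of `G_{pq}`
is covered by at most 130 squares of side `2R` (§5, `section_bound`: `≤ 6·10¹⁵ l⁶ w²`), the remaining
`l' - 2` legs contribute their full arcs (Tonelli via `lmarginal`, §6 `volume_secG_le`), and summing over
the `l'(l'-1)` pairs and choosing `I` maximising `∏_{i∈I}(b_i - a_i)` among `(l'-2)`-subsets gives the
claim with `K = 2⁶⁰` (§7; the case `l' = 1` is momentum conservation alone: `θ ∈ θ₁ + πℤ ± 2πw`).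

Deviations from the printed proof, disclosed: (i) we do not localise the free legs `2, …, l-2` to the
`O(2^{-i})` cone (not needed for the printed bound, which only claims `l - 3` full arcs); (ii) the dyadic
decomposition in `φ` of App. B step 1–2 is replaced by the pointwise two-point estimates of §4 (BGM's
`φ₀` device), which is what makes the bound logarithm-free; (iii) constants are explicit but not
optimised.

Everything here is a `theorem`, plus auxiliary `def`s WITH BODIES for the explicit sets / predicates /
constants of the proof (`redPi`, `thr`, `secG`, `AngularData`, `SamePt`, `OppPt`, `InSect`, `restCos`,
`restSin`, `wTriv`); no `sorry`, no named facts (`def … : Prop` hypotheses), no instances, no notation.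
-/

noncomputable section

open MeasureTheory Real Set Finset

namespace Literature.MathematicalPhysics.QuantumLattice.FermiRG.DR2000

open Literature.MathematicalPhysics.QuantumLattice

/-! ### §0 Elementary trigonometric toolkit -/

/-- Auxiliary step of the proof of `Lemma6SectorCounting_holds`. [folklore] -/
private theorem sc_abs_sin_sub_sin_le (x y : ℝ) : |sin x - sin y| ≤ |x - y| := by
  simpa [Real.dist_eq] using Real.lipschitzWith_sin.dist_le_mul x y

/-- Auxiliary step of the proof of `Lemma6SectorCounting_holds`. [folklore] -/
private theorem sc_abs_cos_sub_cos_le (x y : ℝ) : |cos x - cos y| ≤ |x - y| := by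
  simpa [Real.dist_eq] using Real.lipschitzWith_cos.dist_le_mul x y

/-- `|x| ≤ (π/2) |sin x|` for `|x| ≤ π/2`. [folklore] -/
private theorem sc_abs_le_pi_div_two_mul_abs_sin {x : ℝ} (hx : |x| ≤ π / 2) : |x| ≤ π / 2 * |sin x| := by
  have h1 : 2 / π * |x| ≤ sin |x| := Real.mul_le_sin (abs_nonneg x) hx
  have h2 : sin |x| = |sin x| := by
    rcases le_or_gt 0 x with h | h
    · have hx' : x ≤ π / 2 := by rw [abs_of_nonneg h] at hx; exact hx
      rw [abs_of_nonneg h]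
      rw [abs_of_nonneg (sin_nonneg_of_nonneg_of_le_pi h (by linarith [pi_pos]))]
    · rw [abs_of_neg h, sin_neg, abs_of_neg]
      apply sin_neg_of_neg_of_neg_pi_lt h
      have : -x ≤ π / 2 := by rw [abs_of_neg h] at hx; exact hx
      linarith [pi_pos]
  rw [h2] at h1
  have hpi := pi_pos
  calc |x| = π / 2 * (2 / π * |x|) := by field_simp
    _ ≤ π / 2 * |sin x| := by gcongr

/-- `|sin (a + b)| ≤ |sin a| + |sin b|`. [folklore] -/
private theorem sc_abs_sin_add_le (a b : ℝ) : |sin (a + b)| ≤ |sin a| + |sin b| := by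
  rw [sin_add]
  calc |sin a * cos b + cos a * sin b| ≤ |sin a * cos b| + |cos a * sin b| := abs_add_le _ _
    _ = |sin a| * |cos b| + |cos a| * |sin b| := by rw [abs_mul, abs_mul]
    _ ≤ |sin a| * 1 + 1 * |sin b| := by
        gcongr
        · exact abs_cos_le_one b
        · exact abs_cos_le_one a
    _ = |sin a| + |sin b| := by ring

/-- `|sin (a - b)| ≤ |sin a| + |sin b|`. [folklore] -/
private theorem sc_abs_sin_sub_le (a b : ℝ) : |sin (a - b)| ≤ |sin a| + |sin b| := by
  have := sc_abs_sin_add_le a (-b); simpa [sub_eq_add_neg, sin_neg, abs_neg] using this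

/-- `cos x ≥ 199/200` for `|x| ≤ 1/10`. [folklore] -/
private theorem sc_cos_ge {x : ℝ} (hx : |x| ≤ 1 / 10) : 199 / 200 ≤ cos x := by
  have h := Real.one_sub_sq_div_two_le_cos (x := x)
  have hx2 : x ^ 2 ≤ (1 / 10) ^ 2 := by
    have := abs_nonneg x
    calc x ^ 2 = |x| ^ 2 := (sq_abs x).symm
      _ ≤ (1 / 10) ^ 2 := by gcongr
  linarith

/-- The reduction of an angle modulo `π` into `[-π/2, π/2]`. [folklore] -/
private def redPi (x : ℝ) : ℝ := x - (round (x / π) : ℝ) * π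

/-- Auxiliary step of the proof of `Lemma6SectorCounting_holds`. [folklore] -/
private theorem sc_redPi_add (x : ℝ) : redPi x + (round (x / π) : ℝ) * π = x := by
  unfold redPi; ring

/-- Auxiliary step of the proof of `Lemma6SectorCounting_holds`. [folklore] -/
private theorem sc_abs_redPi_le (x : ℝ) : |redPi x| ≤ π / 2 := by
  have h := abs_sub_round (x / π)
  have hpi := pi_pos
  have : redPi x = (x / π - round (x / π)) * π := by
    unfold redPi; field_simp
  rw [this, abs_mul, abs_of_pos hpi]
  calc |x / π - ↑(round (x / π))| * π ≤ 1 / 2 * π := by gcongr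
    _ = π / 2 := by ring

/-- `cos x = ± cos (redPi x)`, `sin x = ± sin (redPi x)` with the same sign. [folklore] -/
private theorem sc_redPi_sign (x : ℝ) :
    ∃ ε : ℝ, (ε = 1 ∨ ε = -1) ∧ cos x = ε * cos (redPi x) ∧ sin x = ε * sin (redPi x) := by
  have hx : x = redPi x + (round (x / π) : ℤ) * π := (sc_redPi_add x).symm
  refine ⟨(-1 : ℝ) ^ (round (x / π)), ?_, ?_, ?_⟩
  · rcases Int.even_or_odd (round (x / π)) with h | h
    · left; exact h.neg_one_zpow
    · right; exact h.neg_one_zpow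
  · conv_lhs => rw [hx]
    rw [Real.cos_add_int_mul_pi]
  · conv_lhs => rw [hx]
    rw [Real.sin_add_int_mul_pi]

/-- Auxiliary step of the proof of `Lemma6SectorCounting_holds`. [folklore] -/
private theorem sc_abs_sin_redPi (x : ℝ) : |sin (redPi x)| = |sin x| := by
  obtain ⟨ε, hε, -, hs⟩ := sc_redPi_sign x
  rcases hε with h | h <;> simp [hs, h]

/-- Auxiliary step of the proof of `Lemma6SectorCounting_holds`. [folklore] -/
private theorem sc_abs_cos_redPi (x : ℝ) : |cos (redPi x)| = |cos x| := by
  obtain ⟨ε, hε, hc, -⟩ := sc_redPi_sign x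
  rcases hε with h | h <;> simp [hc, h]

/-- Auxiliary step of the proof of `Lemma6SectorCounting_holds`. [folklore] -/
private theorem sc_cos_redPi_nonneg (x : ℝ) : 0 ≤ cos (redPi x) :=
  cos_nonneg_of_neg_pi_div_two_le_of_le (by linarith [abs_le.1 (sc_abs_redPi_le x)])
    (abs_le.1 (sc_abs_redPi_le x)).2

/-- `|redPi x| ≤ (π/2)|sin x|`: the distance to `πℤ` is controlled by `|sin|`. [folklore] -/
private theorem sc_abs_redPi_le_sin (x : ℝ) : |redPi x| ≤ π / 2 * |sin x| := by
  rw [← sc_abs_sin_redPi]; exact sc_abs_le_pi_div_two_mul_abs_sin (sc_abs_redPi_le x)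

/-- The integer `round ((s - c)/π)` of a point of an interval lies in an explicit integer interval.
[folklore] -/
private theorem sc_round_mem_Icc {s c a b : ℝ} (hs : s ∈ Set.Icc a b) :
    round ((s - c) / π) ∈ Finset.Icc ⌈(a - c) / π - 1 / 2⌉ ⌊(b - c) / π + 1 / 2⌋ := by
  have h := abs_le.1 (abs_sub_round ((s - c) / π))
  have hpi := pi_pos
  rw [Finset.mem_Icc]
  constructor
  · apply Int.ceil_le.2
    have : (a - c) / π ≤ (s - c) / π := by gcongr; exact hs.1
    linarith
  · apply Int.le_floor.2
    have : (s - c) / π ≤ (b - c) / π := by gcongr; exact hs.2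
    linarith

/-- … and that integer interval has at most four elements when the real interval has length `≤ 2π`.
[folklore] -/
private theorem sc_card_Icc_le {c a b : ℝ} (hab : b - a ≤ 2 * π) :
    ((Finset.Icc ⌈(a - c) / π - 1 / 2⌉ ⌊(b - c) / π + 1 / 2⌋).card : ℝ) ≤ 4 := by
  rw [Int.card_Icc]
  have hpi := pi_pos
  have h1 : (⌊(b - c) / π + 1 / 2⌋ : ℝ) ≤ (b - c) / π + 1 / 2 := Int.floor_le _
  have h2 : (a - c) / π - 1 / 2 ≤ (⌈(a - c) / π - 1 / 2⌉ : ℝ) := Int.le_ceil _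
  have h3 : (b - c) / π - (a - c) / π = (b - a) / π := by ring
  have h4 : (b - a) / π ≤ 2 := by rw [div_le_iff₀ hpi]; linarith
  have key : ((⌊(b - c) / π + 1 / 2⌋ + 1 - ⌈(a - c) / π - 1 / 2⌉ : ℤ) : ℝ) ≤ 4 := by
    push_cast; linarith
  rcases le_or_gt 0 (⌊(b - c) / π + 1 / 2⌋ + 1 - ⌈(a - c) / π - 1 / 2⌉) with h | h
  · have : ((⌊(b - c) / π + 1 / 2⌋ + 1 - ⌈(a - c) / π - 1 / 2⌉).toNat : ℤ) =
        ⌊(b - c) / π + 1 / 2⌋ + 1 - ⌈(a - c) / π - 1 / 2⌉ := Int.toNat_of_nonneg h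
    have key' : (((⌊(b - c) / π + 1 / 2⌋ + 1 - ⌈(a - c) / π - 1 / 2⌉).toNat : ℤ) : ℝ) ≤ 4 := by
      rw [this]; exact key
    exact_mod_cast key'
  · rw [Int.toNat_eq_zero.2 h.le]; norm_num

/-! ### §1 Compatible momenta in angular form -/

/-- Auxiliary step of the proof of `Lemma6SectorCounting_holds`. [folklore] -/
private theorem sc_norm_momToComplex (k : Fin 2 → ℝ) :
    ‖momToComplex k‖ = Real.sqrt (k 0 ^ 2 + k 1 ^ 2) := by
  rw [Complex.norm_eq_sqrt_sq_add_sq, momToComplex_re, momToComplex_im]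

/-- `w = α^{-1/4}`: positivity, `w ≤ 1`, `w² = 1/√α`, `α^{1/4} = w⁻¹`. [folklore] -/
private theorem sc_w_facts {α : ℝ} (hα : 1 ≤ α) :
    0 < α ^ (-(1 / 4 : ℝ)) ∧ α ^ (-(1 / 4 : ℝ)) ≤ 1 ∧
      (α ^ (-(1 / 4 : ℝ))) ^ 2 = 1 / Real.sqrt α ∧ α ^ (1 / 4 : ℝ) = (α ^ (-(1 / 4 : ℝ)))⁻¹ := by
  have hα0 : 0 < α := by linarith
  refine ⟨Real.rpow_pos_of_pos hα0 _, ?_, ?_, ?_⟩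
  · exact Real.rpow_le_one_of_one_le_of_nonpos hα (by norm_num)
  · rw [← Real.rpow_natCast, ← Real.rpow_mul hα0.le, Real.sqrt_eq_rpow, one_div (α ^ (1 / 2 : ℝ)),
      ← Real.rpow_neg hα0.le]
    norm_num
  · rw [Real.rpow_neg hα0.le, inv_inv]

/-- **Compatible momenta, angular form.**  From `MomentaCompatible α θs` we extract radii `ρ_i` with
`|ρ_i - 1| ≤ w²` and angles `ψ_i` with `|cos(ψ_i - c) - cos(θ_i - c)| ≤ w (|sin(θ_i - c)| + w)`,
`|sin(ψ_i - c) - sin(θ_i - c)| ≤ w` for every reference angle `c`, and momentum conservation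
`Σ ρ_i cos(ψ_i - c) = Σ ρ_i sin(ψ_i - c) = 0`.
[cite: DisertoriRivasseau2000, §IV.3 Lemma 6 p0014:L9–20; App. B p0017:L30–35] -/
private theorem compat_extract {α : ℝ} (hα : 1 ≤ α) {m : ℕ} {θs : Fin m → ℝ}
    (h : MomentaCompatible α θs) :
    ∃ ρ ψ : Fin m → ℝ,
      (∀ i, |ρ i - 1| ≤ (α ^ (-(1 / 4 : ℝ))) ^ 2) ∧
      (∀ i c, |cos (ψ i - c) - cos (θs i - c)| ≤
        α ^ (-(1 / 4 : ℝ)) * (|sin (θs i - c)| + α ^ (-(1 / 4 : ℝ)))) ∧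
      (∀ i c, |sin (ψ i - c) - sin (θs i - c)| ≤ α ^ (-(1 / 4 : ℝ))) ∧
      (∀ c, ∑ i, ρ i * cos (ψ i - c) = 0) ∧ (∀ c, ∑ i, ρ i * sin (ψ i - c) = 0) := by
  obtain ⟨hw0, hw1, hw2, -⟩ := sc_w_facts hα
  set w := α ^ (-(1 / 4 : ℝ)) with hw
  obtain ⟨k, hsum, hk⟩ := h
  refine ⟨fun i => ‖momToComplex (k i)‖, fun i => polarAngle (k i), ?_, ?_, ?_, ?_, ?_⟩
  · intro i
    show |‖momToComplex (k i)‖ - 1| ≤ w ^ 2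
    rw [sc_norm_momToComplex, hw2]; exact (hk i).1
  · intro i c
    obtain ⟨n, hn⟩ := (hk i).2
    -- `a = ψ - c`, `b = θ + 2πn - c`, `|a - b| ≤ w`
    set a := polarAngle (k i) - c with ha
    set b := θs i + 2 * π * n - c with hb
    have hab : |a - b| ≤ w := by
      have : a - b = polarAngle (k i) - θs i - 2 * π * n := by rw [ha, hb]; ring
      rw [this]; exact hn
    have hcosb : cos (θs i - c) = cos b := by
      have : b = θs i - c + n * (2 * π) := by rw [hb]; ring
      rw [this, Real.cos_add_int_mul_two_pi]
    have hsinb : sin (θs i - c) = sin b := by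
      have : b = θs i - c + n * (2 * π) := by rw [hb]; ring
      rw [this, Real.sin_add_int_mul_two_pi]
    rw [hcosb, hsinb, Real.cos_sub_cos]
    have h1 : |sin ((a - b) / 2)| ≤ w / 2 := by
      calc |sin ((a - b) / 2)| ≤ |(a - b) / 2| := abs_sin_le_abs
        _ = |a - b| / 2 := by rw [abs_div, abs_two]
        _ ≤ w / 2 := by gcongr
    have h2 : |sin ((a + b) / 2)| ≤ |sin b| + w / 2 := by
      have : (a + b) / 2 = b + (a - b) / 2 := by ring
      rw [this]
      calc |sin (b + (a - b) / 2)| ≤ |sin b| + |sin ((a - b) / 2)| := sc_abs_sin_add_le _ _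
        _ ≤ |sin b| + w / 2 := by gcongr
    calc |(-2) * sin ((a + b) / 2) * sin ((a - b) / 2)|
        = 2 * (|sin ((a + b) / 2)| * |sin ((a - b) / 2)|) := by
          rw [abs_mul, abs_mul]; norm_num; ring
      _ ≤ 2 * ((|sin b| + w / 2) * (w / 2)) := by gcongr
      _ ≤ w * (|sin b| + w) := by nlinarith [abs_nonneg (sin b)]
  · intro i c
    obtain ⟨n, hn⟩ := (hk i).2
    have hsinb : sin (θs i - c) = sin (θs i + 2 * π * n - c) := by
      have : θs i + 2 * π * n - c = θs i - c + n * (2 * π) := by ring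
      rw [this, Real.sin_add_int_mul_two_pi]
    rw [hsinb]
    calc |sin (polarAngle (k i) - c) - sin (θs i + 2 * π * ↑n - c)|
        ≤ |polarAngle (k i) - c - (θs i + 2 * π * ↑n - c)| := sc_abs_sin_sub_sin_le _ _
      _ = |polarAngle (k i) - θs i - 2 * π * n| := by ring_nf
      _ ≤ w := hn
  · intro c
    have h0 : ∑ i, k i 0 = 0 := by
      have := congrArg (fun f : Fin 2 → ℝ => f 0) hsum; simpa [Finset.sum_apply] using this
    have h1 : ∑ i, k i 1 = 0 := by
      have := congrArg (fun f : Fin 2 → ℝ => f 1) hsum; simpa [Finset.sum_apply] using this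
    have : ∀ i, ‖momToComplex (k i)‖ * cos (polarAngle (k i) - c) =
        cos c * k i 0 + sin c * k i 1 := by
      intro i
      rw [cos_sub, ← norm_mul_cos_polarAngle (k i), ← norm_mul_sin_polarAngle (k i)]; ring
    simp_rw [this, Finset.sum_add_distrib, ← Finset.mul_sum, h0, h1]; ring
  · intro c
    have h0 : ∑ i, k i 0 = 0 := by
      have := congrArg (fun f : Fin 2 → ℝ => f 0) hsum; simpa [Finset.sum_apply] using this
    have h1 : ∑ i, k i 1 = 0 := by
      have := congrArg (fun f : Fin 2 → ℝ => f 1) hsum; simpa [Finset.sum_apply] using this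
    have : ∀ i, ‖momToComplex (k i)‖ * sin (polarAngle (k i) - c) =
        cos c * k i 1 - sin c * k i 0 := by
      intro i
      rw [sin_sub, ← norm_mul_cos_polarAngle (k i), ← norm_mul_sin_polarAngle (k i)]; ring
    simp_rw [this, Finset.sum_sub_distrib, ← Finset.mul_sum, h0, h1]; ring

/-! ### §2 Consequences of momentum conservation for the sector centres -/

section Consequences

variable {m : ℕ} {w : ℝ} {θs ρ ψ : Fin m → ℝ}

/-- The packaged output of `compat_extract`, as a hypothesis of this section. [folklore] -/
private def AngularData (w : ℝ) (θs ρ ψ : Fin m → ℝ) : Prop :=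
  (∀ i, |ρ i - 1| ≤ w ^ 2) ∧
  (∀ i c, |cos (ψ i - c) - cos (θs i - c)| ≤ w * (|sin (θs i - c)| + w)) ∧
  (∀ i c, |sin (ψ i - c) - sin (θs i - c)| ≤ w) ∧
  (∀ c, ∑ i, ρ i * cos (ψ i - c) = 0) ∧ (∀ c, ∑ i, ρ i * sin (ψ i - c) = 0)

/-- Auxiliary step of the proof of `Lemma6SectorCounting_holds`. [folklore] -/
private theorem angularData_of_compat {α : ℝ} (hα : 1 ≤ α) {m : ℕ} {θs : Fin m → ℝ}
    (h : MomentaCompatible α θs) : ∃ ρ ψ, AngularData (α ^ (-(1 / 4 : ℝ))) θs ρ ψ := by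
  obtain ⟨ρ, ψ, h1, h2, h3, h4, h5⟩ := compat_extract hα h
  exact ⟨ρ, ψ, h1, h2, h3, h4, h5⟩

/-- **The centre sums along a direction in which all legs are `B`-aligned.**  If
`|sin(θ_i - c)| ≤ B` for all legs then `|Σ_i cos(θ_i - c)| ≤ m·w·(B + 2w)`.
[cite: DisertoriRivasseau2000, App. B p0017:L120–145] -/
private theorem ad_sum_cos_le (hd : AngularData w θs ρ ψ) (hw : 0 ≤ w) {c B : ℝ}
    (hB : ∀ i, |sin (θs i - c)| ≤ B) :
    |∑ i, cos (θs i - c)| ≤ m * (w * (B + 2 * w)) := by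
  obtain ⟨hρ, hcos, -, hsc, -⟩ := hd
  have key : ∑ i, cos (θs i - c) = ∑ i, ((cos (θs i - c) - cos (ψ i - c)) + (1 - ρ i) * cos (ψ i - c)) := by
    have h0 := hsc c
    rw [← sub_zero (∑ i, cos (θs i - c)), ← h0, ← Finset.sum_sub_distrib]
    apply Finset.sum_congr rfl; intro i _; ring
  rw [key]
  calc |∑ i, ((cos (θs i - c) - cos (ψ i - c)) + (1 - ρ i) * cos (ψ i - c))|
      ≤ ∑ i, |(cos (θs i - c) - cos (ψ i - c)) + (1 - ρ i) * cos (ψ i - c)| := Finset.abs_sum_le_sum_abs _ _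
    _ ≤ ∑ _i : Fin m, w * (B + 2 * w) := by
        apply Finset.sum_le_sum; intro i _
        calc |(cos (θs i - c) - cos (ψ i - c)) + (1 - ρ i) * cos (ψ i - c)|
            ≤ |cos (θs i - c) - cos (ψ i - c)| + |(1 - ρ i) * cos (ψ i - c)| := abs_add_le _ _
          _ ≤ w * (|sin (θs i - c)| + w) + w ^ 2 * 1 := by
              gcongr
              · rw [abs_sub_comm]; exact hcos i c
              · rw [abs_mul]
                gcongr
                · rw [abs_sub_comm]; exact hρ i
                · exact abs_cos_le_one _
          _ ≤ w * (B + w) + w ^ 2 * 1 := by gcongr; exact hB i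
          _ = w * (B + 2 * w) := by ring
    _ = m * (w * (B + 2 * w)) := by simp

/-- The centre sums in the perpendicular direction: `|Σ_i sin(θ_i - c)| ≤ 2 m w` (`w ≤ 1`).
[cite: DisertoriRivasseau2000, App. B p0017:L120–145] -/
private theorem ad_sum_sin_le (hd : AngularData w θs ρ ψ) (hw : 0 ≤ w) (hw1 : w ≤ 1) (c : ℝ) :
    |∑ i, sin (θs i - c)| ≤ 2 * m * w := by
  obtain ⟨hρ, -, hsin, -, hss⟩ := hd
  have key : ∑ i, sin (θs i - c) = ∑ i, ((sin (θs i - c) - sin (ψ i - c)) + (1 - ρ i) * sin (ψ i - c)) := by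
    have h0 := hss c
    rw [← sub_zero (∑ i, sin (θs i - c)), ← h0, ← Finset.sum_sub_distrib]
    apply Finset.sum_congr rfl; intro i _; ring
  rw [key]
  calc |∑ i, ((sin (θs i - c) - sin (ψ i - c)) + (1 - ρ i) * sin (ψ i - c))|
      ≤ ∑ i, |(sin (θs i - c) - sin (ψ i - c)) + (1 - ρ i) * sin (ψ i - c)| := Finset.abs_sum_le_sum_abs _ _
    _ ≤ ∑ _i : Fin m, 2 * w := by
        apply Finset.sum_le_sum; intro i _
        calc |(sin (θs i - c) - sin (ψ i - c)) + (1 - ρ i) * sin (ψ i - c)|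
            ≤ |sin (θs i - c) - sin (ψ i - c)| + |(1 - ρ i) * sin (ψ i - c)| := abs_add_le _ _
          _ ≤ w + w ^ 2 * 1 := by
              gcongr
              · rw [abs_sub_comm]; exact hsin i c
              · rw [abs_mul]
                gcongr
                · rw [abs_sub_comm]; exact hρ i
                · exact abs_sin_le_one _
          _ ≤ 2 * w := by nlinarith
    _ = 2 * m * w := by simp; ring

/-- The crude bound along any direction: `|Σ_i cos(θ_i - c)| ≤ 3 m w` (`w ≤ 1`). [folklore] -/
private theorem ad_sum_cos_le_crude (hd : AngularData w θs ρ ψ) (hw : 0 ≤ w) (hw1 : w ≤ 1) (c : ℝ) :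
    |∑ i, cos (θs i - c)| ≤ 3 * m * w := by
  have h := ad_sum_cos_le hd hw (c := c) (B := 1) (fun i => abs_sin_le_one _)
  calc |∑ i, cos (θs i - c)| ≤ m * (w * (1 + 2 * w)) := h
    _ ≤ m * (w * 3) := by gcongr; linarith
    _ = 3 * m * w := by ring

/-- Two legs: `|sin(ψ_i - ψ_j)| ≤ |sin(θ_i - θ_j)| + 2w`. [folklore] -/
private theorem ad_sin_psi_sub_psi (hd : AngularData w θs ρ ψ) (i j : Fin m) :
    |sin (ψ i - ψ j)| ≤ |sin (θs i - θs j)| + 2 * w := by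
  obtain ⟨-, -, hsin, -, -⟩ := hd
  have h1 : |sin (ψ i - ψ j) - sin (θs i - ψ j)| ≤ w := hsin i (ψ j)
  have h2 : |sin (ψ j - θs i) - sin (θs j - θs i)| ≤ w := hsin j (θs i)
  have h2' : |sin (θs i - ψ j) - sin (θs i - θs j)| ≤ w := by
    have e1 : sin (θs i - ψ j) = -sin (ψ j - θs i) := by rw [← sin_neg]; ring_nf
    have e2 : sin (θs i - θs j) = -sin (θs j - θs i) := by rw [← sin_neg]; ring_nf
    rw [e1, e2, ← abs_neg]; ring_nf; ring_nf at h2; exact h2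
  have := abs_sub_abs_le_abs_sub (sin (ψ i - ψ j)) (sin (θs i - ψ j))
  have := abs_sub_abs_le_abs_sub (sin (θs i - ψ j)) (sin (θs i - θs j))
  linarith

/-- Two legs, symmetric form: `|sin(θ_i - θ_j)| ≤ |sin(ψ_i - ψ_j)| + 2w`. [folklore] -/
private theorem ad_sin_theta_sub_theta (hd : AngularData w θs ρ ψ) (i j : Fin m) :
    |sin (θs i - θs j)| ≤ |sin (ψ i - ψ j)| + 2 * w := by
  obtain ⟨-, -, hsin, -, -⟩ := hd
  have h1 : |sin (ψ i - ψ j) - sin (θs i - ψ j)| ≤ w := hsin i (ψ j)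
  have h2 : |sin (ψ j - θs i) - sin (θs j - θs i)| ≤ w := hsin j (θs i)
  have h2' : |sin (θs i - ψ j) - sin (θs i - θs j)| ≤ w := by
    have e1 : sin (θs i - ψ j) = -sin (ψ j - θs i) := by rw [← sin_neg]; ring_nf
    have e2 : sin (θs i - θs j) = -sin (θs j - θs i) := by rw [← sin_neg]; ring_nf
    rw [e1, e2, ← abs_neg]; ring_nf; ring_nf at h2; exact h2
  have := abs_sub_abs_le_abs_sub (sin (θs i - ψ j)) (sin (ψ i - ψ j))
  have := abs_sub_abs_le_abs_sub (sin (θs i - θs j)) (sin (θs i - ψ j))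
  rw [abs_sub_comm] at h1 h2'
  linarith

end Consequences

section Alignment

variable {l' : ℕ} {w : ℝ} {θs ρ ψ : Fin (l' + 1) → ℝ}

/-- **Alignment of the fixed leg by momentum conservation** (App. B: «since `k_1 = -Σ_{j≥2} k_j` we can
check that `max_j ∠(k'_1,k'_j) ≤ l O(2^{-i})`»; BGM 2003 (s1.34)): if every integrated centre is within
`φ` of the centre `θ_p` modulo `π` (in the sense `|sin(θ_i - θ_p)| ≤ φ`), then so is the fixed centre
`θ_0`, up to the factor `2l'`: `|sin(θ_0 - θ_p)| ≤ 2l'(φ + 2w) + 2w`.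
[cite: DisertoriRivasseau2000, App. B p0017:L136–140] -/
private theorem ad_align_zero (hd : AngularData w θs ρ ψ) (hw : 0 ≤ w) (hw2 : w ^ 2 ≤ 1 / 3)
    (p : Fin l') {φ : ℝ} (hφ : ∀ i : Fin l', |sin (θs i.succ - θs p.succ)| ≤ φ) :
    |sin (θs 0 - θs p.succ)| ≤ 2 * l' * (φ + 2 * w) + 2 * w := by
  have hρ := hd.1
  have hss := hd.2.2.2.2
  -- conservation in the direction perpendicular to `ψ_p`
  have hcons : ρ 0 * sin (ψ 0 - ψ p.succ) = -∑ i : Fin l', ρ i.succ * sin (ψ i.succ - ψ p.succ) := by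
    have h := hss (ψ p.succ)
    rw [Fin.sum_univ_succ] at h; linarith
  have hterm : ∀ i : Fin l', |ρ i.succ * sin (ψ i.succ - ψ p.succ)| ≤ (1 + w ^ 2) * (φ + 2 * w) := by
    intro i
    rw [abs_mul]
    have hρi : |ρ i.succ| ≤ 1 + w ^ 2 := by
      have := abs_le.1 (hρ i.succ)
      rw [abs_le]; constructor <;> nlinarith
    have hs : |sin (ψ i.succ - ψ p.succ)| ≤ φ + 2 * w :=
      (ad_sin_psi_sub_psi hd i.succ p.succ).trans (by linarith [hφ i])
    exact mul_le_mul hρi hs (abs_nonneg _) (by positivity)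
  have hsum : |ρ 0 * sin (ψ 0 - ψ p.succ)| ≤ l' * ((1 + w ^ 2) * (φ + 2 * w)) := by
    rw [hcons, abs_neg]
    calc |∑ i : Fin l', ρ i.succ * sin (ψ i.succ - ψ p.succ)|
        ≤ ∑ i : Fin l', |ρ i.succ * sin (ψ i.succ - ψ p.succ)| := Finset.abs_sum_le_sum_abs _ _
      _ ≤ ∑ _i : Fin l', (1 + w ^ 2) * (φ + 2 * w) := Finset.sum_le_sum fun i _ => hterm i
      _ = l' * ((1 + w ^ 2) * (φ + 2 * w)) := by simp
  have hρ0 : 1 - w ^ 2 ≤ ρ 0 := by have := abs_le.1 (hρ 0); linarith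
  have hρ0pos : 0 < ρ 0 := by linarith
  have hφ0 : 0 ≤ φ := le_trans (abs_nonneg _) (hφ p)
  have h1 : |sin (ψ 0 - ψ p.succ)| ≤ 2 * l' * (φ + 2 * w) := by
    rw [abs_mul, abs_of_pos hρ0pos] at hsum
    -- `ρ₀ |sin| ≤ l'(1+w²)(φ+2w)` and `(1+w²) ≤ 2(1-w²) ≤ 2ρ₀`
    have hkey : ρ 0 * |sin (ψ 0 - ψ p.succ)| ≤ ρ 0 * (2 * l' * (φ + 2 * w)) := by
      calc ρ 0 * |sin (ψ 0 - ψ p.succ)| ≤ l' * ((1 + w ^ 2) * (φ + 2 * w)) := hsum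
        _ ≤ l' * ((2 * ρ 0) * (φ + 2 * w)) := by
            gcongr
            nlinarith
        _ = ρ 0 * (2 * l' * (φ + 2 * w)) := by ring
    exact le_of_mul_le_mul_left hkey hρ0pos
  calc |sin (θs 0 - θs p.succ)| ≤ |sin (ψ 0 - ψ p.succ)| + 2 * w := ad_sin_theta_sub_theta hd 0 p.succ
    _ ≤ 2 * l' * (φ + 2 * w) + 2 * w := by linarith

/-- Consequently EVERY centre is within `2l(φ + 2w)` of `θ_0` modulo `π` (`l = l' + 1`).
[cite: DisertoriRivasseau2000, App. B p0017:L120–140] -/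
private theorem ad_align_all (hd : AngularData w θs ρ ψ) (hw : 0 ≤ w) (hw2 : w ^ 2 ≤ 1 / 3)
    (p : Fin l') {φ : ℝ} (hφ : ∀ i : Fin l', |sin (θs i.succ - θs p.succ)| ≤ φ) (j : Fin (l' + 1)) :
    |sin (θs j - θs 0)| ≤ 2 * ((l' : ℝ) + 1) * (φ + 2 * w) := by
  have hφ0 : 0 ≤ φ := le_trans (abs_nonneg _) (hφ p)
  have h0 := ad_align_zero hd hw hw2 p hφ
  refine Fin.cases ?_ (fun i => ?_) j
  · simp only [sub_self, sin_zero, abs_zero]; positivity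
  · have e : θs i.succ - θs 0 = (θs i.succ - θs p.succ) + (θs p.succ - θs 0) := by ring
    rw [e]
    calc |sin ((θs i.succ - θs p.succ) + (θs p.succ - θs 0))|
        ≤ |sin (θs i.succ - θs p.succ)| + |sin (θs p.succ - θs 0)| := sc_abs_sin_add_le _ _
      _ ≤ φ + (2 * l' * (φ + 2 * w) + 2 * w) := by
          gcongr
          · exact hφ i
          · have : sin (θs p.succ - θs 0) = -sin (θs 0 - θs p.succ) := by rw [← sin_neg]; ring_nf
            rw [this, abs_neg]; exact h0
      _ ≤ 2 * ((l' : ℝ) + 1) * (φ + 2 * w) := by nlinarith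

/-- **The second-order bound along the common direction** (App. B: the `x`-components of `k_j - r_j`
are `O(2^{-i} α^{-1/4})`; BGM 2003 (s1.38)–(s1.40)): `|Σ_j cos(θ_j - θ_0)| ≤ 2 l² w (φ + 3w)`.
[cite: DisertoriRivasseau2000, App. B p0017:L141–150] -/
private theorem ad_sum_cos_refined (hd : AngularData w θs ρ ψ) (hw : 0 ≤ w) (hw2 : w ^ 2 ≤ 1 / 3)
    (p : Fin l') {φ : ℝ} (hφ : ∀ i : Fin l', |sin (θs i.succ - θs p.succ)| ≤ φ) :
    |∑ j, cos (θs j - θs 0)| ≤ 2 * ((l' : ℝ) + 1) ^ 2 * w * (φ + 3 * w) := by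
  have hφ0 : 0 ≤ φ := le_trans (abs_nonneg _) (hφ p)
  have h := ad_sum_cos_le hd hw (c := θs 0) (B := 2 * ((l' : ℝ) + 1) * (φ + 2 * w))
    (fun j => ad_align_all hd hw hw2 p hφ j)
  have hl : (1 : ℝ) ≤ (l' : ℝ) + 1 := by have := Nat.cast_nonneg (α := ℝ) l'; linarith
  calc |∑ j, cos (θs j - θs 0)| ≤ ↑(l' + 1) * (w * (2 * ((l' : ℝ) + 1) * (φ + 2 * w) + 2 * w)) := h
    _ = ((l' : ℝ) + 1) * (w * (2 * ((l' : ℝ) + 1) * (φ + 2 * w) + 2 * w)) := by push_cast; ring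
    _ ≤ ((l' : ℝ) + 1) * (w * (2 * ((l' : ℝ) + 1) * (φ + 2 * w) + 2 * ((l' : ℝ) + 1) * w)) := by
        gcongr; nlinarith
    _ = 2 * ((l' : ℝ) + 1) ^ 2 * w * (φ + 3 * w) := by ring

end Alignment

/-! ### §3 The explicit closed sets `G_{pq}` and the pointwise bound `Υ ≤ Σ 1_{G_{pq}}` -/

section Gsets

variable {l' : ℕ}

/-- The smallness threshold `1/(200 l)` of the near-parallel regime. [folklore] -/
private def thr (l' : ℕ) : ℝ := 1 / (200 * ((l' : ℝ) + 1))

/-- The explicit set `G_{pq}` of integrated centres: inside the box, centre sums `≤ 3lw`, and — in the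
near-parallel regime `|sin(θ_p - θ_q)| ≤ 1/(200 l)`, `w ≤ 1/(200 l)` — alignment of `θ_p, θ_q` with `θ₁`
and the second-order bound on the sum along `θ₁`. [folklore] -/
private def secG (l' : ℕ) (w θ₁ : ℝ) (a b : Fin l' → ℝ) (p q : Fin l') : Set (Fin l' → ℝ) :=
  {θ | (∀ i, a i ≤ θ i ∧ θ i ≤ b i) ∧
    |1 + ∑ i, cos (θ i - θ₁)| ≤ 3 * ((l' : ℝ) + 1) * w ∧
    |∑ i, sin (θ i - θ₁)| ≤ 3 * ((l' : ℝ) + 1) * w ∧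
    (|sin (θ p - θ q)| ≤ thr l' → w ≤ thr l' →
      |sin (θ p - θ₁)| ≤ 2 * ((l' : ℝ) + 1) * (|sin (θ p - θ q)| + 2 * w) ∧
      |sin (θ q - θ₁)| ≤ 2 * ((l' : ℝ) + 1) * (|sin (θ p - θ q)| + 2 * w) ∧
      |1 + ∑ i, cos (θ i - θ₁)| ≤ 2 * ((l' : ℝ) + 1) ^ 2 * w * (|sin (θ p - θ q)| + 3 * w))}

/-- **Pointwise bound.**  A compatible family of centres inside the box lies in `G_{pq}` for the pair
`(p,q)` of integrated legs maximising `|sin(θ_p - θ_q)|` (App. B: the pair with «angle as close as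
possible to π/2»). [cite: DisertoriRivasseau2000, App. B p0017:L30–45] -/
private theorem mem_secG_of_compat {α : ℝ} (hα : 1 ≤ α) (hl : 2 ≤ l') {θ₁ : ℝ} {a b : Fin l' → ℝ}
    {θ : Fin l' → ℝ} (hbox : ∀ i, a i ≤ θ i ∧ θ i ≤ b i)
    (hc : MomentaCompatible α (Fin.cons θ₁ θ : Fin (l' + 1) → ℝ)) :
    ∃ pq ∈ (Finset.univ : Finset (Fin l')).offDiag,
      θ ∈ secG l' (α ^ (-(1 / 4 : ℝ))) θ₁ a b pq.1 pq.2 := by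
  obtain ⟨hw0, hw1, -, -⟩ := sc_w_facts hα
  set w := α ^ (-(1 / 4 : ℝ)) with hw
  obtain ⟨ρ, ψ, hd⟩ := angularData_of_compat hα hc
  -- the max-angle pair
  have hne : ((Finset.univ : Finset (Fin l')).offDiag).Nonempty := by
    refine ⟨(⟨0, by omega⟩, ⟨1, by omega⟩), ?_⟩
    simp [Finset.mem_offDiag, Fin.ext_iff]
  obtain ⟨pq, hpq, hmax⟩ := Finset.exists_max_image _ (fun z : Fin l' × Fin l' => |sin (θ z.1 - θ z.2)|) hne
  refine ⟨pq, hpq, ?_⟩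
  set p := pq.1
  set q := pq.2
  set φ := |sin (θ p - θ q)| with hφ
  have hmax' : ∀ i j : Fin l', |sin (θ i - θ j)| ≤ φ := by
    intro i j
    by_cases hij : i = j
    · rw [hij, sub_self, sin_zero, abs_zero]; exact abs_nonneg _
    · exact hmax (i, j) (by simp [Finset.mem_offDiag, hij])
  -- translate to the `Fin.cons` indexing
  set θs : Fin (l' + 1) → ℝ := Fin.cons θ₁ θ with hθs
  have hθ0 : θs 0 = θ₁ := by simp [hθs]
  have hθsucc : ∀ i : Fin l', θs i.succ = θ i := by intro i; simp [hθs]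
  have hφ' : ∀ i : Fin l', |sin (θs i.succ - θs p.succ)| ≤ φ := by
    intro i; rw [hθsucc, hθsucc]; exact hmax' i p
  have hsumcos : ∑ j, cos (θs j - θs 0) = 1 + ∑ i, cos (θ i - θ₁) := by
    rw [Fin.sum_univ_succ]; simp [hθ0, hθsucc]
  have hsumsin : ∑ j, sin (θs j - θs 0) = ∑ i, sin (θ i - θ₁) := by
    rw [Fin.sum_univ_succ]; simp [hθ0, hθsucc]
  have hm : ((l' + 1 : ℕ) : ℝ) = (l' : ℝ) + 1 := by push_cast; ring
  refine ⟨hbox, ?_, ?_, ?_⟩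
  · have h := ad_sum_cos_le_crude hd hw0.le hw1 (θs 0)
    rw [hsumcos, hm] at h; exact h
  · have h := ad_sum_sin_le hd hw0.le hw1 (θs 0)
    rw [hsumsin] at h
    calc |∑ i, sin (θ i - θ₁)| ≤ 2 * ((l' + 1 : ℕ) : ℝ) * w := h
      _ ≤ 3 * ((l' : ℝ) + 1) * w := by rw [hm]; nlinarith
  · intro _ hwthr
    have hw2 : w ^ 2 ≤ 1 / 3 := by
      have hl1 : (1 : ℝ) ≤ (l' : ℝ) + 1 := by have := Nat.cast_nonneg (α := ℝ) l'; linarith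
      have : thr l' ≤ 1 / 200 := by
        unfold thr; rw [div_le_div_iff₀ (by positivity) (by norm_num)]; nlinarith
      nlinarith
    refine ⟨?_, ?_, ?_⟩
    · have h := ad_align_all hd hw0.le hw2 p hφ' p.succ
      rwa [hθsucc, hθ0] at h
    · have h := ad_align_all hd hw0.le hw2 p hφ' q.succ
      rwa [hθsucc, hθ0] at h
    · have h := ad_sum_cos_refined hd hw0.le hw2 p hφ'
      rwa [hsumcos] at h

end Gsets

/-! ### §4 The parallelogram analysis on the circle: two-point estimates -/

section TwoPoint

/-- `sin p + sin q = 2 sin((p+q)/2) cos((p-q)/2)`. [folklore] -/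
private theorem sc_sin_add_sin (p q : ℝ) : sin p + sin q = 2 * sin ((p + q) / 2) * cos ((p - q) / 2) := by
  have h := Real.sin_sub_sin p (-q)
  simp only [sin_neg, sub_neg_eq_add] at h
  rw [h]; ring_nf

/-- `|cos σ₁ - cos σ₂| ≤ ((|σ₁| + |σ₂|)/2) |σ₁ - σ₂|` (second-order smallness near `0`). [folklore] -/
private theorem sc_abs_cos_sub_cos_le_mul (σ₁ σ₂ : ℝ) :
    |cos σ₁ - cos σ₂| ≤ (|σ₁| + |σ₂|) / 2 * |σ₁ - σ₂| := by
  rw [Real.cos_sub_cos]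
  have h1 : |sin ((σ₁ + σ₂) / 2)| ≤ (|σ₁| + |σ₂|) / 2 := by
    calc |sin ((σ₁ + σ₂) / 2)| ≤ |(σ₁ + σ₂) / 2| := abs_sin_le_abs
      _ = |σ₁ + σ₂| / 2 := by rw [abs_div, abs_two]
      _ ≤ (|σ₁| + |σ₂|) / 2 := by gcongr; exact abs_add_le _ _
  have h2 : |sin ((σ₁ - σ₂) / 2)| ≤ |σ₁ - σ₂| / 2 := by
    calc |sin ((σ₁ - σ₂) / 2)| ≤ |(σ₁ - σ₂) / 2| := abs_sin_le_abs
      _ = |σ₁ - σ₂| / 2 := by rw [abs_div, abs_two]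
  calc |(-2) * sin ((σ₁ + σ₂) / 2) * sin ((σ₁ - σ₂) / 2)|
      = 2 * (|sin ((σ₁ + σ₂) / 2)| * |sin ((σ₁ - σ₂) / 2)|) := by
        rw [abs_mul, abs_mul]; norm_num; ring
    _ ≤ 2 * ((|σ₁| + |σ₂|) / 2 * (|σ₁ - σ₂| / 2)) := by gcongr
    _ = (|σ₁| + |σ₂|) / 2 * |σ₁ - σ₂| := by ring

/-- Lower bound `|cos a - cos b| ≥ (2/π²)(a + b)|a - b|` for `a, b ∈ [0, π/2]`. [folklore] -/
private theorem sc_cos_sub_cos_lower {a b : ℝ} (ha : 0 ≤ a) (hb : 0 ≤ b) (ha' : a ≤ π / 2) (hb' : b ≤ π / 2) :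
    2 / π ^ 2 * (a + b) * |a - b| ≤ |cos a - cos b| := by
  rw [Real.cos_sub_cos]
  have hpi := pi_pos
  have h1 : 2 / π * ((a + b) / 2) ≤ sin ((a + b) / 2) :=
    Real.mul_le_sin (by positivity) (by linarith)
  have hab : |a - b| ≤ π := by rw [abs_le]; constructor <;> linarith
  have h2 : |(a - b) / 2| ≤ π / 2 * |sin ((a - b) / 2)| := by
    apply sc_abs_le_pi_div_two_mul_abs_sin
    rw [abs_div, abs_two]; linarith
  have h1' : 0 ≤ sin ((a + b) / 2) := le_trans (by positivity) h1
  have h2' : |a - b| / π ≤ |sin ((a - b) / 2)| := by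
    rw [abs_div, abs_two] at h2
    rw [div_le_iff₀ hpi]; linarith
  have e1 : 2 / π ^ 2 * (a + b) * |a - b| = 2 * ((2 / π * ((a + b) / 2)) * (|a - b| / π)) := by
    field_simp
  rw [e1]
  calc 2 * ((2 / π * ((a + b) / 2)) * (|a - b| / π))
      ≤ 2 * (sin ((a + b) / 2) * |sin ((a - b) / 2)|) := by gcongr
    _ = |(-2) * sin ((a + b) / 2) * sin ((a - b) / 2)| := by
        rw [abs_mul, abs_mul, abs_of_nonneg h1']; norm_num; ring

/-- Lower bound `|sin a - sin b| ≥ (3/5)|a - b|` for `|a|, |b| ≤ 1/10`. [folklore] -/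
private theorem sc_sin_sub_sin_lower {a b : ℝ} (ha : |a| ≤ 1 / 10) (hb : |b| ≤ 1 / 10) :
    3 / 5 * |a - b| ≤ |sin a - sin b| := by
  rw [Real.sin_sub_sin]
  have hpi := Real.pi_lt_d2
  have hpi3 := Real.pi_gt_three
  have hpi0 := pi_pos
  have hc : 199 / 200 ≤ cos ((a + b) / 2) := by
    apply sc_cos_ge
    rw [abs_div, abs_two]
    have := abs_add_le a b; linarith
  have hab : |a - b| ≤ 1 / 5 := by have := abs_sub a b; linarith
  have h2 : |(a - b) / 2| ≤ π / 2 * |sin ((a - b) / 2)| := by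
    apply sc_abs_le_pi_div_two_mul_abs_sin
    rw [abs_div, abs_two]; linarith
  rw [abs_div, abs_two] at h2
  have h2' : |a - b| / π ≤ |sin ((a - b) / 2)| := by rw [div_le_iff₀ hpi0]; linarith
  have hcoef : 3 / 5 ≤ 2 * (199 / 200) / π := by rw [le_div_iff₀ hpi0]; linarith
  calc 3 / 5 * |a - b| ≤ 2 * (199 / 200) / π * |a - b| := by gcongr
    _ = 2 * (|a - b| / π) * (199 / 200) := by ring
    _ ≤ 2 * |sin ((a - b) / 2)| * cos ((a + b) / 2) := by gcongr
    _ = |2 * sin ((a - b) / 2) * cos ((a + b) / 2)| := by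
        rw [abs_mul, abs_mul, abs_two, abs_of_nonneg (by linarith : 0 ≤ cos ((a + b) / 2))]

/-- **The wedge identity with a reference point** (`Q₁ ∧ Q₂ = (Q₁ - P) ∧ Q₂ + P ∧ (Q₂ - P)`), as a
bound. [folklore] -/
private theorem tp_cross {Q1u Q1v Q2u Q2v Pu Pv e1 e2 ev : ℝ}
    (h1u : |Pu - Q1u| ≤ e1) (h2u : |Pu - Q2u| ≤ e2) (h1v : |Pv - Q1v| ≤ ev) (h2v : |Pv - Q2v| ≤ ev) :
    |Q1u * Q2v - Q1v * Q2u| ≤ e1 * |Q2v| + ev * |Q2u| + |Pu| * ev + |Pv| * e2 := by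
  have key : Q1u * Q2v - Q1v * Q2u =
      (Q1u - Pu) * Q2v - (Q1v - Pv) * Q2u + Pu * (Q2v - Pv) - Pv * (Q2u - Pu) := by ring
  rw [key]
  have a1 : |(Q1u - Pu) * Q2v| ≤ e1 * |Q2v| := by
    rw [abs_mul]; gcongr; rw [abs_sub_comm]; exact h1u
  have a2 : |(Q1v - Pv) * Q2u| ≤ ev * |Q2u| := by
    rw [abs_mul]; gcongr; rw [abs_sub_comm]; exact h1v
  have a3 : |Pu * (Q2v - Pv)| ≤ |Pu| * ev := by
    rw [abs_mul]; gcongr; rw [abs_sub_comm]; exact h2v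
  have a4 : |Pv * (Q2u - Pu)| ≤ |Pv| * e2 := by
    rw [abs_mul]; gcongr; rw [abs_sub_comm]; exact h2u
  calc |(Q1u - Pu) * Q2v - (Q1v - Pv) * Q2u + Pu * (Q2v - Pv) - Pv * (Q2u - Pu)|
      ≤ |(Q1u - Pu) * Q2v - (Q1v - Pv) * Q2u + Pu * (Q2v - Pv)| + |Pv * (Q2u - Pu)| := abs_sub _ _
    _ ≤ |(Q1u - Pu) * Q2v - (Q1v - Pv) * Q2u| + |Pu * (Q2v - Pv)| + |Pv * (Q2u - Pu)| := by
        gcongr; exact abs_add_le _ _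
    _ ≤ |(Q1u - Pu) * Q2v| + |(Q1v - Pv) * Q2u| + |Pu * (Q2v - Pv)| + |Pv * (Q2u - Pu)| := by
        gcongr; exact abs_sub _ _
    _ ≤ e1 * |Q2v| + ev * |Q2u| + |Pu| * ev + |Pv| * e2 := by linarith

/-- From `|c · sin z| ≤ E` with `c ≥ c₀ > 0` and `|z| ≤ π/2`: `|z| ≤ (π/2) E / c₀`. [folklore] -/
private theorem tp_angle_from_sin {c c₀ z E : ℝ} (hc : c₀ ≤ c) (hc₀ : 0 < c₀) (hz : |z| ≤ π / 2)
    (h : |c * sin z| ≤ E) : |z| ≤ π / 2 * (E / c₀) := by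
  rw [abs_mul, abs_of_pos (lt_of_lt_of_le hc₀ hc)] at h
  have h1 : c₀ * |sin z| ≤ E := le_trans (by gcongr) h
  have h2 : |sin z| ≤ E / c₀ := by rw [le_div_iff₀ hc₀]; linarith
  calc |z| ≤ π / 2 * |sin z| := sc_abs_le_pi_div_two_mul_abs_sin hz
    _ ≤ π / 2 * (E / c₀) := by gcongr

set_option maxHeartbeats 400000 in
/-- **Two-point estimate, same parity, half-sums** (App. B case `|N| = 1`, first half).  Points
`Q_i = 2 cos δ_i (cos σ_i, sin σ_i)` with `|σ_i|, |δ_i| ≤ 1/20`, both in the box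
`|P_u - Q_{iu}| ≤ e_u`, `|P_v - Q_{iv}| ≤ e_v ≤ 1/100`: then `|σ₁ - σ₂| ≤ e_u + 2 e_v`.
[cite: DisertoriRivasseau2000, App. B p0018:L1–25] -/
private theorem tp_same_sigma {σ₁ σ₂ δ₁ δ₂ Pu Pv eu ev : ℝ}
    (hσ₁ : |σ₁| ≤ 1 / 20) (hσ₂ : |σ₂| ≤ 1 / 20) (hδ₁ : |δ₁| ≤ 1 / 20) (hδ₂ : |δ₂| ≤ 1 / 20)
    (heu : 0 ≤ eu) (hev : 0 ≤ ev) (hev' : ev ≤ 1 / 100)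
    (hu₁ : |Pu - 2 * cos σ₁ * cos δ₁| ≤ eu) (hu₂ : |Pu - 2 * cos σ₂ * cos δ₂| ≤ eu)
    (hv₁ : |Pv - 2 * sin σ₁ * cos δ₁| ≤ ev) (hv₂ : |Pv - 2 * sin σ₂ * cos δ₂| ≤ ev) :
    |σ₁ - σ₂| ≤ eu + 2 * ev := by
  have hpi := Real.pi_lt_d2
  have cσ₁ : 199 / 200 ≤ cos σ₁ := sc_cos_ge (by linarith)
  have cσ₂ : 199 / 200 ≤ cos σ₂ := sc_cos_ge (by linarith)
  have cδ₁ : 199 / 200 ≤ cos δ₁ := sc_cos_ge (by linarith)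
  have cδ₂ : 199 / 200 ≤ cos δ₂ := sc_cos_ge (by linarith)
  have hcross := tp_cross hu₁ hu₂ hv₁ hv₂
  have hid : 2 * cos σ₁ * cos δ₁ * (2 * sin σ₂ * cos δ₂) - 2 * sin σ₁ * cos δ₁ * (2 * cos σ₂ * cos δ₂) =
      4 * (cos δ₁ * cos δ₂) * sin (σ₂ - σ₁) := by rw [sin_sub]; ring
  rw [hid] at hcross
  have hQ2v : |2 * sin σ₂ * cos δ₂| ≤ 1 / 10 := by
    rw [abs_mul, abs_mul, abs_two]
    have : |sin σ₂| ≤ 1 / 20 := (abs_sin_le_abs).trans hσ₂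
    have : |cos δ₂| ≤ 1 := abs_cos_le_one _
    nlinarith [abs_nonneg (sin σ₂), abs_nonneg (cos δ₂)]
  have hQ2u : |2 * cos σ₂ * cos δ₂| ≤ 2 := by
    rw [abs_mul, abs_mul, abs_two]
    nlinarith [abs_nonneg (cos σ₂), abs_nonneg (cos δ₂), abs_cos_le_one σ₂, abs_cos_le_one δ₂]
  have hQ1v : |2 * sin σ₁ * cos δ₁| ≤ 1 / 10 := by
    rw [abs_mul, abs_mul, abs_two]
    have : |sin σ₁| ≤ 1 / 20 := (abs_sin_le_abs).trans hσ₁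
    have : |cos δ₁| ≤ 1 := abs_cos_le_one _
    nlinarith [abs_nonneg (sin σ₁), abs_nonneg (cos δ₁)]
  have hQ1u : |2 * cos σ₁ * cos δ₁| ≤ 2 := by
    rw [abs_mul, abs_mul, abs_two]
    nlinarith [abs_nonneg (cos σ₁), abs_nonneg (cos δ₁), abs_cos_le_one σ₁, abs_cos_le_one δ₁]
  have hPu : |Pu| ≤ 2 + eu := by
    have := abs_sub_abs_le_abs_sub Pu (2 * cos σ₁ * cos δ₁); linarith
  have hPv : |Pv| ≤ 1 / 10 + ev := by
    have := abs_sub_abs_le_abs_sub Pv (2 * sin σ₁ * cos δ₁); linarith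
  have hb : |4 * (cos δ₁ * cos δ₂) * sin (σ₂ - σ₁)| ≤ (11 / 50) * eu + (41 / 10) * ev := by
    calc |4 * (cos δ₁ * cos δ₂) * sin (σ₂ - σ₁)|
        ≤ eu * |2 * sin σ₂ * cos δ₂| + ev * |2 * cos σ₂ * cos δ₂| + |Pu| * ev + |Pv| * eu := hcross
      _ ≤ eu * (1 / 10) + ev * 2 + (2 + eu) * ev + (1 / 10 + ev) * eu := by gcongr
      _ ≤ (11 / 50) * eu + (41 / 10) * ev := by nlinarith
  have hz : |σ₂ - σ₁| ≤ π / 2 := by have := abs_sub σ₂ σ₁; linarith [Real.pi_gt_three]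
  have hang := tp_angle_from_sin (c := 4 * (cos δ₁ * cos δ₂)) (c₀ := 99 / 25) (by nlinarith)
    (by norm_num) hz hb
  rw [abs_sub_comm] at hang
  calc |σ₁ - σ₂| ≤ π / 2 * (((11 / 50) * eu + (41 / 10) * ev) / (99 / 25)) := hang
    _ ≤ eu + 2 * ev := by nlinarith

set_option maxHeartbeats 400000 in
/-- **Two-point estimate, same parity, half-differences — the no-logarithm step** (App. B case `|N| = 1`,
second half; BGM 2003 Lemma 7.5): with `a, b ≥ 0` the absolute half-differences, `|σ_i| ≤ K(a_i + w)`,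
`|σ₁ - σ₂| ≤ W`, and `|2cos σ₁ cos a - 2 cos σ₂ cos b| ≤ M (a + b) + N`, one gets
`(1/5)(a+b)|a - b| ≲ (M + K W)(a + b) + N + 2 K w W`, whence `|a - b| ≤ w + 5(M + KW) + 5(N/w + KW)`. [cite: DisertoriRivasseau2000, App. B
p0018:L1–40] -/
private theorem tp_same_delta {a b σ₁ σ₂ K W M N w : ℝ} (ha : 0 ≤ a) (hb : 0 ≤ b) (ha' : a ≤ 1 / 20)
    (hb' : b ≤ 1 / 20) (hσ₁ : |σ₁| ≤ 1 / 20) (hK : 0 ≤ K) (hW : 0 ≤ W) (hM : 0 ≤ M) (hN : 0 ≤ N)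
    (hw : 0 < w)
    (hσ₁K : |σ₁| ≤ K * (a + w)) (hσ₂K : |σ₂| ≤ K * (b + w)) (hσ : |σ₁ - σ₂| ≤ W)
    (hQ : |2 * cos σ₁ * cos a - 2 * cos σ₂ * cos b| ≤ M * (a + b) + N) :
    |a - b| ≤ w + 5 * (M + K * W) + 5 * (N / w + K * W) := by
  have hpi := Real.pi_lt_d2
  have hpi3 := Real.pi_gt_three
  have cσ₁ : 199 / 200 ≤ cos σ₁ := sc_cos_ge (by linarith)
  -- upper bound for `|cos a - cos b|`
  have hcos : |cos σ₁ - cos σ₂| ≤ (K * (a + w) + K * (b + w)) / 2 * W := by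
    calc |cos σ₁ - cos σ₂| ≤ (|σ₁| + |σ₂|) / 2 * |σ₁ - σ₂| := sc_abs_cos_sub_cos_le_mul _ _
      _ ≤ (K * (a + w) + K * (b + w)) / 2 * W := by gcongr
  have hid : 2 * (cos a - cos b) * cos σ₁ =
      (2 * cos σ₁ * cos a - 2 * cos σ₂ * cos b) - 2 * cos b * (cos σ₁ - cos σ₂) := by ring
  have hup : 2 * |cos a - cos b| * cos σ₁ ≤ M * (a + b) + N + 2 * ((K * (a + w) + K * (b + w)) / 2 * W) := by
    have e : 2 * |cos a - cos b| * cos σ₁ = |2 * (cos a - cos b) * cos σ₁| := by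
      rw [abs_mul, abs_mul, abs_two, abs_of_nonneg (by linarith : 0 ≤ cos σ₁)]
    rw [e, hid]
    calc |(2 * cos σ₁ * cos a - 2 * cos σ₂ * cos b) - 2 * cos b * (cos σ₁ - cos σ₂)|
        ≤ |2 * cos σ₁ * cos a - 2 * cos σ₂ * cos b| + |2 * cos b * (cos σ₁ - cos σ₂)| := abs_sub _ _
      _ ≤ M * (a + b) + N + 2 * 1 * ((K * (a + w) + K * (b + w)) / 2 * W) := by
          gcongr
          rw [abs_mul, abs_mul, abs_two]
          gcongr
          exact abs_cos_le_one b
      _ = _ := by ring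
  -- lower bound
  have hlow : 2 / π ^ 2 * (a + b) * |a - b| ≤ |cos a - cos b| :=
    sc_cos_sub_cos_lower ha hb (by linarith) (by linarith)
  have hπ2 : 1 / 5 ≤ 2 / π ^ 2 := by
    rw [div_le_div_iff₀ (by norm_num) (by positivity)]; nlinarith
  -- combine: `(199/100)(1/5)(a+b)|a-b| ≤ M(a+b) + N + K(a+b+2w)W`
  have hmain : (199 / 500) * ((a + b) * |a - b|) ≤ (M + K * W) * (a + b) + (N + 2 * K * w * W) := by
    have h1 : 1 / 5 * (a + b) * |a - b| ≤ |cos a - cos b| :=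
      le_trans (by gcongr) hlow
    have hA : (199 / 100) * |cos a - cos b| ≤ 2 * |cos a - cos b| * cos σ₁ := by
      nlinarith [abs_nonneg (cos a - cos b)]
    have hB : 2 * |cos a - cos b| * cos σ₁ ≤ (M + K * W) * (a + b) + (N + 2 * K * w * W) := by
      calc 2 * |cos a - cos b| * cos σ₁ ≤ M * (a + b) + N + 2 * ((K * (a + w) + K * (b + w)) / 2 * W) := hup
        _ = (M + K * W) * (a + b) + (N + 2 * K * w * W) := by ring
    nlinarith
  by_cases hab : a + b ≤ w
  · have : |a - b| ≤ a + b := by rw [abs_le]; constructor <;> linarith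
    have h5 : 0 ≤ 5 * (M + K * W) := by positivity
    have h6 : 0 ≤ 5 * (N / w + K * W) := by positivity
    linarith
  · push Not at hab
    have hS : 0 < a + b := by linarith
    have hCnn : 0 ≤ N + 2 * K * w * W := by positivity
    have hC : N + 2 * K * w * W ≤ (N + 2 * K * w * W) / w * (a + b) := by
      rw [div_mul_eq_mul_div, le_div_iff₀ hw]
      exact mul_le_mul_of_nonneg_left hab.le hCnn
    have h0 : (199 / 500) * |a - b| * (a + b) ≤ ((M + K * W) + (N + 2 * K * w * W) / w) * (a + b) := by
      have : ((M + K * W) + (N + 2 * K * w * W) / w) * (a + b) =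
          (M + K * W) * (a + b) + (N + 2 * K * w * W) / w * (a + b) := by ring
      rw [this]; nlinarith
    have h1 : (199 / 500) * |a - b| ≤ (M + K * W) + (N + 2 * K * w * W) / w :=
      le_of_mul_le_mul_right h0 hS
    have e1 : (N + 2 * K * w * W) / w = N / w + 2 * (K * W) := by field_simp
    rw [e1] at h1
    have : 0 ≤ N / w := by positivity
    have : 0 ≤ K * W := by positivity
    nlinarith [abs_nonneg (a - b)]

set_option maxHeartbeats 400000 in
/-- **Two-point estimate, opposite parity, half-sums** (App. B case `N = 0`, the angular half; BGM 2003
Lemma 7.5 at `b₀ ≈ 0`).  Points `Q_i = 2 s_i (-sin σ_i, cos σ_i)` (`s_i = sin δ_i`), `|σ_i| ≤ 1/20`, in the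
box `|P_u - Q_{iu}| ≤ e_u`, `|P_v - Q_{iv}| ≤ e_v` with `V = |P_v| ≥ 10 e_v` NOT small; the box's
`u`-side and the alignment are `V`-proportional: `e_u ≤ c_u V`, `|σ_i| ≤ c_σ V`.  Then
`|σ₁ - σ₂| ≤ 5 c_u + 5 e_v c_σ`. [cite: DisertoriRivasseau2000, App. B p0018:L41–70] -/
private theorem tp_opp_sigma {σ₁ σ₂ s₁ s₂ Pu Pv eu ev cu cσ : ℝ}
    (hσ₁ : |σ₁| ≤ 1 / 20) (hσ₂ : |σ₂| ≤ 1 / 20)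
    (hev : 0 ≤ ev) (hcu : 0 ≤ cu) (hcσ : 0 ≤ cσ)
    (hV : 10 * ev ≤ |Pv|) (hVpos : 0 < |Pv|) (heuV : eu ≤ cu * |Pv|)
    (hσ₁V : |σ₁| ≤ cσ * |Pv|) (hσ₂V : |σ₂| ≤ cσ * |Pv|)
    (hu₁ : |Pu - (-2 * sin σ₁ * s₁)| ≤ eu) (hu₂ : |Pu - (-2 * sin σ₂ * s₂)| ≤ eu)
    (hv₁ : |Pv - 2 * s₁ * cos σ₁| ≤ ev) (hv₂ : |Pv - 2 * s₂ * cos σ₂| ≤ ev) :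
    |σ₁ - σ₂| ≤ 5 * cu + 5 * (ev * cσ) := by
  have hpi := Real.pi_lt_d2
  have cσ₁ : 199 / 200 ≤ cos σ₁ := sc_cos_ge (by linarith)
  have cσ₂ : 199 / 200 ≤ cos σ₂ := sc_cos_ge (by linarith)
  have heu : 0 ≤ eu := le_trans (abs_nonneg _) hu₁
  have hVnn : 0 ≤ |Pv| := abs_nonneg _
  -- sizes of `2 s_i`
  have aux_u : ∀ {s σ : ℝ}, 199 / 200 ≤ cos σ → |Pv - 2 * s * cos σ| ≤ ev → |2 * s| ≤ 111 / 100 * |Pv| := by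
    intro s σ hc h
    have h1 : |2 * s * cos σ| ≤ |Pv| + ev := by
      have := abs_sub_abs_le_abs_sub (2 * s * cos σ) Pv; rw [abs_sub_comm] at h; linarith
    rw [abs_mul, abs_of_nonneg (by linarith : 0 ≤ cos σ)] at h1
    have h2 : |2 * s| * (199 / 200) ≤ |2 * s| * cos σ :=
      mul_le_mul_of_nonneg_left hc (abs_nonneg _)
    linarith
  have aux_l : ∀ {s σ : ℝ}, 199 / 200 ≤ cos σ → |Pv - 2 * s * cos σ| ≤ ev → 9 / 10 * |Pv| ≤ |2 * s| := by
    intro s σ hc h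
    have h1 : |Pv| - ev ≤ |2 * s * cos σ| := by
      have := abs_sub_abs_le_abs_sub Pv (2 * s * cos σ); linarith
    rw [abs_mul, abs_of_nonneg (by linarith : 0 ≤ cos σ)] at h1
    have : |2 * s| * cos σ ≤ |2 * s| * 1 := mul_le_mul_of_nonneg_left (cos_le_one _) (abs_nonneg _)
    linarith
  have hs₁u := aux_u cσ₁ hv₁
  have hs₂u := aux_u cσ₂ hv₂
  have hs₁l := aux_l cσ₁ hv₁
  have hs₂l := aux_l cσ₂ hv₂
  -- the cross product
  have hcross := tp_cross hu₁ hu₂ hv₁ hv₂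
  have hid : (-2 * sin σ₁ * s₁) * (2 * s₂ * cos σ₂) - (2 * s₁ * cos σ₁) * (-2 * sin σ₂ * s₂) =
      (2 * s₁) * (2 * s₂) * sin (σ₂ - σ₁) := by rw [sin_sub]; ring
  rw [hid] at hcross
  have hQv₂ : |2 * s₂ * cos σ₂| ≤ 111 / 100 * |Pv| := by
    rw [abs_mul, abs_of_nonneg (by linarith : 0 ≤ cos σ₂)]
    calc |2 * s₂| * cos σ₂ ≤ |2 * s₂| * 1 := mul_le_mul_of_nonneg_left (cos_le_one _) (abs_nonneg _)
      _ ≤ 111 / 100 * |Pv| := by linarith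
  have hQu : ∀ {s σ : ℝ}, |σ| ≤ cσ * |Pv| → |2 * s| ≤ 111 / 100 * |Pv| →
      |-2 * sin σ * s| ≤ 111 / 100 * |Pv| * (cσ * |Pv|) := by
    intro s σ hσV hs
    have e : -2 * sin σ * s = -(sin σ * (2 * s)) := by ring
    rw [e, abs_neg, abs_mul]
    have : |sin σ| ≤ cσ * |Pv| := (abs_sin_le_abs).trans hσV
    calc |sin σ| * |2 * s| ≤ (cσ * |Pv|) * (111 / 100 * |Pv|) :=
          mul_le_mul this hs (abs_nonneg _) (by positivity)
      _ = _ := by ring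
  have hQu₂ := hQu hσ₂V hs₂u
  have hQu₁ := hQu hσ₁V hs₁u
  have hPu : |Pu| ≤ 111 / 100 * |Pv| * (cσ * |Pv|) + cu * |Pv| := by
    have := abs_sub_abs_le_abs_sub Pu (-2 * sin σ₁ * s₁); linarith
  have t1 : eu * |2 * s₂ * cos σ₂| ≤ (cu * |Pv|) * (111 / 100 * |Pv|) :=
    mul_le_mul heuV hQv₂ (abs_nonneg _) (by positivity)
  have t2 : ev * |-2 * sin σ₂ * s₂| ≤ ev * (111 / 100 * |Pv| * (cσ * |Pv|)) :=
    mul_le_mul_of_nonneg_left hQu₂ hev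
  have t3 : |Pu| * ev ≤ (111 / 100 * |Pv| * (cσ * |Pv|) + cu * |Pv|) * ev :=
    mul_le_mul_of_nonneg_right hPu hev
  have t4 : |Pv| * eu ≤ |Pv| * (cu * |Pv|) := mul_le_mul_of_nonneg_left heuV hVnn
  have t5 : cu * |Pv| * ev ≤ cu * |Pv| * (|Pv| / 10) :=
    mul_le_mul_of_nonneg_left (by linarith) (by positivity)
  have n1 : 0 ≤ cu * |Pv| ^ 2 := by positivity
  have n2 : 0 ≤ ev * cσ * |Pv| ^ 2 := by positivity
  have hb : |(2 * s₁) * (2 * s₂) * sin (σ₂ - σ₁)| ≤ |Pv| ^ 2 * (23 / 10 * cu + 23 / 10 * (ev * cσ)) := by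
    have h := hcross.trans (add_le_add (add_le_add (add_le_add t1 t2) t3) t4)
    have h' : (cu * |Pv|) * (111 / 100 * |Pv|) + ev * (111 / 100 * |Pv| * (cσ * |Pv|)) +
        (111 / 100 * |Pv| * (cσ * |Pv|) + cu * |Pv|) * ev + |Pv| * (cu * |Pv|) ≤
        |Pv| ^ 2 * (23 / 10 * cu + 23 / 10 * (ev * cσ)) := by
      nlinarith [t5, n1, n2]
    exact h.trans h'
  -- lower bound `|2s₁||2s₂| ≥ 0.81 V²`, then divide
  rw [abs_mul, abs_mul] at hb
  have hprod : 81 / 100 * |Pv| ^ 2 ≤ |2 * s₁| * |2 * s₂| := by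
    have := mul_le_mul hs₁l hs₂l (by positivity) (abs_nonneg _); nlinarith
  have hVsq : 0 < |Pv| ^ 2 := by positivity
  have h1 : 81 / 100 * |Pv| ^ 2 * |sin (σ₂ - σ₁)| ≤ |2 * s₁| * |2 * s₂| * |sin (σ₂ - σ₁)| :=
    mul_le_mul_of_nonneg_right hprod (abs_nonneg _)
  have h3 : |Pv| ^ 2 * (81 / 100 * |sin (σ₂ - σ₁)|) ≤ |Pv| ^ 2 * (23 / 10 * cu + 23 / 10 * (ev * cσ)) := by
    have := h1.trans hb; linarith
  have h4 : 81 / 100 * |sin (σ₂ - σ₁)| ≤ 23 / 10 * cu + 23 / 10 * (ev * cσ) :=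
    le_of_mul_le_mul_left h3 hVsq
  have hz : |σ₂ - σ₁| ≤ π / 2 := by have := abs_sub σ₂ σ₁; linarith [Real.pi_gt_three]
  have hang := sc_abs_le_pi_div_two_mul_abs_sin hz
  rw [abs_sub_comm] at hang
  have hsin' : |sin (σ₂ - σ₁)| ≤ 3 * cu + 3 * (ev * cσ) := by linarith [mul_nonneg hev hcσ]
  calc |σ₁ - σ₂| ≤ π / 2 * |sin (σ₂ - σ₁)| := hang
    _ ≤ π / 2 * (3 * cu + 3 * (ev * cσ)) := by gcongr
    _ ≤ 5 * cu + 5 * (ev * cσ) := by nlinarith [mul_nonneg hev hcσ]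

/-- **Two-point estimate, opposite parity, half-differences** (App. B case `N = 0`, radial half):
`|s₁ - s₂| ≤ e_v + 0.56 (|σ₁|+|σ₂|) W V…`; instance used below. [folklore] -/
private theorem tp_opp_delta {σ₁ σ₂ δ₁ δ₂ Pv ev W : ℝ}
    (hσ₁ : |σ₁| ≤ 1 / 20) (hσ₂ : |σ₂| ≤ 1 / 20) (hδ₁ : |δ₁| ≤ 1 / 20) (hδ₂ : |δ₂| ≤ 1 / 20)
    (hev : 0 ≤ ev) (hW : 0 ≤ W) (hσ : |σ₁ - σ₂| ≤ W)
    (hv₁ : |Pv - 2 * sin δ₁ * cos σ₁| ≤ ev) (hv₂ : |Pv - 2 * sin δ₂ * cos σ₂| ≤ ev) :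
    |δ₁ - δ₂| ≤ 2 * ev + W / 10 := by
  have cσ₁ : 199 / 200 ≤ cos σ₁ := sc_cos_ge (by linarith)
  have hcos : |cos σ₁ - cos σ₂| ≤ (1 / 20) * W := by
    calc |cos σ₁ - cos σ₂| ≤ (|σ₁| + |σ₂|) / 2 * |σ₁ - σ₂| := sc_abs_cos_sub_cos_le_mul _ _
      _ ≤ (1 / 20 + 1 / 20) / 2 * W := by gcongr
      _ = (1 / 20) * W := by ring
  have hs₂ : |2 * sin δ₂| ≤ 1 / 10 := by
    rw [abs_mul, abs_two]; have := (abs_sin_le_abs (x := δ₂)).trans hδ₂; linarith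
  have hid : 2 * (sin δ₁ - sin δ₂) * cos σ₁ =
      (2 * sin δ₁ * cos σ₁ - 2 * sin δ₂ * cos σ₂) - 2 * sin δ₂ * (cos σ₁ - cos σ₂) := by ring
  have hdv : |2 * sin δ₁ * cos σ₁ - 2 * sin δ₂ * cos σ₂| ≤ 2 * ev := by
    have := abs_sub_le (2 * sin δ₁ * cos σ₁) Pv (2 * sin δ₂ * cos σ₂)
    rw [abs_sub_comm] at hv₁; linarith
  have hup : 2 * |sin δ₁ - sin δ₂| * cos σ₁ ≤ 2 * ev + 1 / 10 * ((1 / 20) * W) := by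
    have e : 2 * |sin δ₁ - sin δ₂| * cos σ₁ = |2 * (sin δ₁ - sin δ₂) * cos σ₁| := by
      rw [abs_mul, abs_mul, abs_two, abs_of_nonneg (by linarith : 0 ≤ cos σ₁)]
    rw [e, hid]
    calc |(2 * sin δ₁ * cos σ₁ - 2 * sin δ₂ * cos σ₂) - 2 * sin δ₂ * (cos σ₁ - cos σ₂)|
        ≤ |2 * sin δ₁ * cos σ₁ - 2 * sin δ₂ * cos σ₂| + |2 * sin δ₂ * (cos σ₁ - cos σ₂)| := abs_sub _ _
      _ ≤ 2 * ev + 1 / 10 * ((1 / 20) * W) := by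
          gcongr
          rw [abs_mul]; gcongr
  have hlow : 3 / 5 * |δ₁ - δ₂| ≤ |sin δ₁ - sin δ₂| :=
    sc_sin_sub_sin_lower (by linarith) (by linarith)
  nlinarith [abs_nonneg (δ₁ - δ₂), abs_nonneg (sin δ₁ - sin δ₂)]

set_option maxHeartbeats 400000 in
/-- **Two-point estimate, transverse regime** (App. B with `2^{-i} = O(1)`; the map
`(θ_p,θ_q) ↦ e(θ_p)+e(θ_q)` is a local diffeomorphism with Jacobian `|sin(θ_p - θ_q)| > τ`):
points `b_i = 2 cos d_i (cos σ_i, sin σ_i)` with `|sin(2 d_i)| > τ`, both in the box of side `ρ ≤ τ`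
around `P`, and both with `|cos d_i| ≥ c`, `c ∈ {τ/2}` … : `|sin(σ₁ - σ₂)| ≤ 6ρ/τ` and
`|cos² d₁ - cos² d₂| ≤ 4ρ`. [cite: DisertoriRivasseau2000, App. B p0017:L46–60] -/
private theorem tp_trans {σ₁ σ₂ d₁ d₂ Pu Pv ρ τ : ℝ} (hρ : 0 ≤ ρ) (hτ : 0 < τ) (hρτ : ρ ≤ τ)
    (hd₁ : τ < |sin (2 * d₁)|) (hd₂ : τ < |sin (2 * d₂)|)
    (hu₁ : |Pu - 2 * cos d₁ * cos σ₁| ≤ ρ) (hu₂ : |Pu - 2 * cos d₂ * cos σ₂| ≤ ρ)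
    (hv₁ : |Pv - 2 * cos d₁ * sin σ₁| ≤ ρ) (hv₂ : |Pv - 2 * cos d₂ * sin σ₂| ≤ ρ) :
    |sin (σ₁ - σ₂)| ≤ 6 * ρ / τ ∧ |cos d₁ ^ 2 - cos d₂ ^ 2| ≤ 4 * ρ := by
  -- `|cos d_i| > τ/2`
  have hc₁ : τ / 2 < |cos d₁| := by
    rw [Real.sin_two_mul, abs_mul, abs_mul, abs_two] at hd₁
    nlinarith [abs_sin_le_one d₁, abs_nonneg (cos d₁), abs_nonneg (sin d₁)]
  have hc₂ : τ / 2 < |cos d₂| := by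
    rw [Real.sin_two_mul, abs_mul, abs_mul, abs_two] at hd₂
    nlinarith [abs_sin_le_one d₂, abs_nonneg (cos d₂), abs_nonneg (sin d₂)]
  constructor
  · have hcross := tp_cross hu₁ hu₂ hv₁ hv₂
    have hid : 2 * cos d₁ * cos σ₁ * (2 * cos d₂ * sin σ₂) - 2 * cos d₁ * sin σ₁ * (2 * cos d₂ * cos σ₂) =
        4 * (cos d₁ * cos d₂) * sin (σ₂ - σ₁) := by rw [sin_sub]; ring
    rw [hid] at hcross
    have hb2v : |2 * cos d₂ * sin σ₂| ≤ 2 * |cos d₂| := by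
      rw [abs_mul, abs_mul, abs_two]; nlinarith [abs_sin_le_one σ₂, abs_nonneg (cos d₂), abs_nonneg (sin σ₂)]
    have hb2u : |2 * cos d₂ * cos σ₂| ≤ 2 * |cos d₂| := by
      rw [abs_mul, abs_mul, abs_two]; nlinarith [abs_cos_le_one σ₂, abs_nonneg (cos d₂), abs_nonneg (cos σ₂)]
    have hb1v : |2 * cos d₁ * sin σ₁| ≤ 2 * |cos d₁| := by
      rw [abs_mul, abs_mul, abs_two]; nlinarith [abs_sin_le_one σ₁, abs_nonneg (cos d₁), abs_nonneg (sin σ₁)]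
    have hb1u : |2 * cos d₁ * cos σ₁| ≤ 2 * |cos d₁| := by
      rw [abs_mul, abs_mul, abs_two]; nlinarith [abs_cos_le_one σ₁, abs_nonneg (cos d₁), abs_nonneg (cos σ₁)]
    have hPu : |Pu| ≤ 2 * |cos d₁| + ρ := by
      have := abs_sub_abs_le_abs_sub Pu (2 * cos d₁ * cos σ₁); linarith
    have hPv : |Pv| ≤ 2 * |cos d₁| + ρ := by
      have := abs_sub_abs_le_abs_sub Pv (2 * cos d₁ * sin σ₁); linarith
    have hb : |4 * (cos d₁ * cos d₂) * sin (σ₂ - σ₁)| ≤ 4 * ρ * |cos d₂| + 4 * ρ * |cos d₁| + 2 * ρ ^ 2 := by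
      calc |4 * (cos d₁ * cos d₂) * sin (σ₂ - σ₁)|
          ≤ ρ * |2 * cos d₂ * sin σ₂| + ρ * |2 * cos d₂ * cos σ₂| + |Pu| * ρ + |Pv| * ρ := hcross
        _ ≤ ρ * (2 * |cos d₂|) + ρ * (2 * |cos d₂|) + (2 * |cos d₁| + ρ) * ρ + (2 * |cos d₁| + ρ) * ρ := by
            gcongr
        _ = 4 * ρ * |cos d₂| + 4 * ρ * |cos d₁| + 2 * ρ ^ 2 := by ring
    have e4 : |4 * (cos d₁ * cos d₂) * sin (σ₂ - σ₁)| = 4 * (|cos d₁| * |cos d₂|) * |sin (σ₂ - σ₁)| := by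
      rw [abs_mul, abs_mul, abs_mul, abs_of_pos (by norm_num : (0:ℝ) < 4)]
    rw [e4] at hb
    -- `|sin(σ₁ - σ₂)| = |sin(σ₂ - σ₁)|`
    have es : sin (σ₁ - σ₂) = -sin (σ₂ - σ₁) := by rw [← sin_neg, neg_sub]
    rw [es, abs_neg, le_div_iff₀ hτ]
    -- absorb: `ρ|c₂|τ ≤ 2ρ|c₁||c₂|`, `ρ|c₁|τ ≤ 2ρ|c₁||c₂|`, `ρ²τ ≤ 4ρ|c₁||c₂|`
    have A0 : 0 ≤ |cos d₁| * |cos d₂| := by positivity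
    have i1 : ρ * |cos d₂| * τ ≤ 2 * ρ * (|cos d₁| * |cos d₂|) := by
      have h : τ ≤ 2 * |cos d₁| := by linarith
      calc ρ * |cos d₂| * τ ≤ ρ * |cos d₂| * (2 * |cos d₁|) :=
            mul_le_mul_of_nonneg_left h (by positivity)
        _ = 2 * ρ * (|cos d₁| * |cos d₂|) := by ring
    have i2 : ρ * |cos d₁| * τ ≤ 2 * ρ * (|cos d₁| * |cos d₂|) := by
      have h : τ ≤ 2 * |cos d₂| := by linarith
      calc ρ * |cos d₁| * τ ≤ ρ * |cos d₁| * (2 * |cos d₂|) :=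
            mul_le_mul_of_nonneg_left h (by positivity)
        _ = 2 * ρ * (|cos d₁| * |cos d₂|) := by ring
    have i3 : ρ ^ 2 * τ ≤ 4 * ρ * (|cos d₁| * |cos d₂|) := by
      have h1 : ρ ^ 2 * τ ≤ ρ * τ ^ 2 := by
        calc ρ ^ 2 * τ = ρ * (ρ * τ) := by ring
          _ ≤ ρ * (τ * τ) := by gcongr
          _ = ρ * τ ^ 2 := by ring
      have h2 : τ ^ 2 ≤ 4 * (|cos d₁| * |cos d₂|) := by
        have := mul_le_mul hc₁.le hc₂.le (by positivity) (abs_nonneg _); nlinarith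
      calc ρ ^ 2 * τ ≤ ρ * τ ^ 2 := h1
        _ ≤ ρ * (4 * (|cos d₁| * |cos d₂|)) := mul_le_mul_of_nonneg_left h2 hρ
        _ = _ := by ring
    have m := mul_le_mul_of_nonneg_right hb hτ.le
    have : 4 * (|cos d₁| * |cos d₂|) * (|sin (σ₂ - σ₁)| * τ) ≤ 4 * (|cos d₁| * |cos d₂|) * (6 * ρ) := by
      have e1 : 4 * (|cos d₁| * |cos d₂|) * (|sin (σ₂ - σ₁)| * τ) =
          4 * (|cos d₁| * |cos d₂|) * |sin (σ₂ - σ₁)| * τ := by ring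
      have e2 : (4 * ρ * |cos d₂| + 4 * ρ * |cos d₁| + 2 * ρ ^ 2) * τ =
          4 * (ρ * |cos d₂| * τ) + 4 * (ρ * |cos d₁| * τ) + 2 * (ρ ^ 2 * τ) := by ring
      rw [e1]; rw [e2] at m
      linarith
    have hpos : 0 < 4 * (|cos d₁| * |cos d₂|) :=
      mul_pos (by norm_num) (mul_pos (by linarith) (by linarith))
    exact le_of_mul_le_mul_left this hpos
  · -- `4cos² d_i = b_{iu}² + b_{iv}²`
    have hdu : |2 * cos d₁ * cos σ₁ - 2 * cos d₂ * cos σ₂| ≤ 2 * ρ := by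
      have := abs_sub_le (2 * cos d₁ * cos σ₁) Pu (2 * cos d₂ * cos σ₂)
      rw [abs_sub_comm] at hu₁; linarith
    have hdv : |2 * cos d₁ * sin σ₁ - 2 * cos d₂ * sin σ₂| ≤ 2 * ρ := by
      have := abs_sub_le (2 * cos d₁ * sin σ₁) Pv (2 * cos d₂ * sin σ₂)
      rw [abs_sub_comm] at hv₁; linarith
    have hsu : |2 * cos d₁ * cos σ₁ + 2 * cos d₂ * cos σ₂| ≤ 4 := by
      have := abs_add_le (2 * cos d₁ * cos σ₁) (2 * cos d₂ * cos σ₂)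
      have a1 : |2 * cos d₁ * cos σ₁| ≤ 2 := by
        rw [abs_mul, abs_mul, abs_two]; nlinarith [abs_cos_le_one d₁, abs_cos_le_one σ₁, abs_nonneg (cos d₁), abs_nonneg (cos σ₁)]
      have a2 : |2 * cos d₂ * cos σ₂| ≤ 2 := by
        rw [abs_mul, abs_mul, abs_two]; nlinarith [abs_cos_le_one d₂, abs_cos_le_one σ₂, abs_nonneg (cos d₂), abs_nonneg (cos σ₂)]
      linarith
    have hsv : |2 * cos d₁ * sin σ₁ + 2 * cos d₂ * sin σ₂| ≤ 4 := by
      have := abs_add_le (2 * cos d₁ * sin σ₁) (2 * cos d₂ * sin σ₂)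
      have a1 : |2 * cos d₁ * sin σ₁| ≤ 2 := by
        rw [abs_mul, abs_mul, abs_two]; nlinarith [abs_cos_le_one d₁, abs_sin_le_one σ₁, abs_nonneg (cos d₁), abs_nonneg (sin σ₁)]
      have a2 : |2 * cos d₂ * sin σ₂| ≤ 2 := by
        rw [abs_mul, abs_mul, abs_two]; nlinarith [abs_cos_le_one d₂, abs_sin_le_one σ₂, abs_nonneg (cos d₂), abs_nonneg (sin σ₂)]
      linarith
    have key : 4 * cos d₁ ^ 2 - 4 * cos d₂ ^ 2 =
        (2 * cos d₁ * cos σ₁ - 2 * cos d₂ * cos σ₂) * (2 * cos d₁ * cos σ₁ + 2 * cos d₂ * cos σ₂) +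
        (2 * cos d₁ * sin σ₁ - 2 * cos d₂ * sin σ₂) * (2 * cos d₁ * sin σ₁ + 2 * cos d₂ * sin σ₂) := by
      linear_combination (-4 * cos d₁ ^ 2) * sin_sq_add_cos_sq σ₁ + (4 * cos d₂ ^ 2) * sin_sq_add_cos_sq σ₂
    have : |4 * cos d₁ ^ 2 - 4 * cos d₂ ^ 2| ≤ 2 * ρ * 4 + 2 * ρ * 4 := by
      rw [key]
      calc _ ≤ |(2 * cos d₁ * cos σ₁ - 2 * cos d₂ * cos σ₂) * (2 * cos d₁ * cos σ₁ + 2 * cos d₂ * cos σ₂)| +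
            |(2 * cos d₁ * sin σ₁ - 2 * cos d₂ * sin σ₂) * (2 * cos d₁ * sin σ₁ + 2 * cos d₂ * sin σ₂)| :=
            abs_add_le _ _
        _ ≤ 2 * ρ * 4 + 2 * ρ * 4 := by rw [abs_mul, abs_mul]; gcongr
    have e : 4 * cos d₁ ^ 2 - 4 * cos d₂ ^ 2 = 4 * (cos d₁ ^ 2 - cos d₂ ^ 2) := by ring
    rw [e, abs_mul, abs_of_pos (by norm_num : (0:ℝ) < 4)] at this
    linarith

/-- From `|cos² a - cos² b| ≤ E` for `a, b ∈ [0, π/2]` with `cos a, cos b ≥ c > 0` and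
`sin a, sin b ≥ c`: `|a - b| ≤ (π/2) E / c²` (the two monotone branches of App. B's radial equation).
 [folklore] -/
private theorem tp_abs_sub_of_cos_sq {a b c E : ℝ} (ha : 0 ≤ a) (hb : 0 ≤ b) (ha' : a ≤ π / 2) (hb' : b ≤ π / 2)
    (hc : 0 < c) (hca : c ≤ cos a) (hcb : c ≤ cos b) (hsa : c ≤ sin a) (hsb : c ≤ sin b)
    (hE : |cos a ^ 2 - cos b ^ 2| ≤ E) : |a - b| ≤ π / 2 * (E / c ^ 2) := by
  -- `cos² a - cos² b = -sin(a+b) sin(a-b)`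
  have hid : cos a ^ 2 - cos b ^ 2 = -(sin (a + b) * sin (a - b)) := by
    rw [sin_add, sin_sub]; nlinarith [sin_sq_add_cos_sq a, sin_sq_add_cos_sq b]
  -- `sin(a+b) ≥ ` : since `a+b ∈ [0,π]`, `sin(a+b) = sin a cos b + cos a sin b ≥ 2c²`
  have hsab : 2 * c ^ 2 ≤ sin (a + b) := by
    rw [sin_add]; nlinarith [mul_le_mul hsa hcb hc.le (le_trans hc.le hsa), mul_le_mul hca hsb hc.le (le_trans hc.le hca)]
  have hz : |a - b| ≤ π / 2 := by rw [abs_le]; constructor <;> linarith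
  have h1 : |sin (a + b) * sin (a - b)| ≤ E := by rw [hid, abs_neg] at hE; exact hE
  have := tp_angle_from_sin (c := sin (a + b)) (c₀ := 2 * c ^ 2) hsab (by positivity) hz h1
  calc |a - b| ≤ π / 2 * (E / (2 * c ^ 2)) := this
    _ ≤ π / 2 * (E / c ^ 2) := by
        gcongr
        · exact le_trans (abs_nonneg _) hE
        · linarith [sq_nonneg c]

/-! #### Two-point estimates in the reduced coordinates `x = redPi(θ_p - θ₁)`, `y = redPi(θ_q - θ₁)` -/

/-- The data of one admissible point of the near-parallel regime, SAME parity, in reduced variables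
`x = redPi(θ_p - θ₁)`, `y = redPi(θ_q - θ₁)`: alignment, small transverse angle, the second-order bound along
`u` and the first-order bound along `v` (`P = -ε A`). [folklore] -/
private def SamePt (L w Pu Pv x y : ℝ) : Prop :=
  |x| ≤ π * L * (|sin (x - y)| + 2 * w) ∧ |y| ≤ π * L * (|sin (x - y)| + 2 * w) ∧
  |sin (x - y)| ≤ 1 / (200 * L) ∧
  |Pu - (cos x + cos y)| ≤ 2 * L ^ 2 * w * (|sin (x - y)| + 3 * w) ∧
  |Pv - (sin x + sin y)| ≤ 3 * L * w

/-- A priori smallness in the near-parallel regime: `|x| ≤ 1/20`. [folklore] -/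
private theorem tp_small {L w x φ : ℝ} (hL : 1 ≤ L) (hwt : w ≤ 1 / (200 * L))
    (hx : |x| ≤ π * L * (φ + 2 * w)) (hφ : φ ≤ 1 / (200 * L)) :
    |x| ≤ 1 / 20 := by
  have hpi := Real.pi_lt_d2
  have hL0 : 0 < L := by linarith
  have h1 : φ + 2 * w ≤ 3 / (200 * L) := by
    have : 3 / (200 * L) = 1 / (200 * L) + 2 * (1 / (200 * L)) := by ring
    rw [this]; linarith
  calc |x| ≤ π * L * (φ + 2 * w) := hx
    _ ≤ π * L * (3 / (200 * L)) := mul_le_mul_of_nonneg_left h1 (by positivity)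
    _ = π * 3 / 200 := by field_simp
    _ ≤ 1 / 20 := by linarith

/-- The data of one admissible point of the near-parallel regime, OPPOSITE parity. [folklore] -/
private def OppPt (L w Pu Pv x y : ℝ) : Prop :=
  |x| ≤ π * L * (|sin (x - y)| + 2 * w) ∧ |y| ≤ π * L * (|sin (x - y)| + 2 * w) ∧
  |sin (x - y)| ≤ 1 / (200 * L) ∧
  |Pu - (cos x - cos y)| ≤ 2 * L ^ 2 * w * (|sin (x - y)| + 3 * w) ∧
  |Pv - (sin x - sin y)| ≤ 3 * L * w

/-- Numerical facts shared by the reduced two-point estimates. [folklore] -/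
private theorem tp_consts {L w : ℝ} (hL : 1 ≤ L) (hw : 0 < w) (hwt : w ≤ 1 / (300 * L ^ 2)) :
    w ≤ 1 / (200 * L) ∧ L * w ≤ 1 / 300 ∧ L ^ 2 * w ≤ 1 / 300 ∧ w ≤ L * w ∧ L * w ≤ L ^ 2 * w := by
  have hL0 : 0 < L := by linarith
  have hL2 : L ≤ L ^ 2 := by nlinarith
  have h1 : w ≤ 1 / (300 * L) := hwt.trans (by
    rw [div_le_div_iff₀ (by positivity) (by positivity)]; nlinarith)
  refine ⟨h1.trans ?_, ?_, ?_, ?_, ?_⟩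
  · rw [div_le_div_iff₀ (by positivity) (by positivity)]; nlinarith
  · calc L * w ≤ L * (1 / (300 * L)) := by gcongr
      _ = 1 / 300 := by field_simp
  · calc L ^ 2 * w ≤ L ^ 2 * (1 / (300 * L ^ 2)) := by gcongr
      _ = 1 / 300 := by field_simp
  · nlinarith
  · nlinarith

/-- The size of the `u`-error in the near-parallel regime: `2L²w(φ̂ + 3w) ≤ Lw/25`. [folklore] -/
private theorem tp_eu_le {L w φ : ℝ} (hL : 1 ≤ L) (hw : 0 < w) (hwt : w ≤ 1 / (200 * L))
    (hφ : φ ≤ 1 / (200 * L)) : 2 * L ^ 2 * w * (φ + 3 * w) ≤ L * w / 25 := by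
  have hL0 : 0 < L := by linarith
  have : φ + 3 * w ≤ 4 / (200 * L) := by
    have e : 4 / (200 * L) = 1 / (200 * L) + 3 * (1 / (200 * L)) := by ring
    rw [e]; gcongr
  calc 2 * L ^ 2 * w * (φ + 3 * w) ≤ 2 * L ^ 2 * w * (4 / (200 * L)) := by gcongr
    _ = L * w / 25 := by field_simp; ring

/-- Half-sum and half-difference bookkeeping: `|σ| ≤ (|x|+|y|)/2`, `|δ| ≤ (|x|+|y|)/2`. [folklore] -/
private theorem tp_half_le (x y : ℝ) : |(x + y) / 2| ≤ (|x| + |y|) / 2 ∧ |(x - y) / 2| ≤ (|x| + |y|) / 2 := by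
  constructor
  · rw [abs_div, abs_two]; have := abs_add_le x y; linarith
  · rw [abs_div, abs_two]; have := abs_sub x y; linarith

/-- Recombination: from bounds on the half-sum and half-difference displacements to the coordinates. [folklore] -/
private theorem tp_recombine {x₁ y₁ x₂ y₂ A B : ℝ}
    (hσ : |(x₂ + y₂) / 2 - (x₁ + y₁) / 2| ≤ A) (hδ : |(x₂ - y₂) / 2 - (x₁ - y₁) / 2| ≤ B) :
    |x₂ - x₁| ≤ A + B ∧ |y₂ - y₁| ≤ A + B := by
  constructor
  · have e : x₂ - x₁ = ((x₂ + y₂) / 2 - (x₁ + y₁) / 2) + ((x₂ - y₂) / 2 - (x₁ - y₁) / 2) := by ring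
    rw [e]; have := abs_add_le ((x₂ + y₂) / 2 - (x₁ + y₁) / 2) ((x₂ - y₂) / 2 - (x₁ - y₁) / 2)
    linarith
  · have e : y₂ - y₁ = ((x₂ + y₂) / 2 - (x₁ + y₁) / 2) - ((x₂ - y₂) / 2 - (x₁ - y₁) / 2) := by ring
    rw [e]; have := abs_sub ((x₂ + y₂) / 2 - (x₁ + y₁) / 2) ((x₂ - y₂) / 2 - (x₁ - y₁) / 2)
    linarith

/-- Recombination, flipped: if the half-differences are opposite, the second point is near `(y₁, x₁)`. [folklore] -/
private theorem tp_recombine_flip {x₁ y₁ x₂ y₂ A B : ℝ}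
    (hσ : |(x₂ + y₂) / 2 - (x₁ + y₁) / 2| ≤ A) (hδ : |(x₂ - y₂) / 2 + (x₁ - y₁) / 2| ≤ B) :
    |x₂ - y₁| ≤ A + B ∧ |y₂ - x₁| ≤ A + B := by
  constructor
  · have e : x₂ - y₁ = ((x₂ + y₂) / 2 - (x₁ + y₁) / 2) + ((x₂ - y₂) / 2 + (x₁ - y₁) / 2) := by ring
    rw [e]; have := abs_add_le ((x₂ + y₂) / 2 - (x₁ + y₁) / 2) ((x₂ - y₂) / 2 + (x₁ - y₁) / 2)
    linarith
  · have e : y₂ - x₁ = ((x₂ + y₂) / 2 - (x₁ + y₁) / 2) - ((x₂ - y₂) / 2 + (x₁ - y₁) / 2) := by ring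
    rw [e]; have := abs_sub ((x₂ + y₂) / 2 - (x₁ + y₁) / 2) ((x₂ - y₂) / 2 + (x₁ - y₁) / 2)
    linarith

/-- `| |δ₂| - |δ₁| | ≤ B` means `|δ₂ - δ₁| ≤ B` or `|δ₂ + δ₁| ≤ B`. [folklore] -/
private theorem tp_abs_abs_cases {δ₁ δ₂ B : ℝ} (h : abs (|δ₁| - |δ₂|) ≤ B) : |δ₂ - δ₁| ≤ B ∨ |δ₂ + δ₁| ≤ B := by
  rcases le_or_gt 0 δ₁ with h1 | h1 <;> rcases le_or_gt 0 δ₂ with h2 | h2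
  · left; rw [abs_of_nonneg h1, abs_of_nonneg h2, abs_sub_comm] at h; exact h
  · right; rw [abs_of_nonneg h1, abs_of_neg h2] at h
    rw [show δ₂ + δ₁ = δ₁ - -δ₂ by ring]; exact h
  · right; rw [abs_of_neg h1, abs_of_nonneg h2] at h
    rw [show δ₂ + δ₁ = -(-δ₁ - δ₂) by ring, abs_neg]; exact h
  · left; rw [abs_of_neg h1, abs_of_neg h2] at h
    rw [show δ₂ - δ₁ = -δ₁ - -δ₂ by ring]; exact h

/-- Per-point data, same parity. [folklore] -/
private theorem tp_same_point {L w Pu Pv x y : ℝ} (hL : 1 ≤ L) (hw : 0 < w) (hwt : w ≤ 1 / (300 * L ^ 2))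
    (h : SamePt L w Pu Pv x y) :
    |(x + y) / 2| ≤ 1 / 20 ∧ |(x - y) / 2| ≤ 1 / 20 ∧
    |Pu - 2 * cos ((x + y) / 2) * cos ((x - y) / 2)| ≤ L * w / 25 ∧
    |Pv - 2 * sin ((x + y) / 2) * cos ((x - y) / 2)| ≤ 3 * L * w ∧
    |(x + y) / 2| ≤ 2 * π * L * (|(x - y) / 2| + w) ∧
    |Pu - 2 * cos ((x + y) / 2) * cos (|(x - y) / 2|)| ≤ 2 * L ^ 2 * w * (2 * |(x - y) / 2| + 3 * w) := by
  obtain ⟨hx, hy, hφ, hu, hv⟩ := h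
  obtain ⟨hwt', -, -, -, -⟩ := tp_consts hL hw hwt
  have sx := tp_small hL hwt' hx hφ
  have sy := tp_small hL hwt' hy hφ
  obtain ⟨tσ, tδ⟩ := tp_half_le x y
  have eU : cos x + cos y = 2 * cos ((x + y) / 2) * cos ((x - y) / 2) := Real.cos_add_cos x y
  have eV : sin x + sin y = 2 * sin ((x + y) / 2) * cos ((x - y) / 2) := sc_sin_add_sin x y
  have hφa : |sin (x - y)| ≤ 2 * |(x - y) / 2| := by
    calc |sin (x - y)| ≤ |x - y| := abs_sin_le_abs
      _ = 2 * |(x - y) / 2| := by rw [abs_div, abs_two]; ring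
  refine ⟨by linarith only [tσ, sx, sy], by linarith only [tδ, sx, sy], ?_, ?_, ?_, ?_⟩
  · rw [← eU]; exact hu.trans (tp_eu_le hL hw hwt' hφ)
  · rw [← eV]; exact hv
  · have h1 : |(x + y) / 2| ≤ π * L * (|sin (x - y)| + 2 * w) := by linarith only [tσ, hx, hy]
    have h2 : π * L * (|sin (x - y)| + 2 * w) ≤ π * L * (2 * |(x - y) / 2| + 2 * w) :=
      mul_le_mul_of_nonneg_left (by linarith only [hφa]) (by positivity)
    linarith only [h1, h2]
  · rw [Real.cos_abs, ← eU]
    have h2 : 2 * L ^ 2 * w * (|sin (x - y)| + 3 * w) ≤ 2 * L ^ 2 * w * (2 * |(x - y) / 2| + 3 * w) :=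
      mul_le_mul_of_nonneg_left (by linarith only [hφa]) (by positivity)
    exact hu.trans h2

/-- Same parity: the second point is within `600 L² w` of the first or of its flip `(y₁, x₁)`.
[cite: DisertoriRivasseau2000, App. B p0018:L1–40] -/
private theorem tp_same_xy {L w Pu Pv x₁ y₁ x₂ y₂ : ℝ} (hL : 1 ≤ L) (hw : 0 < w) (hwt : w ≤ 1 / (300 * L ^ 2))
    (h₁ : SamePt L w Pu Pv x₁ y₁) (h₂ : SamePt L w Pu Pv x₂ y₂) :
    (|x₂ - x₁| ≤ 600 * L ^ 2 * w ∧ |y₂ - y₁| ≤ 600 * L ^ 2 * w) ∨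
      (|x₂ - y₁| ≤ 600 * L ^ 2 * w ∧ |y₂ - x₁| ≤ 600 * L ^ 2 * w) := by
  have hpi' : π ≤ 315 / 100 := by have := Real.pi_lt_d2; norm_num at this; linarith
  obtain ⟨-, hLw, hL2w, hwLw, hLwL2w⟩ := tp_consts hL hw hwt
  have hev' : 3 * L * w ≤ 1 / 100 := by linarith only [hLw]
  obtain ⟨sσ₁, sδ₁, hu₁, hv₁, hK₁, hQ₁⟩ := tp_same_point hL hw hwt h₁
  obtain ⟨sσ₂, sδ₂, hu₂, hv₂, hK₂, hQ₂⟩ := tp_same_point hL hw hwt h₂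
  -- (1) half-sums
  have hσ : |(x₁ + y₁) / 2 - (x₂ + y₂) / 2| ≤ L * w / 25 + 2 * (3 * L * w) :=
    tp_same_sigma sσ₁ sσ₂ sδ₁ sδ₂ (by positivity) (by positivity) hev' hu₁ hu₂ hv₁ hv₂
  -- (2) absolute half-differences
  have hQ : |2 * cos ((x₁ + y₁) / 2) * cos (|(x₁ - y₁) / 2|) - 2 * cos ((x₂ + y₂) / 2) * cos (|(x₂ - y₂) / 2|)|
      ≤ 4 * L ^ 2 * w * (|(x₁ - y₁) / 2| + |(x₂ - y₂) / 2|) + 12 * L ^ 2 * w ^ 2 := by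
    have t := abs_sub_le (2 * cos ((x₁ + y₁) / 2) * cos (|(x₁ - y₁) / 2|)) Pu
      (2 * cos ((x₂ + y₂) / 2) * cos (|(x₂ - y₂) / 2|))
    rw [abs_sub_comm _ Pu] at t
    have e3 : 2 * L ^ 2 * w * (2 * |(x₁ - y₁) / 2| + 3 * w) + 2 * L ^ 2 * w * (2 * |(x₂ - y₂) / 2| + 3 * w) =
        4 * L ^ 2 * w * (|(x₁ - y₁) / 2| + |(x₂ - y₂) / 2|) + 12 * L ^ 2 * w ^ 2 := by ring
    linarith only [t, hQ₁, hQ₂, e3]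
  have hδ := tp_same_delta (K := 2 * π * L) (W := L * w / 25 + 2 * (3 * L * w)) (M := 4 * L ^ 2 * w)
    (N := 12 * L ^ 2 * w ^ 2) (abs_nonneg _) (abs_nonneg _) sδ₁ sδ₂ sσ₁ (by positivity) (by positivity)
    (by positivity) (by positivity) hw hK₁ hK₂ hσ hQ
  -- numerical consolidation
  have hnn : 0 ≤ L ^ 2 * w := by positivity
  have hσ' : |(x₂ + y₂) / 2 - (x₁ + y₁) / 2| ≤ 7 * L ^ 2 * w := by
    rw [abs_sub_comm]; linarith only [hσ, hLwL2w, hwLw, hw]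
  have hδ' : abs (|(x₁ - y₁) / 2| - |(x₂ - y₂) / 2|) ≤ 593 * L ^ 2 * w := by
    have e : w + 5 * (4 * L ^ 2 * w + 2 * π * L * (L * w / 25 + 2 * (3 * L * w))) +
        5 * (12 * L ^ 2 * w ^ 2 / w + 2 * π * L * (L * w / 25 + 2 * (3 * L * w))) =
        w + 80 * (L ^ 2 * w) + (604 / 5) * (π * (L ^ 2 * w)) := by
      field_simp; ring
    rw [e] at hδ
    have hπL : π * (L ^ 2 * w) ≤ 315 / 100 * (L ^ 2 * w) :=
      mul_le_mul_of_nonneg_right hpi' (by positivity)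
    have hwL : w ≤ L ^ 2 * w := hwLw.trans hLwL2w
    linarith only [hδ, hπL, hwL, hnn]
  rcases tp_abs_abs_cases hδ' with h | h
  · left
    have := tp_recombine hσ' h
    constructor <;> linarith only [this.1, this.2, hnn]
  · right
    have := tp_recombine_flip hσ' h
    constructor <;> linarith only [this.1, this.2, hnn]

/-- One point of the opposite-parity class: `|sin δ| ≤ (|P_v| + 3Lw)/1.99` and `φ̂ ≤ 2|sin δ|`. [folklore] -/
private theorem tp_opp_point {L w Pv x y : ℝ} (hc : 199 / 200 ≤ cos ((x + y) / 2))
    (hv : |Pv - (sin x - sin y)| ≤ 3 * L * w) :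
    |sin ((x - y) / 2)| ≤ (|Pv| + 3 * L * w) / (199 / 100) ∧ |sin (x - y)| ≤ 2 * |sin ((x - y) / 2)| := by
  constructor
  · rw [Real.sin_sub_sin] at hv
    have h1 : |2 * sin ((x - y) / 2) * cos ((x + y) / 2)| ≤ |Pv| + 3 * L * w := by
      have := abs_sub_abs_le_abs_sub (2 * sin ((x - y) / 2) * cos ((x + y) / 2)) Pv
      rw [abs_sub_comm] at hv; linarith
    rw [abs_mul, abs_mul, abs_two, abs_of_nonneg (by linarith : 0 ≤ cos ((x + y) / 2))] at h1
    rw [le_div_iff₀ (by norm_num)]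
    have : 2 * |sin ((x - y) / 2)| * (199 / 200) ≤ 2 * |sin ((x - y) / 2)| * cos ((x + y) / 2) := by
      gcongr
    linarith
  · have e : x - y = 2 * ((x - y) / 2) := by ring
    conv_lhs => rw [e, Real.sin_two_mul]
    rw [abs_mul, abs_mul, abs_two]
    have := abs_cos_le_one ((x - y) / 2)
    nlinarith [abs_nonneg (sin ((x - y) / 2)), abs_nonneg (cos ((x - y) / 2))]

/-- Per-point data, opposite parity (both sub-cases). [folklore] -/
private theorem tp_opp_pointdata {L w Pu Pv x y : ℝ} (hL : 1 ≤ L) (hw : 0 < w) (hwt : w ≤ 1 / (300 * L ^ 2))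
    (h : OppPt L w Pu Pv x y) :
    |(x + y) / 2| ≤ 1 / 20 ∧ |(x - y) / 2| ≤ 1 / 20 ∧
    |Pv - 2 * sin ((x - y) / 2) * cos ((x + y) / 2)| ≤ 3 * L * w ∧
    (|Pv| ≤ 30 * L * w → |x| ≤ 120 * L ^ 2 * w ∧ |y| ≤ 120 * L ^ 2 * w) ∧
    (30 * L * w < |Pv| →
      |Pu - (-2 * sin ((x + y) / 2) * sin ((x - y) / 2))| ≤ (5 / 2 * L ^ 2 * w) * |Pv| ∧
      |(x + y) / 2| ≤ (38 / 10 * L) * |Pv|) := by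
  obtain ⟨hx, hy, hφ, hu, hv⟩ := h
  have hpi' : π ≤ 315 / 100 := by have := Real.pi_lt_d2; norm_num at this; linarith
  have hL0 : 0 < L := by linarith
  obtain ⟨hwt', hLw, hL2w, hwLw, hLwL2w⟩ := tp_consts hL hw hwt
  have sx := tp_small hL hwt' hx hφ
  have sy := tp_small hL hwt' hy hφ
  obtain ⟨tσ, tδ⟩ := tp_half_le x y
  have sσ : |(x + y) / 2| ≤ 1 / 20 := by linarith only [tσ, sx, sy]
  have sδ : |(x - y) / 2| ≤ 1 / 20 := by linarith only [tδ, sx, sy]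
  have cσ : 199 / 200 ≤ cos ((x + y) / 2) := sc_cos_ge (by linarith only [sσ])
  obtain ⟨ps, pφ⟩ := tp_opp_point cσ hv
  have eV : sin x - sin y = 2 * sin ((x - y) / 2) * cos ((x + y) / 2) := Real.sin_sub_sin x y
  have eU : cos x - cos y = -2 * sin ((x + y) / 2) * sin ((x - y) / 2) := Real.cos_sub_cos x y
  refine ⟨sσ, sδ, by rw [← eV]; exact hv, ?_, ?_⟩
  · intro hV
    have h3 : |sin ((x - y) / 2)| ≤ 17 * L * w := by
      refine ps.trans ?_; rw [div_le_iff₀ (by norm_num)]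
      have : 0 ≤ L * w := by positivity
      linarith
    have h4 : |sin (x - y)| ≤ 34 * L * w := by linarith
    have h5 : π * L * (|sin (x - y)| + 2 * w) ≤ 120 * L ^ 2 * w := by
      have h6 : |sin (x - y)| + 2 * w ≤ 36 * (L * w) := by linarith only [h4, hwLw]
      have h7 : π * L * (|sin (x - y)| + 2 * w) ≤ π * L * (36 * (L * w)) :=
        mul_le_mul_of_nonneg_left h6 (by positivity)
      have h8 : π * (L ^ 2 * w) ≤ 315 / 100 * (L ^ 2 * w) :=
        mul_le_mul_of_nonneg_right hpi' (by positivity)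
      have e : π * L * (36 * (L * w)) = 36 * (π * (L ^ 2 * w)) := by ring
      rw [e] at h7
      linarith only [h7, h8, show 0 ≤ L ^ 2 * w by positivity]
    exact ⟨hx.trans h5, hy.trans h5⟩
  · intro hV
    have hVpos : 0 < |Pv| := lt_of_le_of_lt (by positivity) hV
    have hw' : w ≤ |Pv| / 30 := by
      rw [le_div_iff₀ (by norm_num)]; nlinarith only [hV, hwLw]
    have h3 : |sin ((x - y) / 2)| ≤ 56 / 100 * |Pv| := by
      refine ps.trans ?_; rw [div_le_iff₀ (by norm_num)]
      have : 0 ≤ L * w := by positivity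
      linarith
    have h4 : |sin (x - y)| ≤ 112 / 100 * |Pv| := by linarith
    constructor
    · rw [← eU]
      refine hu.trans ?_
      have h5 : |sin (x - y)| + 3 * w ≤ 122 / 100 * |Pv| := by linarith
      have h6 : 2 * L ^ 2 * w * (|sin (x - y)| + 3 * w) ≤ 2 * L ^ 2 * w * (122 / 100 * |Pv|) :=
        mul_le_mul_of_nonneg_left h5 (by positivity)
      have : 0 ≤ L ^ 2 * w * |Pv| := by positivity
      linarith only [h6, this]
    · have h5 : |sin (x - y)| + 2 * w ≤ 119 / 100 * |Pv| := by linarith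
      have h6 : |(x + y) / 2| ≤ π * L * (|sin (x - y)| + 2 * w) := by linarith only [tσ, hx, hy]
      have h7 : π * L * (|sin (x - y)| + 2 * w) ≤ π * L * (119 / 100 * |Pv|) :=
        mul_le_mul_of_nonneg_left h5 (by positivity)
      have h8 : π * (L * |Pv|) ≤ 315 / 100 * (L * |Pv|) :=
        mul_le_mul_of_nonneg_right hpi' (by positivity)
      have e : π * L * (119 / 100 * |Pv|) = 119 / 100 * (π * (L * |Pv|)) := by ring
      rw [e] at h7
      have : 0 ≤ L * |Pv| := by positivity
      linarith

/-- Opposite parity: the second point is within `600 L² w` of the first.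
[cite: DisertoriRivasseau2000, App. B p0018:L41–70] -/
private theorem tp_opp_xy {L w Pu Pv x₁ y₁ x₂ y₂ : ℝ} (hL : 1 ≤ L) (hw : 0 < w) (hwt : w ≤ 1 / (300 * L ^ 2))
    (h₁ : OppPt L w Pu Pv x₁ y₁) (h₂ : OppPt L w Pu Pv x₂ y₂) :
    |x₂ - x₁| ≤ 600 * L ^ 2 * w ∧ |y₂ - y₁| ≤ 600 * L ^ 2 * w := by
  obtain ⟨-, hLw, hL2w, hwLw, hLwL2w⟩ := tp_consts hL hw hwt
  obtain ⟨sσ₁, sδ₁, hv₁, sm₁, bg₁⟩ := tp_opp_pointdata hL hw hwt h₁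
  obtain ⟨sσ₂, sδ₂, hv₂, sm₂, bg₂⟩ := tp_opp_pointdata hL hw hwt h₂
  by_cases hV : |Pv| ≤ 30 * L * w
  · obtain ⟨bx₁, by₁⟩ := sm₁ hV
    obtain ⟨bx₂, by₂⟩ := sm₂ hV
    have hnn : 0 ≤ L ^ 2 * w := by positivity
    constructor
    · have := abs_sub x₂ x₁; linarith only [this, bx₁, bx₂, hnn]
    · have := abs_sub y₂ y₁; linarith only [this, by₁, by₂, hnn]
  · push Not at hV
    have hVpos : 0 < |Pv| := lt_of_le_of_lt (by positivity) hV
    obtain ⟨pu₁, pσ₁⟩ := bg₁ hV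
    obtain ⟨pu₂, pσ₂⟩ := bg₂ hV
    have hσ := tp_opp_sigma (cu := 5 / 2 * L ^ 2 * w) (cσ := 38 / 10 * L) sσ₁ sσ₂ (by positivity)
      (by positivity) (by positivity) (by linarith only [hV]) hVpos le_rfl pσ₁ pσ₂ pu₁ pu₂ hv₁ hv₂
    have hδ := tp_opp_delta sσ₁ sσ₂ sδ₁ sδ₂ (by positivity) (le_trans (abs_nonneg _) hσ) hσ hv₁ hv₂
    have hσ' : |(x₂ + y₂) / 2 - (x₁ + y₁) / 2| ≤ 139 / 2 * L ^ 2 * w := by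
      rw [abs_sub_comm]
      calc _ ≤ 5 * (5 / 2 * L ^ 2 * w) + 5 * (3 * L * w * (38 / 10 * L)) := hσ
        _ = 139 / 2 * L ^ 2 * w := by ring
    have hδ' : |(x₂ - y₂) / 2 - (x₁ - y₁) / 2| ≤ 13 * L ^ 2 * w := by
      rw [abs_sub_comm]
      calc _ ≤ 2 * (3 * L * w) + (5 * (5 / 2 * L ^ 2 * w) + 5 * (3 * L * w * (38 / 10 * L))) / 10 := hδ
        _ = 6 * (L * w) + 139 / 20 * (L ^ 2 * w) := by ring
        _ ≤ 13 * L ^ 2 * w := by linarith only [hLwL2w, hw, hL2w, show 0 ≤ L ^ 2 * w by positivity]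
    have := tp_recombine hσ' hδ'
    have hnn : 0 ≤ L ^ 2 * w := by positivity
    constructor <;> linarith only [this.1, this.2, hnn]

/-- Transverse regime, in the original coordinates: the half-sums agree modulo `π` to `5700 L² w` and
the reduced half-differences agree in absolute value to `3.1·10⁶ L³ w`.
[cite: DisertoriRivasseau2000, App. B p0017:L46–60] -/
private theorem tp_trans_st {L w Pu Pv s₁ t₁ s₂ t₂ : ℝ} (hL : 1 ≤ L) (hw : 0 < w) (hwt : w ≤ 1 / (600 * L ^ 2))
    (hd₁ : 1 / (200 * L) < |sin (s₁ - t₁)|) (hd₂ : 1 / (200 * L) < |sin (s₂ - t₂)|)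
    (hu₁ : |Pu - (cos s₁ + cos t₁)| ≤ 3 * L * w) (hu₂ : |Pu - (cos s₂ + cos t₂)| ≤ 3 * L * w)
    (hv₁ : |Pv - (sin s₁ + sin t₁)| ≤ 3 * L * w) (hv₂ : |Pv - (sin s₂ + sin t₂)| ≤ 3 * L * w) :
    |redPi ((s₁ + t₁) / 2 - (s₂ + t₂) / 2)| ≤ 5700 * L ^ 2 * w ∧
      abs (|redPi ((s₁ - t₁) / 2)| - |redPi ((s₂ - t₂) / 2)|) ≤ 3100000 * L ^ 3 * w := by
  have hpi := Real.pi_lt_d2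
  have hpi3 := Real.pi_gt_three
  have hL0 : 0 < L := by linarith
  set τ := 1 / (200 * L) with hτ
  have hτpos : 0 < τ := by positivity
  have hτ1 : τ ≤ 1 := by rw [hτ, div_le_one (by positivity)]; linarith
  have hρτ : 3 * L * w ≤ τ := by
    rw [hτ, le_div_iff₀ (by positivity)]
    calc 3 * L * w * (200 * L) = 600 * L ^ 2 * w := by ring
      _ ≤ 600 * L ^ 2 * (1 / (600 * L ^ 2)) := by gcongr
      _ = 1 := by field_simp
  -- sum-to-product
  have eU : ∀ s t : ℝ, cos s + cos t = 2 * cos ((s - t) / 2) * cos ((s + t) / 2) := by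
    intro s t; rw [Real.cos_add_cos]; ring
  have eV : ∀ s t : ℝ, sin s + sin t = 2 * cos ((s - t) / 2) * sin ((s + t) / 2) := by
    intro s t; rw [sc_sin_add_sin]; ring
  have e2 : ∀ s t : ℝ, s - t = 2 * ((s - t) / 2) := fun s t => by ring
  have hd₁' : τ < |sin (2 * ((s₁ - t₁) / 2))| := by rw [← e2]; exact hd₁
  have hd₂' : τ < |sin (2 * ((s₂ - t₂) / 2))| := by rw [← e2]; exact hd₂
  rw [eU] at hu₁ hu₂; rw [eV] at hv₁ hv₂
  obtain ⟨hsin, hcos⟩ := tp_trans (by positivity) hτpos hρτ hd₁' hd₂' hu₁ hu₂ hv₁ hv₂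
  constructor
  · -- `|redPi(σ₁ - σ₂)| ≤ (π/2)|sin(σ₁ - σ₂)| ≤ (π/2)·6ρ/τ`
    calc |redPi ((s₁ + t₁) / 2 - (s₂ + t₂) / 2)| ≤ π / 2 * |sin ((s₁ + t₁) / 2 - (s₂ + t₂) / 2)| :=
          sc_abs_redPi_le_sin _
      _ ≤ π / 2 * (6 * (3 * L * w) / τ) := by gcongr
      _ = π / 2 * 3600 * (L ^ 2 * w) := by rw [hτ]; field_simp; ring
      _ ≤ 5700 * L ^ 2 * w := by nlinarith [show 0 ≤ L ^ 2 * w by positivity]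
  · -- the radial equation through the reduced half-differences
    have key : ∀ d : ℝ, τ < |sin (2 * d)| →
        τ / 2 ≤ cos (|redPi d|) ∧ τ / 2 ≤ sin (|redPi d|) ∧ cos (|redPi d|) ^ 2 = cos d ^ 2 := by
      intro d hd
      have hprod : τ < 2 * |sin d| * |cos d| := by
        rw [Real.sin_two_mul, abs_mul, abs_mul, abs_two] at hd; linarith
      have hs : τ / 2 ≤ |sin d| := by nlinarith [abs_cos_le_one d, abs_nonneg (sin d), abs_nonneg (cos d)]
      have hc : τ / 2 ≤ |cos d| := by nlinarith [abs_sin_le_one d, abs_nonneg (sin d), abs_nonneg (cos d)]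
      refine ⟨?_, ?_, ?_⟩
      · rw [Real.cos_abs, ← abs_of_nonneg (sc_cos_redPi_nonneg d), sc_abs_cos_redPi]; exact hc
      · have : sin |redPi d| = |sin (redPi d)| := by
          rcases le_or_gt 0 (redPi d) with h | h
          · rw [abs_of_nonneg h, abs_of_nonneg]
            exact sin_nonneg_of_nonneg_of_le_pi h (by linarith [abs_le.1 (sc_abs_redPi_le d)])
          · rw [abs_of_neg h, sin_neg, abs_of_neg]
            apply sin_neg_of_neg_of_neg_pi_lt h; linarith [abs_le.1 (sc_abs_redPi_le d)]
        rw [this, sc_abs_sin_redPi]; exact hs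
      · rw [Real.cos_abs, ← sq_abs (cos (redPi d)), sc_abs_cos_redPi, sq_abs]
    obtain ⟨c1, s1, q1⟩ := key _ hd₁'
    obtain ⟨c2, s2, q2⟩ := key _ hd₂'
    have hE : |cos (|redPi ((s₁ - t₁) / 2)|) ^ 2 - cos (|redPi ((s₂ - t₂) / 2)|) ^ 2| ≤ 4 * (3 * L * w) := by
      rw [q1, q2]; exact hcos
    have h := tp_abs_sub_of_cos_sq (abs_nonneg _) (abs_nonneg _) (sc_abs_redPi_le _) (sc_abs_redPi_le _)
      (by positivity : 0 < τ / 2) c1 c2 s1 s2 hE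
    calc _ ≤ π / 2 * (4 * (3 * L * w) / (τ / 2) ^ 2) := h
      _ = π / 2 * 1920000 * (L ^ 3 * w) := by rw [hτ]; field_simp; ring
      _ ≤ 3100000 * L ^ 3 * w := by nlinarith [show 0 ≤ L ^ 3 * w by positivity]

end TwoPoint

/-! ### §5 The `(θ_p, θ_q)`-section of `G_{pq}`: reduction to the two-point estimates -/

section Cover

/-- The section conditions of `G_{pq}` in the two moving centres `s = θ_p`, `t = θ_q`, the other
centres being frozen into `A_u = 1 + Σ' cos(θ_i - θ₁)`, `A_v = Σ' sin(θ_i - θ₁)`. [folklore] -/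
private def InSect (L w θ₁ Au Av s t : ℝ) : Prop :=
  |Au + cos (s - θ₁) + cos (t - θ₁)| ≤ 3 * L * w ∧ |Av + sin (s - θ₁) + sin (t - θ₁)| ≤ 3 * L * w ∧
  (|sin (s - t)| ≤ 1 / (200 * L) → w ≤ 1 / (200 * L) →
    |sin (s - θ₁)| ≤ 2 * L * (|sin (s - t)| + 2 * w) ∧ |sin (t - θ₁)| ≤ 2 * L * (|sin (s - t)| + 2 * w) ∧
    |Au + cos (s - θ₁) + cos (t - θ₁)| ≤ 2 * L ^ 2 * w * (|sin (s - t)| + 3 * w))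

/-- Explicit sign version of `sc_redPi_sign`. [folklore] -/
private theorem sc_redPi_pow (u : ℝ) :
    cos u = (-1 : ℝ) ^ (round (u / π)) * cos (redPi u) ∧ sin u = (-1 : ℝ) ^ (round (u / π)) * sin (redPi u) ∧
    ((-1 : ℝ) ^ (round (u / π)) = 1 ∨ (-1 : ℝ) ^ (round (u / π)) = -1) := by
  have hx : u = redPi u + (round (u / π) : ℤ) * π := (sc_redPi_add u).symm
  refine ⟨?_, ?_, ?_⟩
  · conv_lhs => rw [hx]
    rw [Real.cos_add_int_mul_pi]
  · conv_lhs => rw [hx]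
    rw [Real.sin_add_int_mul_pi]
  · rcases Int.even_or_odd (round (u / π)) with h | h
    · left; exact h.neg_one_zpow
    · right; exact h.neg_one_zpow

/-- `s = θ₁ + mπ + redPi(s - θ₁)` with `m = round((s - θ₁)/π)`. [folklore] -/
private theorem sc_decomp (s θ₁ : ℝ) : s = θ₁ + (round ((s - θ₁) / π) : ℝ) * π + redPi (s - θ₁) := by
  have := sc_redPi_add (s - θ₁); linarith

/-- `|sin(s - t)| = |sin(redPi(s-θ₁) - redPi(t-θ₁))|`. [folklore] -/
private theorem sc_sin_diff_red (s t θ₁ : ℝ) :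
    |sin (s - t)| = |sin (redPi (s - θ₁) - redPi (t - θ₁))| := by
  have hs := sc_decomp s θ₁
  have ht := sc_decomp t θ₁
  have e : s - t = (redPi (s - θ₁) - redPi (t - θ₁)) +
      ((round ((s - θ₁) / π) - round ((t - θ₁) / π) : ℤ) : ℝ) * π := by
    push_cast; linarith
  rw [e, Real.sin_add_int_mul_pi, abs_mul, abs_neg_one_zpow, one_mul]

/-- **Reduction of a near-parallel point to the two-point data** (same / opposite parity according to
the parities of `m = round((s-θ₁)/π)`, `m' = round((t-θ₁)/π)`). [folklore] -/
private theorem red_point {L w θ₁ Au Av s t : ℝ} (hL : 1 ≤ L) (hI : InSect L w θ₁ Au Av s t)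
    (hA : |sin (s - t)| ≤ 1 / (200 * L)) (hw : w ≤ 1 / (200 * L)) :
    ((-1 : ℝ) ^ (round ((s - θ₁) / π)) = (-1 : ℝ) ^ (round ((t - θ₁) / π)) →
        SamePt L w (-((-1 : ℝ) ^ (round ((s - θ₁) / π))) * Au) (-((-1 : ℝ) ^ (round ((s - θ₁) / π))) * Av)
          (redPi (s - θ₁)) (redPi (t - θ₁))) ∧
    ((-1 : ℝ) ^ (round ((s - θ₁) / π)) ≠ (-1 : ℝ) ^ (round ((t - θ₁) / π)) →
        OppPt L w (-((-1 : ℝ) ^ (round ((s - θ₁) / π))) * Au) (-((-1 : ℝ) ^ (round ((s - θ₁) / π))) * Av)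
          (redPi (s - θ₁)) (redPi (t - θ₁))) := by
  obtain ⟨hu0, hv0, himp⟩ := hI
  obtain ⟨hs1, ht1, hu1⟩ := himp hA hw
  obtain ⟨cs, ss, εs⟩ := sc_redPi_pow (s - θ₁)
  obtain ⟨ct, st, εt⟩ := sc_redPi_pow (t - θ₁)
  set x := redPi (s - θ₁) with hxdef
  set y := redPi (t - θ₁) with hydef
  set e₁ := (-1 : ℝ) ^ (round ((s - θ₁) / π)) with he₁
  set e₂ := (-1 : ℝ) ^ (round ((t - θ₁) / π)) with he₂
  have hφ : |sin (s - t)| = |sin (x - y)| := sc_sin_diff_red s t θ₁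
  have hL0 : 0 < L := by linarith
  have hxb : |x| ≤ π * L * (|sin (x - y)| + 2 * w) := by
    calc |x| ≤ π / 2 * |sin (s - θ₁)| := sc_abs_redPi_le_sin _
      _ ≤ π / 2 * (2 * L * (|sin (s - t)| + 2 * w)) := by gcongr
      _ = π * L * (|sin (x - y)| + 2 * w) := by rw [hφ]; ring
  have hyb : |y| ≤ π * L * (|sin (x - y)| + 2 * w) := by
    calc |y| ≤ π / 2 * |sin (t - θ₁)| := sc_abs_redPi_le_sin _
      _ ≤ π / 2 * (2 * L * (|sin (s - t)| + 2 * w)) := by gcongr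
      _ = π * L * (|sin (x - y)| + 2 * w) := by rw [hφ]; ring
  have hA' : |sin (x - y)| ≤ 1 / (200 * L) := hφ ▸ hA
  rw [hφ] at hu1
  constructor
  · intro hpar
    refine ⟨hxb, hyb, hA', ?_, ?_⟩
    · have e : -e₁ * Au - (cos x + cos y) = -e₁ * (Au + cos (s - θ₁) + cos (t - θ₁)) := by
        rw [cs, ct, ← hpar]
        rcases εs with h | h <;> simp only [h] <;> ring
      rw [e, abs_mul, abs_neg]
      rcases εs with h | h <;> simp only [h, abs_one, abs_neg, one_mul] <;> exact hu1
    · have e : -e₁ * Av - (sin x + sin y) = -e₁ * (Av + sin (s - θ₁) + sin (t - θ₁)) := by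
        rw [ss, st, ← hpar]
        rcases εs with h | h <;> simp only [h] <;> ring
      rw [e, abs_mul, abs_neg]
      rcases εs with h | h <;> simp only [h, abs_one, abs_neg, one_mul] <;> exact hv0
  · intro hpar
    have hopp : e₂ = -e₁ := by
      rcases εs with h | h <;> rcases εt with h' | h'
      · exact absurd (h.trans h'.symm) hpar
      · rw [h, h']
      · rw [h, h']; norm_num
      · exact absurd (h.trans h'.symm) hpar
    refine ⟨hxb, hyb, hA', ?_, ?_⟩
    · have e : -e₁ * Au - (cos x - cos y) = -e₁ * (Au + cos (s - θ₁) + cos (t - θ₁)) := by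
        rw [cs, ct, hopp]
        rcases εs with h | h <;> simp only [h] <;> ring
      rw [e, abs_mul, abs_neg]
      rcases εs with h | h <;> simp only [h, abs_one, abs_neg, one_mul] <;> exact hu1
    · have e : -e₁ * Av - (sin x - sin y) = -e₁ * (Av + sin (s - θ₁) + sin (t - θ₁)) := by
        rw [ss, st, hopp]
        rcases εs with h | h <;> simp only [h] <;> ring
      rw [e, abs_mul, abs_neg]
      rcases εs with h | h <;> simp only [h, abs_one, abs_neg, one_mul] <;> exact hv0

/-- **Pair lemma, near-parallel regime**: two points of the section with the same integers
`(m, m')` are `600 L² w`-close, directly or after the flip. [folklore] -/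
private theorem pairA {L w θ₁ Au Av s₀ t₀ s t : ℝ} (hL : 1 ≤ L) (hw : 0 < w) (hwt : w ≤ 1 / (300 * L ^ 2))
    (hI₀ : InSect L w θ₁ Au Av s₀ t₀) (hI : InSect L w θ₁ Au Av s t)
    (hA₀ : |sin (s₀ - t₀)| ≤ 1 / (200 * L)) (hA : |sin (s - t)| ≤ 1 / (200 * L))
    (hm : round ((s - θ₁) / π) = round ((s₀ - θ₁) / π))
    (hm' : round ((t - θ₁) / π) = round ((t₀ - θ₁) / π)) :
    (|s - s₀| ≤ 600 * L ^ 2 * w ∧ |t - t₀| ≤ 600 * L ^ 2 * w) ∨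
    (|s - (t₀ + ((round ((s₀ - θ₁) / π) : ℝ) - round ((t₀ - θ₁) / π)) * π)| ≤ 600 * L ^ 2 * w ∧
      |t - (s₀ + ((round ((t₀ - θ₁) / π) : ℝ) - round ((s₀ - θ₁) / π)) * π)| ≤ 600 * L ^ 2 * w) := by
  obtain ⟨hwt', -, -, -, -⟩ := tp_consts hL hw hwt
  have d₀ := sc_decomp s₀ θ₁
  have e₀ := sc_decomp t₀ θ₁
  have d := sc_decomp s θ₁
  have e := sc_decomp t θ₁
  obtain ⟨same₀, opp₀⟩ := red_point hL hI₀ hA₀ hwt'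
  obtain ⟨same, opp⟩ := red_point hL hI hA hwt'
  rw [hm] at same opp d
  rw [hm'] at same opp e
  by_cases hpar : (-1 : ℝ) ^ (round ((s₀ - θ₁) / π)) = (-1 : ℝ) ^ (round ((t₀ - θ₁) / π))
  · have h := tp_same_xy hL hw hwt (same₀ hpar) (same hpar)
    rcases h with ⟨h1, h2⟩ | ⟨h1, h2⟩
    · left; constructor
      · have : s - s₀ = redPi (s - θ₁) - redPi (s₀ - θ₁) := by linarith
        rw [this]; exact h1
      · have : t - t₀ = redPi (t - θ₁) - redPi (t₀ - θ₁) := by linarith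
        rw [this]; exact h2
    · right; constructor
      · have : s - (t₀ + ((round ((s₀ - θ₁) / π) : ℝ) - round ((t₀ - θ₁) / π)) * π) =
            redPi (s - θ₁) - redPi (t₀ - θ₁) := by linarith
        rw [this]; exact h1
      · have : t - (s₀ + ((round ((t₀ - θ₁) / π) : ℝ) - round ((s₀ - θ₁) / π)) * π) =
            redPi (t - θ₁) - redPi (s₀ - θ₁) := by linarith
        rw [this]; exact h2
  · have h := tp_opp_xy hL hw hwt (opp₀ hpar) (opp hpar)
    left; constructor
    · have : s - s₀ = redPi (s - θ₁) - redPi (s₀ - θ₁) := by linarith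
      rw [this]; exact h.1
    · have : t - t₀ = redPi (t - θ₁) - redPi (t₀ - θ₁) := by linarith
      rw [this]; exact h.2

/-- **Pair lemma, transverse regime**: two points of the section are `R_B`-close modulo `π` in each
coordinate, directly or after the shift by `∓ 2 y₀`, `y₀ = redPi((s₀ - t₀)/2)`; the integers are
bounded by `3` when the arcs have length `≤ 2π` and `R_B ≤ 1`. [folklore] -/
private theorem pairB {L w θ₁ Au Av s₀ t₀ s t : ℝ} (hL : 1 ≤ L) (hw : 0 < w) (hwt : w ≤ 1 / (600 * L ^ 2))
    (hR : 5700 * L ^ 2 * w + 3100000 * L ^ 3 * w ≤ 1)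
    (hI₀ : InSect L w θ₁ Au Av s₀ t₀) (hI : InSect L w θ₁ Au Av s t)
    (hB₀ : 1 / (200 * L) < |sin (s₀ - t₀)|) (hB : 1 / (200 * L) < |sin (s - t)|)
    (hds : |s - s₀| ≤ 2 * π) (hdt : |t - t₀| ≤ 2 * π) :
    ∃ j j' : ℤ, |j| ≤ 3 ∧ |j'| ≤ 3 ∧
      ((|s - (s₀ + j * π)| ≤ 5700 * L ^ 2 * w + 3100000 * L ^ 3 * w ∧
        |t - (t₀ + j' * π)| ≤ 5700 * L ^ 2 * w + 3100000 * L ^ 3 * w) ∨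
       (|s - (s₀ - 2 * redPi ((s₀ - t₀) / 2) + j * π)| ≤ 5700 * L ^ 2 * w + 3100000 * L ^ 3 * w ∧
        |t - (t₀ + 2 * redPi ((s₀ - t₀) / 2) + j' * π)| ≤ 5700 * L ^ 2 * w + 3100000 * L ^ 3 * w)) := by
  set R := 5700 * L ^ 2 * w + 3100000 * L ^ 3 * w with hRdef
  obtain ⟨hu₀, hv₀, -⟩ := hI₀
  obtain ⟨hu, hv, -⟩ := hI
  -- shifted variables
  have key := tp_trans_st (Pu := -Au) (Pv := -Av) (s₁ := s₀ - θ₁) (t₁ := t₀ - θ₁) (s₂ := s - θ₁)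
    (t₂ := t - θ₁) hL hw hwt
    (by have : s₀ - θ₁ - (t₀ - θ₁) = s₀ - t₀ := by ring
        rw [this]; exact hB₀)
    (by have : s - θ₁ - (t - θ₁) = s - t := by ring
        rw [this]; exact hB)
    (by have : -Au - (cos (s₀ - θ₁) + cos (t₀ - θ₁)) = -(Au + cos (s₀ - θ₁) + cos (t₀ - θ₁)) := by ring
        rw [this, abs_neg]; exact hu₀)
    (by have : -Au - (cos (s - θ₁) + cos (t - θ₁)) = -(Au + cos (s - θ₁) + cos (t - θ₁)) := by ring
        rw [this, abs_neg]; exact hu)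
    (by have : -Av - (sin (s₀ - θ₁) + sin (t₀ - θ₁)) = -(Av + sin (s₀ - θ₁) + sin (t₀ - θ₁)) := by ring
        rw [this, abs_neg]; exact hv₀)
    (by have : -Av - (sin (s - θ₁) + sin (t - θ₁)) = -(Av + sin (s - θ₁) + sin (t - θ₁)) := by ring
        rw [this, abs_neg]; exact hv)
  obtain ⟨kσ, kd⟩ := key
  have eσ : (s₀ - θ₁ + (t₀ - θ₁)) / 2 - (s - θ₁ + (t - θ₁)) / 2 = (s₀ + t₀) / 2 - (s + t) / 2 := by ring
  have ed₀ : (s₀ - θ₁ - (t₀ - θ₁)) / 2 = (s₀ - t₀) / 2 := by ring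
  have ed : (s - θ₁ - (t - θ₁)) / 2 = (s - t) / 2 := by ring
  rw [eσ] at kσ
  rw [ed₀, ed] at kd
  -- decompositions
  set σd := (s₀ + t₀) / 2 - (s + t) / 2 with hσd
  have dσ : σd = redPi σd + (round (σd / π) : ℝ) * π := (sc_redPi_add σd).symm
  have dd₀ : (s₀ - t₀) / 2 = redPi ((s₀ - t₀) / 2) + (round (((s₀ - t₀) / 2) / π) : ℝ) * π :=
    (sc_redPi_add _).symm
  have dd : (s - t) / 2 = redPi ((s - t) / 2) + (round (((s - t) / 2) / π) : ℝ) * π :=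
    (sc_redPi_add _).symm
  set n := round (σd / π) with hn
  set k₀ := round (((s₀ - t₀) / 2) / π) with hk₀
  set k := round (((s - t) / 2) / π) with hk
  set y₀ := redPi ((s₀ - t₀) / 2) with hy₀
  set y := redPi ((s - t) / 2) with hy
  set eρ := redPi σd with heρ
  have heb : |eρ| ≤ 5700 * L ^ 2 * w := kσ
  -- `s = (s+t)/2 + (s-t)/2`, etc.
  have Es : s - s₀ = -σd + ((s - t) / 2 - (s₀ - t₀) / 2) := by rw [hσd]; ring
  have Et : t - t₀ = -σd - ((s - t) / 2 - (s₀ - t₀) / 2) := by rw [hσd]; ring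
  have kd' : abs (|y₀| - |y|) ≤ 3100000 * L ^ 3 * w := kd
  rcases tp_abs_abs_cases kd' with hyy | hyy
  · -- same sign: `s - s₀ = -eρ - nπ + (y - y₀) + (k - k₀)π`
    refine ⟨k - k₀ - n, -n - (k - k₀), ?_, ?_, Or.inl ⟨?_, ?_⟩⟩
    · -- bound on `j`
      have h1 : |((k - k₀ - n : ℤ) : ℝ) * π| ≤ |s - s₀| + |eρ| + |y - y₀| := by
        have e1 : ((k - k₀ - n : ℤ) : ℝ) * π = (s - s₀) + eρ - (y - y₀) := by
          push_cast; rw [Es, dσ, dd, dd₀]; ring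
        rw [e1]
        calc |s - s₀ + eρ - (y - y₀)| ≤ |s - s₀ + eρ| + |y - y₀| := abs_sub _ _
          _ ≤ |s - s₀| + |eρ| + |y - y₀| := by gcongr; exact abs_add_le _ _
      have h2 : |((k - k₀ - n : ℤ) : ℝ)| * π ≤ 2 * π + 1 := by
        rw [← abs_of_pos pi_pos, ← abs_mul, abs_of_pos pi_pos]
        have : |eρ| + |y - y₀| ≤ 1 := by linarith only [heb, hyy, hR]
        linarith only [h1, this, hds]
      have h3 : |((k - k₀ - n : ℤ) : ℝ)| < 4 := by
        by_contra hc; push Not at hc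
        have hm := mul_le_mul_of_nonneg_right hc pi_pos.le
        linarith only [hm, h2, Real.pi_gt_three]
      have h4 : |(k - k₀ - n : ℤ)| < 4 := by exact_mod_cast h3
      omega
    · have h1 : |((-n - (k - k₀) : ℤ) : ℝ) * π| ≤ |t - t₀| + |eρ| + |y - y₀| := by
        have e1 : ((-n - (k - k₀) : ℤ) : ℝ) * π = (t - t₀) + eρ + (y - y₀) := by
          push_cast; rw [Et, dσ, dd, dd₀]; ring
        rw [e1]
        calc |t - t₀ + eρ + (y - y₀)| ≤ |t - t₀ + eρ| + |y - y₀| := abs_add_le _ _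
          _ ≤ |t - t₀| + |eρ| + |y - y₀| := by gcongr; exact abs_add_le _ _
      have h2 : |((-n - (k - k₀) : ℤ) : ℝ)| * π ≤ 2 * π + 1 := by
        rw [← abs_of_pos pi_pos, ← abs_mul, abs_of_pos pi_pos]
        have : |eρ| + |y - y₀| ≤ 1 := by linarith only [heb, hyy, hR]
        linarith only [h1, this, hdt]
      have h3 : |((-n - (k - k₀) : ℤ) : ℝ)| < 4 := by
        by_contra hc; push Not at hc
        have hm := mul_le_mul_of_nonneg_right hc pi_pos.le
        linarith only [hm, h2, Real.pi_gt_three]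
      have h4 : |(-n - (k - k₀) : ℤ)| < 4 := by exact_mod_cast h3
      omega
    · have e1 : s - (s₀ + ((k - k₀ - n : ℤ) : ℝ) * π) = -eρ + (y - y₀) := by
        push_cast; rw [show s = s₀ + (s - s₀) by ring, Es, dσ, dd, dd₀]; ring
      rw [e1]
      calc |-eρ + (y - y₀)| ≤ |-eρ| + |y - y₀| := abs_add_le _ _
        _ ≤ 5700 * L ^ 2 * w + 3100000 * L ^ 3 * w := by rw [abs_neg]; exact add_le_add heb hyy
    · have e1 : t - (t₀ + ((-n - (k - k₀) : ℤ) : ℝ) * π) = -eρ - (y - y₀) := by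
        push_cast; rw [show t = t₀ + (t - t₀) by ring, Et, dσ, dd, dd₀]; ring
      rw [e1]
      calc |-eρ - (y - y₀)| ≤ |-eρ| + |y - y₀| := abs_sub _ _
        _ ≤ 5700 * L ^ 2 * w + 3100000 * L ^ 3 * w := by rw [abs_neg]; exact add_le_add heb hyy
  · -- opposite signs: `y - y₀ = (y + y₀) - 2 y₀`
    refine ⟨k - k₀ - n, -n - (k - k₀), ?_, ?_, Or.inr ⟨?_, ?_⟩⟩
    · have h1 : |((k - k₀ - n : ℤ) : ℝ) * π| ≤ |s - s₀| + |eρ| + |y + y₀| + 2 * |y₀| := by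
        have e1 : ((k - k₀ - n : ℤ) : ℝ) * π = (s - s₀) + eρ - (y + y₀) + 2 * y₀ := by
          push_cast; rw [Es, dσ, dd, dd₀]; ring
        rw [e1]
        calc |s - s₀ + eρ - (y + y₀) + 2 * y₀| ≤ |s - s₀ + eρ - (y + y₀)| + |2 * y₀| := abs_add_le _ _
          _ ≤ |s - s₀ + eρ| + |y + y₀| + |2 * y₀| := by gcongr; exact abs_sub _ _
          _ ≤ |s - s₀| + |eρ| + |y + y₀| + 2 * |y₀| := by
              rw [abs_mul, abs_two]; gcongr; exact abs_add_le _ _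
      have hy₀b : |y₀| ≤ π / 2 := sc_abs_redPi_le _
      have h2 : |((k - k₀ - n : ℤ) : ℝ)| * π ≤ 3 * π + 1 := by
        rw [← abs_of_pos pi_pos, ← abs_mul, abs_of_pos pi_pos]
        have : |eρ| + |y + y₀| ≤ 1 := by linarith only [heb, hyy, hR]
        linarith only [h1, this, hds, hy₀b]
      have h3 : |((k - k₀ - n : ℤ) : ℝ)| < 4 := by
        by_contra hc; push Not at hc
        have hm := mul_le_mul_of_nonneg_right hc pi_pos.le
        linarith only [hm, h2, Real.pi_gt_three]
      have h4 : |(k - k₀ - n : ℤ)| < 4 := by exact_mod_cast h3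
      omega
    · have h1 : |((-n - (k - k₀) : ℤ) : ℝ) * π| ≤ |t - t₀| + |eρ| + |y + y₀| + 2 * |y₀| := by
        have e1 : ((-n - (k - k₀) : ℤ) : ℝ) * π = (t - t₀) + eρ + (y + y₀) - 2 * y₀ := by
          push_cast; rw [Et, dσ, dd, dd₀]; ring
        rw [e1]
        calc |t - t₀ + eρ + (y + y₀) - 2 * y₀| ≤ |t - t₀ + eρ + (y + y₀)| + |2 * y₀| := abs_sub _ _
          _ ≤ |t - t₀ + eρ| + |y + y₀| + |2 * y₀| := by gcongr; exact abs_add_le _ _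
          _ ≤ |t - t₀| + |eρ| + |y + y₀| + 2 * |y₀| := by
              rw [abs_mul, abs_two]; gcongr; exact abs_add_le _ _
      have hy₀b : |y₀| ≤ π / 2 := sc_abs_redPi_le _
      have h2 : |((-n - (k - k₀) : ℤ) : ℝ)| * π ≤ 3 * π + 1 := by
        rw [← abs_of_pos pi_pos, ← abs_mul, abs_of_pos pi_pos]
        have : |eρ| + |y + y₀| ≤ 1 := by linarith only [heb, hyy, hR]
        linarith only [h1, this, hdt, hy₀b]
      have h3 : |((-n - (k - k₀) : ℤ) : ℝ)| < 4 := by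
        by_contra hc; push Not at hc
        have hm := mul_le_mul_of_nonneg_right hc pi_pos.le
        linarith only [hm, h2, Real.pi_gt_three]
      have h4 : |(-n - (k - k₀) : ℤ)| < 4 := by exact_mod_cast h3
      omega
    · have e1 : s - (s₀ - 2 * y₀ + ((k - k₀ - n : ℤ) : ℝ) * π) = -eρ + (y + y₀) := by
        push_cast; rw [show s = s₀ + (s - s₀) by ring, Es, dσ, dd, dd₀]; ring
      rw [e1]
      calc |-eρ + (y + y₀)| ≤ |-eρ| + |y + y₀| := abs_add_le _ _
        _ ≤ 5700 * L ^ 2 * w + 3100000 * L ^ 3 * w := by rw [abs_neg]; exact add_le_add heb hyy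
    · have e1 : t - (t₀ + 2 * y₀ + ((-n - (k - k₀) : ℤ) : ℝ) * π) = -eρ - (y + y₀) := by
        push_cast; rw [show t = t₀ + (t - t₀) by ring, Et, dσ, dd, dd₀]; ring
      rw [e1]
      calc |-eρ - (y + y₀)| ≤ |-eρ| + |y + y₀| := abs_sub _ _
        _ ≤ 5700 * L ^ 2 * w + 3100000 * L ^ 3 * w := by rw [abs_neg]; exact add_le_add heb hyy

/-! #### From boxes to integrals -/

open scoped ENNReal

/-- **Covering lemma**: if every point of `F ⊆ ℝ²` lies in one of the squares of half-side `r` centred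
at `(c j, d j)`, `j ∈ T`, then `∫∫ 1_F ≤ |T| (2r)²`. [folklore] -/
private theorem lint_cover {F : Set (ℝ × ℝ)} {ι : Type*} (T : Finset ι) (c d : ι → ℝ) {r : ℝ}
    (hF : ∀ s t, (s, t) ∈ F → ∃ j ∈ T, |s - c j| ≤ r ∧ |t - d j| ≤ r) :
    ∫⁻ s, ∫⁻ t, F.indicator (1 : ℝ × ℝ → ℝ≥0∞) (s, t) ≤ T.card * ENNReal.ofReal (2 * r) ^ 2 := by
  classical
  set I : ι → Set ℝ := fun j => Set.Icc (c j - r) (c j + r) with hI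
  set J : ι → Set ℝ := fun j => Set.Icc (d j - r) (d j + r) with hJ
  have key : ∀ s t, F.indicator (1 : ℝ × ℝ → ℝ≥0∞) (s, t) ≤
      ∑ j ∈ T, (I j).indicator (1 : ℝ → ℝ≥0∞) s * (J j).indicator (1 : ℝ → ℝ≥0∞) t := by
    intro s t
    by_cases h : (s, t) ∈ F
    · obtain ⟨j, hj, h1, h2⟩ := hF s t h
      rw [Set.indicator_of_mem h]
      have hs : s ∈ I j := by
        simp only [hI, Set.mem_Icc]; constructor <;> linarith [abs_le.1 h1]
      have ht : t ∈ J j := by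
        simp only [hJ, Set.mem_Icc]; constructor <;> linarith [abs_le.1 h2]
      calc (1 : ℝ × ℝ → ℝ≥0∞) (s, t) = (I j).indicator (1 : ℝ → ℝ≥0∞) s * (J j).indicator (1 : ℝ → ℝ≥0∞) t := by
            rw [Set.indicator_of_mem hs, Set.indicator_of_mem ht]; simp
        _ ≤ ∑ j ∈ T, (I j).indicator (1 : ℝ → ℝ≥0∞) s * (J j).indicator (1 : ℝ → ℝ≥0∞) t :=
            Finset.single_le_sum (f := fun j => (I j).indicator (1 : ℝ → ℝ≥0∞) s *
              (J j).indicator (1 : ℝ → ℝ≥0∞) t) (fun _ _ => zero_le) hj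
    · rw [Set.indicator_of_notMem h]; exact zero_le
  have hmI : ∀ j, MeasurableSet (I j) := fun j => measurableSet_Icc
  have hmJ : ∀ j, MeasurableSet (J j) := fun j => measurableSet_Icc
  have hmeas : ∀ j (s : ℝ), Measurable fun t : ℝ => (I j).indicator (1 : ℝ → ℝ≥0∞) s * (J j).indicator (1 : ℝ → ℝ≥0∞) t :=
    fun j s => (measurable_one.indicator (hmJ j)).const_mul _
  have hvolI : ∀ j, volume (I j) = ENNReal.ofReal (2 * r) := by
    intro j; simp only [hI, Real.volume_Icc]; ring_nf
  have hvolJ : ∀ j, volume (J j) = ENNReal.ofReal (2 * r) := by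
    intro j; simp only [hJ, Real.volume_Icc]; ring_nf
  have inner : ∀ s, ∫⁻ t, ∑ j ∈ T, (I j).indicator (1 : ℝ → ℝ≥0∞) s * (J j).indicator (1 : ℝ → ℝ≥0∞) t =
      ∑ j ∈ T, (I j).indicator (1 : ℝ → ℝ≥0∞) s * ENNReal.ofReal (2 * r) := by
    intro s
    rw [lintegral_finsetSum _ (fun j _ => hmeas j s)]
    apply Finset.sum_congr rfl; intro j _
    rw [lintegral_const_mul _ (measurable_one.indicator (hmJ j)), lintegral_indicator_one (hmJ j),
      hvolJ]
  have hmeas2 : ∀ j, Measurable fun s : ℝ => (I j).indicator (1 : ℝ → ℝ≥0∞) s * ENNReal.ofReal (2 * r) :=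
    fun j => (measurable_one.indicator (hmI j)).mul_const _
  calc ∫⁻ s, ∫⁻ t, F.indicator (1 : ℝ × ℝ → ℝ≥0∞) (s, t)
      ≤ ∫⁻ s, ∫⁻ t, ∑ j ∈ T, (I j).indicator (1 : ℝ → ℝ≥0∞) s * (J j).indicator (1 : ℝ → ℝ≥0∞) t :=
        lintegral_mono fun s => lintegral_mono fun t => key s t
    _ = ∫⁻ s, ∑ j ∈ T, (I j).indicator (1 : ℝ → ℝ≥0∞) s * ENNReal.ofReal (2 * r) :=
        lintegral_congr fun s => inner s
    _ = ∑ j ∈ T, ENNReal.ofReal (2 * r) * ENNReal.ofReal (2 * r) := by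
        rw [lintegral_finsetSum _ (fun j _ => hmeas2 j)]
        apply Finset.sum_congr rfl; intro j _
        rw [lintegral_mul_const _ (measurable_one.indicator (hmI j)),
          lintegral_indicator_one (hmI j), hvolI]
    _ = T.card * ENNReal.ofReal (2 * r) ^ 2 := by
        rw [Finset.sum_const, nsmul_eq_mul]; ring

variable {l' : ℕ}

/-- The frozen parts `A_u`, `A_v` of the centre sums. [folklore] -/
private def restCos (θ₁ : ℝ) (p q : Fin l') (x : Fin l' → ℝ) : ℝ :=
  1 + ∑ i ∈ (Finset.univ.erase p).erase q, cos (x i - θ₁)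

/-- The frozen part `A_v`. [folklore] -/
private def restSin (θ₁ : ℝ) (p q : Fin l') (x : Fin l' → ℝ) : ℝ :=
  ∑ i ∈ (Finset.univ.erase p).erase q, sin (x i - θ₁)

/-- Splitting a sum over the legs at the two moving ones. [folklore] -/
private theorem sum_update_update {p q : Fin l'} (hpq : p ≠ q) (g : ℝ → ℝ) (x : Fin l' → ℝ) (s t : ℝ) :
    ∑ i, g (Function.update (Function.update x p s) q t i) =
      g s + g t + ∑ i ∈ (Finset.univ.erase p).erase q, g (x i) := by
  set θ' := Function.update (Function.update x p s) q t with hθ'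
  have hp : θ' p = s := by
    rw [hθ', Function.update_of_ne hpq, Function.update_self]
  have hq : θ' q = t := by rw [hθ', Function.update_self]
  have hq' : q ∈ Finset.univ.erase p := Finset.mem_erase.2 ⟨hpq.symm, Finset.mem_univ _⟩
  rw [← Finset.add_sum_erase _ _ (Finset.mem_univ p), ← Finset.add_sum_erase _ _ hq', hp, hq, ← add_assoc]
  congr 1
  apply Finset.sum_congr rfl
  intro i hi
  have hi' := Finset.mem_erase.1 hi
  have hi'' := Finset.mem_erase.1 hi'.2
  rw [hθ', Function.update_of_ne hi'.1, Function.update_of_ne hi''.1]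

/-- **The section of `G_{pq}` in terms of `InSect`.** [folklore] -/
private theorem mem_secG_update {w θ₁ : ℝ} {a b : Fin l' → ℝ} {p q : Fin l'} (hpq : p ≠ q)
    {x : Fin l' → ℝ} {s t : ℝ}
    (h : Function.update (Function.update x p s) q t ∈ secG l' w θ₁ a b p q) :
    (a p ≤ s ∧ s ≤ b p) ∧ (a q ≤ t ∧ t ≤ b q) ∧
      (∀ i, i ≠ p → i ≠ q → a i ≤ x i ∧ x i ≤ b i) ∧
      InSect ((l' : ℝ) + 1) w θ₁ (restCos θ₁ p q x) (restSin θ₁ p q x) s t := by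
  set θ' := Function.update (Function.update x p s) q t with hθ'
  have hp : θ' p = s := by
    rw [hθ', Function.update_of_ne hpq, Function.update_self]
  have hq : θ' q = t := by rw [hθ', Function.update_self]
  obtain ⟨hbox, hu, hv, himp⟩ := h
  have hcs : 1 + ∑ i, cos (θ' i - θ₁) = restCos θ₁ p q x + cos (s - θ₁) + cos (t - θ₁) := by
    rw [sum_update_update hpq (fun u => cos (u - θ₁)) x s t, restCos]; ring
  have hsn : ∑ i, sin (θ' i - θ₁) = restSin θ₁ p q x + sin (s - θ₁) + sin (t - θ₁) := by
    rw [sum_update_update hpq (fun u => sin (u - θ₁)) x s t, restSin]; ring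
  refine ⟨?_, ?_, ?_, ?_⟩
  · have := hbox p; rwa [hp] at this
  · have := hbox q; rwa [hq] at this
  · intro i hip hiq
    have := hbox i
    rwa [hθ', Function.update_of_ne hiq, Function.update_of_ne hip] at this
  · refine ⟨?_, ?_, ?_⟩
    · rw [← hcs]; exact hu
    · rw [← hsn]; exact hv
    · intro hA hw
      rw [hp, hq] at himp
      obtain ⟨h1, h2, h3⟩ := himp hA (by simpa [thr] using hw)
      refine ⟨h1, h2, ?_⟩
      rw [← hcs]; exact h3

/-- The trivial-regime threshold. [folklore] -/
private def wTriv (L : ℝ) : ℝ := 1 / (3200000 * L ^ 3)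

/-- Auxiliary step of the proof of `Lemma6SectorCounting_holds`. [folklore] -/
private theorem wTriv_facts {L w : ℝ} (hL : 1 ≤ L) (hw : 0 < w) (hwT : w ≤ wTriv L) :
    w ≤ 1 / (300 * L ^ 2) ∧ w ≤ 1 / (600 * L ^ 2) ∧ 5700 * L ^ 2 * w + 3100000 * L ^ 3 * w ≤ 1 ∧
      600 * L ^ 2 * w ≤ 5700 * L ^ 2 * w + 3100000 * L ^ 3 * w := by
  have hL0 : 0 < L := by linarith
  have hL2 : L ^ 2 ≤ L ^ 3 := by nlinarith
  have hL1 : 1 ≤ L ^ 2 := by nlinarith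
  unfold wTriv at hwT
  have h3 : L ^ 3 * w ≤ 1 / 3200000 := by
    calc L ^ 3 * w ≤ L ^ 3 * (1 / (3200000 * L ^ 3)) := by gcongr
      _ = 1 / 3200000 := by field_simp
  have h2 : L ^ 2 * w ≤ L ^ 3 * w := by nlinarith
  refine ⟨?_, ?_, ?_, ?_⟩
  · rw [le_div_iff₀ (by positivity)]; nlinarith
  · rw [le_div_iff₀ (by positivity)]; nlinarith
  · nlinarith
  · nlinarith

/-- **The section estimate**: for every frozen configuration `x` of the other legs, the double integral
over `(θ_p, θ_q)` of the indicator of `G_{pq}` is `≤ 6·10¹⁵ L⁶ w²`.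
[cite: DisertoriRivasseau2000, App. B (step 1: «N_l ≤ K^l»)] -/
private theorem section_bound {w θ₁ : ℝ} {a b : Fin l' → ℝ} {p q : Fin l'} (hpq : p ≠ q)
    (hw : 0 < w) (hab : ∀ i, b i - a i ≤ 2 * π) (x : Fin l' → ℝ) :
    ∫⁻ s, ∫⁻ t, (secG l' w θ₁ a b p q).indicator (1 : (Fin l' → ℝ) → ℝ≥0∞)
        (Function.update (Function.update x p s) q t) ≤
      ENNReal.ofReal (6 * 10 ^ 15 * ((l' : ℝ) + 1) ^ 6 * w ^ 2) := by
  classical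
  set L : ℝ := (l' : ℝ) + 1 with hLdef
  have hL : 1 ≤ L := by have := Nat.cast_nonneg (α := ℝ) l'; rw [hLdef]; linarith
  have hL0 : 0 < L := by linarith
  set Au := restCos θ₁ p q x
  set Av := restSin θ₁ p q x
  set F : Set (ℝ × ℝ) := {z | Function.update (Function.update x p z.1) q z.2 ∈ secG l' w θ₁ a b p q} with hFdef
  have hind : ∀ s t, (secG l' w θ₁ a b p q).indicator (1 : (Fin l' → ℝ) → ℝ≥0∞)
      (Function.update (Function.update x p s) q t) = F.indicator (1 : ℝ × ℝ → ℝ≥0∞) (s, t) := by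
    intro s t
    by_cases h : Function.update (Function.update x p s) q t ∈ secG l' w θ₁ a b p q
    · rw [Set.indicator_of_mem h, Set.indicator_of_mem (show (s, t) ∈ F from h)]; rfl
    · rw [Set.indicator_of_notMem h, Set.indicator_of_notMem (show (s, t) ∉ F from h)]
  simp_rw [hind]
  have hmem : ∀ s t, (s, t) ∈ F → (a p ≤ s ∧ s ≤ b p) ∧ (a q ≤ t ∧ t ≤ b q) ∧ InSect L w θ₁ Au Av s t := by
    intro s t h
    obtain ⟨h1, h2, -, h4⟩ := mem_secG_update hpq h
    exact ⟨h1, h2, h4⟩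
  by_cases hwT : w ≤ wTriv L
  · -- the genuine regime: cover by the two-point estimates
    obtain ⟨hw300, hw600, hR1, hR600⟩ := wTriv_facts hL hw hwT
    set R := 5700 * L ^ 2 * w + 3100000 * L ^ 3 * w with hRdef
    -- witnesses (one per class)
    let PA : ℤ → ℤ → ℝ × ℝ → Prop := fun m m' z =>
      z ∈ F ∧ |sin (z.1 - z.2)| ≤ 1 / (200 * L) ∧ round ((z.1 - θ₁) / π) = m ∧ round ((z.2 - θ₁) / π) = m'
    let PB : ℝ × ℝ → Prop := fun z => z ∈ F ∧ 1 / (200 * L) < |sin (z.1 - z.2)|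
    obtain ⟨zA, hzA⟩ : ∃ zA : ℤ → ℤ → ℝ × ℝ, ∀ m m' z, PA m m' z → PA m m' (zA m m') := by
      refine ⟨fun m m' => if h : ∃ z, PA m m' z then h.choose else (0, 0), ?_⟩
      intro m m' z hz
      have hex : ∃ z, PA m m' z := ⟨z, hz⟩
      simp only [dif_pos hex]
      exact hex.choose_spec
    obtain ⟨zB, hzB⟩ : ∃ zB : ℝ × ℝ, ∀ z, PB z → PB zB := by
      refine ⟨if h : ∃ z, PB z then h.choose else (0, 0), ?_⟩
      intro z hz
      have hex : ∃ z, PB z := ⟨z, hz⟩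
      simp only [dif_pos hex]
      exact hex.choose_spec
    -- index set and centres
    let Mp : Finset ℤ := Finset.Icc ⌈(a p - θ₁) / π - 1 / 2⌉ ⌊(b p - θ₁) / π + 1 / 2⌋
    let Mq : Finset ℤ := Finset.Icc ⌈(a q - θ₁) / π - 1 / 2⌉ ⌊(b q - θ₁) / π + 1 / 2⌋
    obtain ⟨J3, hJ3mem, hJ3card⟩ : ∃ J3 : Finset ℤ, (∀ j : ℤ, |j| ≤ 3 → j ∈ J3) ∧ J3.card = 7 := by
      refine ⟨Finset.Icc (-3) 3, fun j hj => ?_, by simp⟩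
      rw [Finset.mem_Icc]; constructor <;> linarith [abs_le.1 hj]
    let T : Finset (Bool × ℤ × ℤ × Fin 2) :=
      ({true} ×ˢ (Mp ×ˢ (Mq ×ˢ Finset.univ))) ∪ ({false} ×ˢ (J3 ×ˢ (J3 ×ˢ Finset.univ)))
    have memTA : ∀ m ∈ Mp, ∀ m' ∈ Mq, ∀ τ : Fin 2, (true, m, m', τ) ∈ T := fun m hm m' hm' τ =>
      Finset.mem_union.2 (Or.inl (Finset.mem_product.2 ⟨Finset.mem_singleton_self _,
        Finset.mem_product.2 ⟨hm, Finset.mem_product.2 ⟨hm', Finset.mem_univ _⟩⟩⟩))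
    have memTB : ∀ j ∈ J3, ∀ j' ∈ J3, ∀ τ : Fin 2, (false, j, j', τ) ∈ T := fun j hj j' hj' τ =>
      Finset.mem_union.2 (Or.inr (Finset.mem_product.2 ⟨Finset.mem_singleton_self _,
        Finset.mem_product.2 ⟨hj, Finset.mem_product.2 ⟨hj', Finset.mem_univ _⟩⟩⟩))
    let cfun : Bool × ℤ × ℤ × Fin 2 → ℝ := fun i =>
      if i.1 then (if i.2.2.2 = 0 then (zA i.2.1 i.2.2.1).1
        else (zA i.2.1 i.2.2.1).2 + ((i.2.1 : ℝ) - i.2.2.1) * π)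
      else (if i.2.2.2 = 0 then zB.1 + i.2.1 * π else zB.1 - 2 * redPi ((zB.1 - zB.2) / 2) + i.2.1 * π)
    let dfun : Bool × ℤ × ℤ × Fin 2 → ℝ := fun i =>
      if i.1 then (if i.2.2.2 = 0 then (zA i.2.1 i.2.2.1).2
        else (zA i.2.1 i.2.2.1).1 + ((i.2.2.1 : ℝ) - i.2.1) * π)
      else (if i.2.2.2 = 0 then zB.2 + i.2.2.1 * π else zB.2 + 2 * redPi ((zB.1 - zB.2) / 2) + i.2.2.1 * π)
    have hcover : ∀ s t, (s, t) ∈ F → ∃ j ∈ T, |s - cfun j| ≤ R ∧ |t - dfun j| ≤ R := by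
      intro s t hst
      obtain ⟨hsI, htI, hI⟩ := hmem s t hst
      by_cases hA : |sin (s - t)| ≤ 1 / (200 * L)
      · set m := round ((s - θ₁) / π) with hm
        set m' := round ((t - θ₁) / π) with hm'
        have hP : PA m m' (s, t) := ⟨hst, hA, rfl, rfl⟩
        obtain ⟨h0F, h0A, h0m, h0m'⟩ := hzA m m' (s, t) hP
        obtain ⟨-, -, hI₀⟩ := hmem (zA m m').1 (zA m m').2 h0F
        have hmM : m ∈ Mp := sc_round_mem_Icc ⟨hsI.1, hsI.2⟩
        have hm'M : m' ∈ Mq := sc_round_mem_Icc ⟨htI.1, htI.2⟩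
        rcases pairA hL hw hw300 hI₀ hI h0A hA (by rw [h0m]) (by rw [h0m']) with ⟨h1, h2⟩ | ⟨h1, h2⟩
        · refine ⟨(true, m, m', 0), memTA m hmM m' hm'M 0, ?_, ?_⟩
          · simp only [cfun, if_true]; exact h1.trans hR600
          · simp only [dfun, if_true]; exact h2.trans hR600
        · refine ⟨(true, m, m', 1), memTA m hmM m' hm'M 1, ?_, ?_⟩
          · simp only [cfun, if_true, one_ne_zero, if_false]
            rw [h0m, h0m'] at h1; exact h1.trans hR600
          · simp only [dfun, if_true, one_ne_zero, if_false]
            rw [h0m, h0m'] at h2; exact h2.trans hR600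
      · push Not at hA
        have hP : PB (s, t) := ⟨hst, hA⟩
        obtain ⟨h0F, h0B⟩ := hzB (s, t) hP
        obtain ⟨hsI₀, htI₀, hI₀⟩ := hmem zB.1 zB.2 h0F
        have hds : |s - zB.1| ≤ 2 * π := by
          rw [abs_le]; constructor <;> linarith [hab p, hsI.1, hsI.2, hsI₀.1, hsI₀.2]
        have hdt : |t - zB.2| ≤ 2 * π := by
          rw [abs_le]; constructor <;> linarith [hab q, htI.1, htI.2, htI₀.1, htI₀.2]
        obtain ⟨j, j', hj, hj', hbox⟩ := pairB hL hw hw600 hR1 hI₀ hI h0B hA hds hdt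
        have hjM : j ∈ J3 := hJ3mem j hj
        have hj'M : j' ∈ J3 := hJ3mem j' hj'
        rcases hbox with ⟨h1, h2⟩ | ⟨h1, h2⟩
        · refine ⟨(false, j, j', 0), memTB j hjM j' hj'M 0, ?_, ?_⟩
          · simp only [cfun, if_true]; rw [hRdef]; exact h1
          · simp only [dfun, if_true]; rw [hRdef]; exact h2
        · refine ⟨(false, j, j', 1), memTB j hjM j' hj'M 1, ?_, ?_⟩
          · simp only [cfun, one_ne_zero, if_false]; rw [hRdef]; exact h1
          · simp only [dfun, one_ne_zero, if_false]; rw [hRdef]; exact h2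
    have hcard : (T.card : ℝ≥0∞) ≤ 130 := by
      have hMp : (Mp.card : ℝ) ≤ 4 := sc_card_Icc_le (hab p)
      have hMq : (Mq.card : ℝ) ≤ 4 := sc_card_Icc_le (hab q)
      have h1 : (T.card : ℝ) ≤ 130 := by
        have hc : T.card ≤ Mp.card * (Mq.card * 2) + 7 * (7 * 2) := by
          calc T.card ≤ ({true} ×ˢ (Mp ×ˢ (Mq ×ˢ (Finset.univ : Finset (Fin 2))))).card +
                ({false} ×ˢ (J3 ×ˢ (J3 ×ˢ (Finset.univ : Finset (Fin 2))))).card := Finset.card_union_le _ _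
            _ = Mp.card * (Mq.card * 2) + 7 * (7 * 2) := by
                simp [Finset.card_product, hJ3card]
        have hc' : (T.card : ℝ) ≤ (Mp.card : ℝ) * ((Mq.card : ℝ) * 2) + 98 := by exact_mod_cast hc
        nlinarith [Nat.cast_nonneg (α := ℝ) Mp.card, Nat.cast_nonneg (α := ℝ) Mq.card]
      have h2 : ((T.card : ℕ) : ℝ≥0∞) = ENNReal.ofReal (T.card : ℝ) := by
        rw [ENNReal.ofReal_natCast]
      rw [h2]
      calc ENNReal.ofReal (T.card : ℝ) ≤ ENNReal.ofReal 130 := ENNReal.ofReal_le_ofReal h1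
        _ = 130 := by norm_num
    have hRle : R ≤ 3200000 * L ^ 3 * w := by
      have : L ^ 2 * w ≤ L ^ 3 * w := by
        have hL2 : L ^ 2 ≤ L ^ 3 := by nlinarith
        nlinarith
      rw [hRdef]; nlinarith
    have hR0 : 0 ≤ R := by rw [hRdef]; positivity
    calc ∫⁻ s, ∫⁻ t, F.indicator (1 : ℝ × ℝ → ℝ≥0∞) (s, t) ≤ T.card * ENNReal.ofReal (2 * R) ^ 2 :=
          lint_cover T cfun dfun hcover
      _ ≤ 130 * ENNReal.ofReal (2 * (3200000 * L ^ 3 * w)) ^ 2 := by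
          gcongr
      _ = ENNReal.ofReal (130 * (2 * (3200000 * L ^ 3 * w)) ^ 2) := by
          symm
          rw [ENNReal.ofReal_mul (by norm_num), ENNReal.ofReal_pow (by positivity)]
          norm_num
      _ ≤ ENNReal.ofReal (6 * 10 ^ 15 * L ^ 6 * w ^ 2) := by
          apply ENNReal.ofReal_le_ofReal
          have h0 : 0 ≤ L ^ 6 * w ^ 2 := by positivity
          have : (2 * (3200000 * L ^ 3 * w)) ^ 2 = 4 * 3200000 ^ 2 * (L ^ 6 * w ^ 2) := by ring
          rw [this]
          have : 6 * 10 ^ 15 * L ^ 6 * w ^ 2 = 6 * 10 ^ 15 * (L ^ 6 * w ^ 2) := by ring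
          rw [this]
          nlinarith [h0]
  · -- the trivial regime `w > w_T`: one square of side `2π`
    push Not at hwT
    have hcover : ∀ s t, (s, t) ∈ F → ∃ j ∈ ({0} : Finset ℕ),
        |s - (fun _ => (a p + b p) / 2) j| ≤ π ∧ |t - (fun _ => (a q + b q) / 2) j| ≤ π := by
      intro s t hst
      obtain ⟨hsI, htI, -⟩ := hmem s t hst
      refine ⟨0, Finset.mem_singleton_self 0, ?_, ?_⟩
      · rw [abs_le]; constructor <;> linarith [hab p, hsI.1, hsI.2]
      · rw [abs_le]; constructor <;> linarith [hab q, htI.1, htI.2]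
    have hpi := Real.pi_lt_d2
    have hkey : (2 * π) ^ 2 ≤ 6 * 10 ^ 15 * L ^ 6 * w ^ 2 := by
      unfold wTriv at hwT
      have h1 : 1 < 3200000 * L ^ 3 * w := by
        have := (div_lt_iff₀ (by positivity : (0:ℝ) < 3200000 * L ^ 3)).1 hwT
        linarith
      have h2 : 1 < (3200000 * L ^ 3 * w) ^ 2 := by nlinarith
      have h3 : (2 * π) ^ 2 ≤ 40 := by nlinarith [Real.pi_pos]
      have h4 : (3200000 * L ^ 3 * w) ^ 2 = 3200000 ^ 2 * (L ^ 6 * w ^ 2) := by ring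
      have h5 : 6 * 10 ^ 15 * L ^ 6 * w ^ 2 = 6 * 10 ^ 15 * (L ^ 6 * w ^ 2) := by ring
      rw [h4] at h2
      rw [h5]
      nlinarith [h2, h3]
    calc ∫⁻ s, ∫⁻ t, F.indicator (1 : ℝ × ℝ → ℝ≥0∞) (s, t)
        ≤ ({0} : Finset ℕ).card * ENNReal.ofReal (2 * π) ^ 2 := lint_cover _ _ _ hcover
      _ = ENNReal.ofReal ((2 * π) ^ 2) := by
          rw [Finset.card_singleton, ENNReal.ofReal_pow (by positivity)]; simp
      _ ≤ ENNReal.ofReal (6 * 10 ^ 15 * L ^ 6 * w ^ 2) := ENNReal.ofReal_le_ofReal hkey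

end Cover

/-! ### §6. The measure of `G_{pq}`

Integrating the two moving legs first (the section estimate) and the other `l' - 2` legs over their
whole arcs gives `|G_{pq}| ≤ 6·10¹⁵ L⁶ w² ∏_{i ≠ p, q} (b_i - a_i)`; this is done with Mathlib's
marginal integrals `lmarginal`. -/
section Volume

open scoped ENNReal

variable {l' : ℕ}

/-- Auxiliary step of the proof of `Lemma6SectorCounting_holds`. [folklore] -/
private theorem measurableSet_secG (l' : ℕ) (w θ₁ : ℝ) (a b : Fin l' → ℝ) (p q : Fin l') :
    MeasurableSet (secG l' w θ₁ a b p q) := by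
  have mbox : MeasurableSet {θ : Fin l' → ℝ | ∀ i, a i ≤ θ i ∧ θ i ≤ b i} := by
    have : {θ : Fin l' → ℝ | ∀ i, a i ≤ θ i ∧ θ i ≤ b i} = ⋂ i, {θ | a i ≤ θ i ∧ θ i ≤ b i} := by
      ext θ; simp
    rw [this]
    exact MeasurableSet.iInter fun i =>
      (measurableSet_le measurable_const (measurable_pi_apply i)).inter
        (measurableSet_le (measurable_pi_apply i) measurable_const)
  have mu : Measurable fun θ : Fin l' → ℝ => |1 + ∑ i, cos (θ i - θ₁)| :=
    Continuous.measurable (by fun_prop)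
  have mv : Measurable fun θ : Fin l' → ℝ => |∑ i, sin (θ i - θ₁)| :=
    Continuous.measurable (by fun_prop)
  have mpq : Measurable fun θ : Fin l' → ℝ => |sin (θ p - θ q)| := Continuous.measurable (by fun_prop)
  have mp1 : Measurable fun θ : Fin l' → ℝ => |sin (θ p - θ₁)| := Continuous.measurable (by fun_prop)
  have mq1 : Measurable fun θ : Fin l' → ℝ => |sin (θ q - θ₁)| := Continuous.measurable (by fun_prop)
  have mr1 : Measurable fun θ : Fin l' → ℝ => 2 * ((l' : ℝ) + 1) * (|sin (θ p - θ q)| + 2 * w) :=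
    Continuous.measurable (by fun_prop)
  have mr2 : Measurable fun θ : Fin l' → ℝ => 2 * ((l' : ℝ) + 1) ^ 2 * w * (|sin (θ p - θ q)| + 3 * w) :=
    Continuous.measurable (by fun_prop)
  have e : secG l' w θ₁ a b p q =
      {θ | ∀ i, a i ≤ θ i ∧ θ i ≤ b i} ∩ {θ | |1 + ∑ i, cos (θ i - θ₁)| ≤ 3 * ((l' : ℝ) + 1) * w} ∩
        {θ | |∑ i, sin (θ i - θ₁)| ≤ 3 * ((l' : ℝ) + 1) * w} ∩
        (({θ : Fin l' → ℝ | |sin (θ p - θ q)| ≤ thr l'}ᶜ ∪ {_θ : Fin l' → ℝ | w ≤ thr l'}ᶜ) ∪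
          ({θ | |sin (θ p - θ₁)| ≤ 2 * ((l' : ℝ) + 1) * (|sin (θ p - θ q)| + 2 * w)} ∩
           {θ | |sin (θ q - θ₁)| ≤ 2 * ((l' : ℝ) + 1) * (|sin (θ p - θ q)| + 2 * w)} ∩
           {θ | |1 + ∑ i, cos (θ i - θ₁)| ≤
              2 * ((l' : ℝ) + 1) ^ 2 * w * (|sin (θ p - θ q)| + 3 * w)})) := by
    ext θ
    simp only [secG, Set.mem_setOf_eq, Set.mem_inter_iff, Set.mem_union, Set.mem_compl_iff]
    tauto
  rw [e]
  refine ((mbox.inter (measurableSet_le mu measurable_const)).inter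
    (measurableSet_le mv measurable_const)).inter ?_
  refine (((measurableSet_le mpq measurable_const).compl).union
    ((measurableSet_le measurable_const measurable_const).compl)).union ?_
  exact ((measurableSet_le mp1 mr1).inter (measurableSet_le mq1 mr1)).inter (measurableSet_le mu mr2)

/-- **`|G_{pq}| ≤ 6·10¹⁵ L⁶ w² ∏_{i ≠ p,q} (b_i - a_i)`.** [folklore] -/
private theorem volume_secG_le {w θ₁ : ℝ} {a b : Fin l' → ℝ} {p q : Fin l'} (hpq : p ≠ q) (hw : 0 < w)
    (hab : ∀ i, b i - a i ≤ 2 * π) :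
    volume (secG l' w θ₁ a b p q) ≤ ENNReal.ofReal (6 * 10 ^ 15 * ((l' : ℝ) + 1) ^ 6 * w ^ 2) *
      ∏ i ∈ (Finset.univ.erase p).erase q, ENNReal.ofReal (b i - a i) := by
  set C : ℝ≥0∞ := ENNReal.ofReal (6 * 10 ^ 15 * ((l' : ℝ) + 1) ^ 6 * w ^ 2) with hC
  have hS := measurableSet_secG l' w θ₁ a b p q
  set S := secG l' w θ₁ a b p q with hSdef
  let side : Fin l' → Set ℝ := fun i => if i = p ∨ i = q then Set.Icc 0 1 else Set.Icc (a i) (b i)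
  have hside : ∀ i, MeasurableSet (side i) := by
    intro i
    by_cases h : i = p ∨ i = q
    · simp only [side, if_pos h]; exact measurableSet_Icc
    · simp only [side, if_neg h]; exact measurableSet_Icc
  set B : Set (Fin l' → ℝ) := Set.pi Set.univ side with hBdef
  have hB : MeasurableSet B := MeasurableSet.univ_pi hside
  set f : (Fin l' → ℝ) → ℝ≥0∞ := S.indicator 1 with hfdef
  set g : (Fin l' → ℝ) → ℝ≥0∞ := fun θ => C * B.indicator 1 θ with hgdef
  have hf : Measurable f := measurable_one.indicator hS
  have hg : Measurable g := (measurable_one.indicator hB).const_mul C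
  have hq' : q ∈ Finset.univ.erase p := Finset.mem_erase.2 ⟨hpq.symm, Finset.mem_univ _⟩
  have hpq' : p ∉ ({q} : Finset (Fin l')) := by simpa using hpq
  -- the unit square
  have hI1 : volume (Set.Icc (0 : ℝ) 1) = 1 := by simp [Real.volume_Icc]
  have e1 : ∀ s : ℝ, ∫⁻ t : ℝ, C * (Set.Icc (0 : ℝ) 1).indicator (1 : ℝ → ℝ≥0∞) s *
      (Set.Icc (0 : ℝ) 1).indicator (1 : ℝ → ℝ≥0∞) t =
        C * (Set.Icc (0 : ℝ) 1).indicator (1 : ℝ → ℝ≥0∞) s := by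
    intro s
    rw [lintegral_const_mul _ (measurable_one.indicator measurableSet_Icc),
      lintegral_indicator_one measurableSet_Icc, hI1, mul_one]
  have hunit : ∫⁻ s : ℝ, ∫⁻ t : ℝ, C * (Set.Icc (0 : ℝ) 1).indicator (1 : ℝ → ℝ≥0∞) s *
      (Set.Icc (0 : ℝ) 1).indicator (1 : ℝ → ℝ≥0∞) t = C := by
    rw [lintegral_congr e1, lintegral_const_mul _ (measurable_one.indicator measurableSet_Icc),
      lintegral_indicator_one measurableSet_Icc, hI1, mul_one]
  -- the marginal inequality over the two moving legs
  have key : (∫⋯∫⁻_{p, q}, f ∂(fun _ : Fin l' => (volume : Measure ℝ))) ≤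
      (∫⋯∫⁻_{p, q}, g ∂(fun _ : Fin l' => (volume : Measure ℝ))) := by
    intro x
    rw [lmarginal_insert _ hf hpq', lmarginal_insert _ hg hpq', lmarginal_singleton f q,
      lmarginal_singleton g q]
    change ∫⁻ s, ∫⁻ t, f (Function.update (Function.update x p s) q t) ≤
      ∫⁻ s, ∫⁻ t, g (Function.update (Function.update x p s) q t)
    by_cases hrest : ∀ i, i ≠ p → i ≠ q → a i ≤ x i ∧ x i ≤ b i
    · calc ∫⁻ s, ∫⁻ t, f (Function.update (Function.update x p s) q t)
          ≤ C := section_bound hpq hw hab x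
        _ = ∫⁻ s : ℝ, ∫⁻ t : ℝ, C * (Set.Icc (0 : ℝ) 1).indicator (1 : ℝ → ℝ≥0∞) s *
              (Set.Icc (0 : ℝ) 1).indicator (1 : ℝ → ℝ≥0∞) t := hunit.symm
        _ ≤ ∫⁻ s, ∫⁻ t, g (Function.update (Function.update x p s) q t) := by
          apply lintegral_mono; intro s; apply lintegral_mono; intro t
          simp only [hgdef]
          by_cases hs : s ∈ Set.Icc (0 : ℝ) 1
          · by_cases ht : t ∈ Set.Icc (0 : ℝ) 1
            · have hmem : Function.update (Function.update x p s) q t ∈ B := by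
                simp only [hBdef, Set.mem_pi, Set.mem_univ, forall_true_left]
                intro i
                by_cases hip : i = p
                · subst hip
                  simp only [side, true_or, if_true, Function.update_of_ne hpq, Function.update_self]
                  exact hs
                · by_cases hiq : i = q
                  · subst hiq
                    simp only [side, or_true, if_true, Function.update_self]
                    exact ht
                  · simp only [side, hip, hiq, or_self, if_false, Function.update_of_ne hiq,
                      Function.update_of_ne hip]
                    exact hrest i hip hiq
              rw [Set.indicator_of_mem hs, Set.indicator_of_mem ht, Set.indicator_of_mem hmem]
              simp
            · rw [Set.indicator_of_notMem ht]; simp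
          · rw [Set.indicator_of_notMem hs]; simp
    · have h0 : ∀ s t, f (Function.update (Function.update x p s) q t) = 0 := by
        intro s t
        apply Set.indicator_of_notMem
        intro hmem
        obtain ⟨-, -, hr, -⟩ := mem_secG_update hpq hmem
        exact hrest hr
      simp only [h0, lintegral_zero]
      exact zero_le
  have hvol : volume B = ∏ i ∈ (Finset.univ.erase p).erase q, ENNReal.ofReal (b i - a i) := by
    rw [hBdef, volume_pi_pi, ← Finset.mul_prod_erase _ _ (Finset.mem_univ p),
      ← Finset.mul_prod_erase _ _ hq']
    have hp1 : volume (side p) = 1 := by simp [side, Real.volume_Icc]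
    have hq1 : volume (side q) = 1 := by simp [side, Real.volume_Icc]
    rw [hp1, hq1, one_mul, one_mul]
    apply Finset.prod_congr rfl
    intro i hi
    have hi' := Finset.mem_erase.1 hi
    have hi'' := Finset.mem_erase.1 hi'.2
    simp only [side, hi'.1, hi''.1, or_self, if_false, Real.volume_Icc]
  calc volume S = ∫⁻ θ, f θ := (lintegral_indicator_one hS).symm
    _ ≤ ∫⁻ θ, g θ := by
        have := lintegral_le_of_lmarginal_le (μ := fun _ : Fin l' => (volume : Measure ℝ))
          {p, q} hf hg key
        rw [← volume_pi] at this
        exact this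
    _ = C * volume B := by
        rw [hgdef, lintegral_const_mul _ (measurable_one.indicator hB), lintegral_indicator_one hB]
    _ = C * ∏ i ∈ (Finset.univ.erase p).erase q, ENNReal.ofReal (b i - a i) := by rw [hvol]

end Volume

/-! ### §7. Proof of Lemma 6 -/
section Main

open scoped ENNReal

/-- Auxiliary step of the proof of `Lemma6SectorCounting_holds`. [folklore] -/
private theorem upsilon_nonneg (α : ℝ) {l : ℕ} (θs : Fin l → ℝ) : 0 ≤ upsilon α θs := by
  unfold upsilon; split_ifs <;> norm_num

/-- Auxiliary step of the proof of `Lemma6SectorCounting_holds`. [folklore] -/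
private theorem upsilon_le_one (α : ℝ) {l : ℕ} (θs : Fin l → ℝ) : upsilon α θs ≤ 1 := by
  unfold upsilon; split_ifs <;> norm_num

/-- Auxiliary step of the proof of `Lemma6SectorCounting_holds`. [folklore] -/
private theorem compat_of_upsilon_ne_zero {α : ℝ} {l : ℕ} {θs : Fin l → ℝ} (h : upsilon α θs ≠ 0) :
    MomentaCompatible α θs := by
  unfold upsilon at h
  split_ifs at h with hc
  · exact hc
  · exact absurd rfl h

/-- From a measurable cover of `{u ≠ 0} ∩ box` to a bound on `∫_box u` (`0 ≤ u ≤ 1`). [folklore] -/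
private theorem setIntegral_le_of_cover {n : ℕ} {ι : Type*} (T : Finset ι) (S : ι → Set (Fin n → ℝ))
    (r : ι → ℝ) (hS : ∀ j ∈ T, MeasurableSet (S j)) (hr : ∀ j ∈ T, 0 ≤ r j)
    (hle : ∀ j ∈ T, volume (S j) ≤ ENNReal.ofReal (r j))
    {box : Set (Fin n → ℝ)} (hbox : MeasurableSet box) (hboxfin : volume box ≠ ∞)
    {u : (Fin n → ℝ) → ℝ} (hu0 : ∀ θ, 0 ≤ u θ) (hu1 : ∀ θ, u θ ≤ 1)
    (hcov : ∀ θ ∈ box, u θ ≠ 0 → ∃ j ∈ T, θ ∈ S j) :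
    ∫ θ in box, u θ ≤ ∑ j ∈ T, r j := by
  set ν := (volume : Measure (Fin n → ℝ)).restrict box with hν
  haveI : IsFiniteMeasure ν := by
    refine ⟨?_⟩
    rw [hν, Measure.restrict_apply_univ]
    exact hboxfin.lt_top
  have hgi : Integrable (fun θ => ∑ j ∈ T, (S j).indicator (fun _ => (1 : ℝ)) θ) ν :=
    integrable_finsetSum T fun j hj => (integrable_const (1 : ℝ)).indicator (hS j hj)
  have hg0 : ∀ θ, ∀ j ∈ T, 0 ≤ (S j).indicator (fun _ => (1 : ℝ)) θ :=
    fun θ j _ => Set.indicator_nonneg (fun _ _ => zero_le_one) _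
  have hug : ∀ᵐ θ ∂ν, u θ ≤ ∑ j ∈ T, (S j).indicator (fun _ => (1 : ℝ)) θ := by
    rw [hν, ae_restrict_iff' hbox]
    refine Filter.Eventually.of_forall fun θ hθ => ?_
    by_cases hu : u θ = 0
    · rw [hu]; exact Finset.sum_nonneg (hg0 θ)
    · obtain ⟨j, hj, hθj⟩ := hcov θ hθ hu
      calc u θ ≤ 1 := hu1 θ
        _ = (S j).indicator (fun _ => (1 : ℝ)) θ := by rw [Set.indicator_of_mem hθj]
        _ ≤ ∑ j ∈ T, (S j).indicator (fun _ => (1 : ℝ)) θ :=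
            Finset.single_le_sum (f := fun j => (S j).indicator (fun _ => (1 : ℝ)) θ) (hg0 θ) hj
  have hu0' : 0 ≤ᵐ[ν] u := Filter.Eventually.of_forall hu0
  calc ∫ θ in box, u θ = ∫ θ, u θ ∂ν := rfl
    _ ≤ ∫ θ, ∑ j ∈ T, (S j).indicator (fun _ => (1 : ℝ)) θ ∂ν := integral_mono_of_nonneg hu0' hgi hug
    _ = ∑ j ∈ T, ∫ θ, (S j).indicator (fun _ => (1 : ℝ)) θ ∂ν :=
        integral_finsetSum T fun j hj => (integrable_const (1 : ℝ)).indicator (hS j hj)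
    _ = ∑ j ∈ T, ν.real (S j) := by
        refine Finset.sum_congr rfl fun j hj => ?_
        rw [integral_indicator_const _ (hS j hj), smul_eq_mul, mul_one]
    _ ≤ ∑ j ∈ T, r j := by
        refine Finset.sum_le_sum fun j hj => ?_
        rw [measureReal_def]
        apply ENNReal.toReal_le_of_le_ofReal (hr j hj)
        calc ν (S j) ≤ volume (S j) := by rw [hν]; exact Measure.restrict_apply_le _ _
          _ ≤ ENNReal.ofReal (r j) := hle j hj

/-- **DR 2000 Part I, Lemma 6 (sector counting), proved.** `K = 2⁶⁰` works.
[cite: DisertoriRivasseau2000, §IV.3 Lemma 6 (IV.31), App. B] -/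
theorem Lemma6SectorCounting_holds : Lemma6SectorCounting := by
  refine ⟨2 ^ 60, by norm_num, ?_⟩
  intro α hα l' hl' θ₁ a b harc
  have hα0 : 0 < α := by linarith
  obtain ⟨hw0, hw1, -, hw4⟩ := sc_w_facts hα
  set w := α ^ (-(1 / 4 : ℝ)) with hwdef
  have hαw : α ^ (1 / 4 : ℝ) * w = 1 := by rw [hw4, inv_mul_cancel₀ hw0.ne']
  have hab0 : ∀ i, 0 ≤ b i - a i := fun i => by linarith [(harc i).1]
  have hab2 : ∀ i, b i - a i ≤ 2 * π := fun i => (harc i).2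
  -- the box
  set box : Set (Fin l' → ℝ) := Set.pi Set.univ (fun i => Set.Icc (a i) (b i)) with hboxdef
  have hboxm : MeasurableSet box := MeasurableSet.univ_pi fun i => measurableSet_Icc
  have hboxvol : volume box = ENNReal.ofReal (∏ i, (b i - a i)) := by
    rw [hboxdef, volume_pi_pi, ENNReal.ofReal_prod_of_nonneg (fun i _ => hab0 i)]
    simp only [Real.volume_Icc]
  have hboxfin : volume box ≠ ∞ := by rw [hboxvol]; exact ENNReal.ofReal_ne_top
  have hmembox : ∀ θ ∈ box, ∀ i, a i ≤ θ i ∧ θ i ≤ b i := fun θ hθ i => Set.mem_univ_pi.1 hθ i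
  set u : (Fin l' → ℝ) → ℝ := fun θ => upsilon α (Fin.cons θ₁ θ : Fin (l' + 1) → ℝ) with hudef
  have hu0 : ∀ θ, 0 ≤ u θ := fun θ => upsilon_nonneg _ _
  have hu1 : ∀ θ, u θ ≤ 1 := fun θ => upsilon_le_one _ _
  rcases hl' with rfl | hl3
  · /- `l' = 1` (two legs): conservation alone forces `θ ≡ θ₁ (mod π)` up to `2πw`, so the
      integral is `≤ 16 π w` and `(4/3) α^{1/4} · 16 π w ≤ K²`. -/
    refine ⟨∅, by simp, ?_⟩
    rw [Finset.prod_empty, mul_one, pow_one]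
    let M : Finset ℤ := Finset.Icc ⌈(a 0 - θ₁) / π - 1 / 2⌉ ⌊(b 0 - θ₁) / π + 1 / 2⌋
    let S : ℤ → Set (Fin 1 → ℝ) := fun m =>
      Set.pi Set.univ fun _ => Set.Icc (θ₁ + m * π - 2 * π * w) (θ₁ + m * π + 2 * π * w)
    have hint : ∫ θ in box, u θ ≤ ∑ m ∈ M, 4 * π * w := by
      apply setIntegral_le_of_cover M S (fun _ => 4 * π * w)
      · intro m _; exact MeasurableSet.univ_pi fun _ => measurableSet_Icc
      · intro m _; positivity
      · intro m _
        rw [volume_pi_pi]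
        simp only [Real.volume_Icc, Finset.prod_const, Finset.card_univ, Fintype.card_fin, pow_one]
        apply le_of_eq; congr 1; ring
      · exact hboxm
      · exact hboxfin
      · exact hu0
      · exact hu1
      · intro θ hθ hne0
        have hc := compat_of_upsilon_ne_zero hne0
        obtain ⟨ρ, ψ, hd⟩ := angularData_of_compat hα hc
        have hs := ad_sum_sin_le hd hw0.le hw1 θ₁
        rw [← hwdef] at hs
        simp only [Fin.sum_univ_succ, Finset.univ_eq_empty, Finset.sum_empty, add_zero, Fin.cons_zero,
          Fin.cons_succ, sub_self, Real.sin_zero, zero_add] at hs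
        have hs' : |sin (θ 0 - θ₁)| ≤ 4 * w := by
          have := hs; push_cast at this; linarith
        set m := round ((θ 0 - θ₁) / π) with hm
        have hmM : m ∈ M := sc_round_mem_Icc ⟨(hmembox θ hθ 0).1, (hmembox θ hθ 0).2⟩
        refine ⟨m, hmM, ?_⟩
        rw [Set.mem_univ_pi]
        intro i
        have hi : i = 0 := Subsingleton.elim _ _
        subst hi
        have hdec := sc_decomp (θ 0) θ₁
        have hr : |redPi (θ 0 - θ₁)| ≤ 2 * π * w := by
          have := sc_abs_redPi_le_sin (θ 0 - θ₁)
          nlinarith [Real.pi_pos, abs_nonneg (sin (θ 0 - θ₁))]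
        rw [Set.mem_Icc]
        constructor <;> linarith [(abs_le.1 hr).1, (abs_le.1 hr).2, hdec]
    have hM4 : (M.card : ℝ) ≤ 4 := sc_card_Icc_le (c := θ₁) (harc 0).2
    have hpi := Real.pi_lt_d2
    calc (4 / 3) * α ^ (1 / 4 : ℝ) * ∫ θ in box, u θ
        ≤ (4 / 3) * α ^ (1 / 4 : ℝ) * (∑ m ∈ M, 4 * π * w) :=
          mul_le_mul_of_nonneg_left hint (by positivity)
      _ = (4 / 3) * (M.card : ℝ) * 4 * π * (α ^ (1 / 4 : ℝ) * w) := by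
          rw [Finset.sum_const, nsmul_eq_mul]; ring
      _ ≤ (2 ^ 60 : ℝ) ^ (1 + 1) := by
          rw [hαw, mul_one]
          nlinarith [hM4, Real.pi_pos]
  · /- `l' ≥ 3`. -/
    set L : ℝ := (l' : ℝ) + 1 with hLdef
    have hL1 : 1 ≤ L := by rw [hLdef]; linarith [Nat.cast_nonneg (α := ℝ) l']
    set Csec : ℝ := 6 * 10 ^ 15 * L ^ 6 * w ^ 2 with hCsec
    have hCsec0 : 0 ≤ Csec := by rw [hCsec]; positivity
    -- the index set `I`: maximise the product over all `(l'-2)`-subsets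
    have hne : ((Finset.univ : Finset (Fin l')).powersetCard (l' - 2)).Nonempty := by
      apply Finset.powersetCard_nonempty.2
      simp
    obtain ⟨I, hI, hImax⟩ := Finset.exists_max_image _
      (fun J : Finset (Fin l') => ∏ i ∈ J, ((b i - a i) * α ^ (1 / 4 : ℝ))) hne
    have hIcard : I.card = l' - 2 := (Finset.mem_powersetCard.1 hI).2
    refine ⟨I, hIcard, ?_⟩
    set P := ∏ i ∈ I, ((b i - a i) * α ^ (1 / 4 : ℝ)) with hPdef
    have hP0 : 0 ≤ P := Finset.prod_nonneg fun i _ => mul_nonneg (hab0 i) (by positivity)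
    -- the sets `G_{pq}` and their measure bounds
    let S : Fin l' × Fin l' → Set (Fin l' → ℝ) := fun pq => secG l' w θ₁ a b pq.1 pq.2
    let r : Fin l' × Fin l' → ℝ := fun pq =>
      Csec * ∏ i ∈ (Finset.univ.erase pq.1).erase pq.2, (b i - a i)
    have hint : ∫ θ in box, u θ ≤ ∑ pq ∈ (Finset.univ : Finset (Fin l')).offDiag, r pq := by
      apply setIntegral_le_of_cover _ S r
      · intro pq _; exact measurableSet_secG l' w θ₁ a b pq.1 pq.2
      · intro pq _
        exact mul_nonneg hCsec0 (Finset.prod_nonneg fun i _ => hab0 i)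
      · intro pq hpq
        have hne' : pq.1 ≠ pq.2 := (Finset.mem_offDiag.1 hpq).2.2
        calc volume (S pq) ≤ ENNReal.ofReal Csec *
              ∏ i ∈ (Finset.univ.erase pq.1).erase pq.2, ENNReal.ofReal (b i - a i) :=
              volume_secG_le hne' hw0 hab2
          _ = ENNReal.ofReal (r pq) := by
              show _ = ENNReal.ofReal (Csec * ∏ i ∈ (Finset.univ.erase pq.1).erase pq.2, (b i - a i))
              rw [ENNReal.ofReal_mul hCsec0, ENNReal.ofReal_prod_of_nonneg (fun i _ => hab0 i)]
      · exact hboxm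
      · exact hboxfin
      · exact hu0
      · exact hu1
      · intro θ hθ hne0
        have hc := compat_of_upsilon_ne_zero hne0
        obtain ⟨pq, hpq, hmem⟩ := mem_secG_of_compat hα (by omega) (hmembox θ hθ) hc
        exact ⟨pq, hpq, hmem⟩
    -- each `∏_{i ≠ p,q} (b_i - a_i)` is `≤ w^{l'-2} P`
    have hFw : ∀ i, b i - a i = (b i - a i) * α ^ (1 / 4 : ℝ) * w := by
      intro i; rw [mul_assoc, hαw, mul_one]
    have hprod : ∀ pq ∈ (Finset.univ : Finset (Fin l')).offDiag,
        ∏ i ∈ (Finset.univ.erase pq.1).erase pq.2, (b i - a i) ≤ w ^ (l' - 2) * P := by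
      intro pq hpq
      have hne' : pq.1 ≠ pq.2 := (Finset.mem_offDiag.1 hpq).2.2
      have hJcard : ((Finset.univ.erase pq.1).erase pq.2).card = l' - 2 := by
        rw [Finset.card_erase_of_mem (Finset.mem_erase.2 ⟨hne'.symm, Finset.mem_univ _⟩),
          Finset.card_erase_of_mem (Finset.mem_univ _), Finset.card_univ, Fintype.card_fin]
        omega
      have hJmem : (Finset.univ.erase pq.1).erase pq.2 ∈
          (Finset.univ : Finset (Fin l')).powersetCard (l' - 2) :=
        Finset.mem_powersetCard.2 ⟨Finset.subset_univ _, hJcard⟩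
      have h1 : ∏ i ∈ (Finset.univ.erase pq.1).erase pq.2, (b i - a i) =
          w ^ (l' - 2) * ∏ i ∈ (Finset.univ.erase pq.1).erase pq.2, ((b i - a i) * α ^ (1 / 4 : ℝ)) := by
        rw [Finset.prod_congr rfl (fun i _ => hFw i), Finset.prod_mul_distrib, Finset.prod_const, hJcard,
          mul_comm]
      rw [h1]
      exact mul_le_mul_of_nonneg_left (hImax _ hJmem) (pow_nonneg hw0.le _)
    -- number of pairs
    have hcardR : (((Finset.univ : Finset (Fin l')).offDiag.card : ℕ) : ℝ) ≤ L ^ 2 := by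
      have h : (Finset.univ : Finset (Fin l')).offDiag.card ≤ l' * l' := by
        rw [Finset.offDiag_card, Finset.card_univ, Fintype.card_fin]; exact Nat.sub_le _ _
      have h' : (((Finset.univ : Finset (Fin l')).offDiag.card : ℕ) : ℝ) ≤ (l' : ℝ) * l' := by
        exact_mod_cast h
      rw [hLdef]; nlinarith [Nat.cast_nonneg (α := ℝ) l']
    have hsum : ∑ pq ∈ (Finset.univ : Finset (Fin l')).offDiag, r pq ≤
        L ^ 2 * (Csec * (w ^ (l' - 2) * P)) := by
      calc ∑ pq ∈ (Finset.univ : Finset (Fin l')).offDiag, r pq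
          ≤ ∑ pq ∈ (Finset.univ : Finset (Fin l')).offDiag, Csec * (w ^ (l' - 2) * P) :=
            Finset.sum_le_sum fun pq hpq => mul_le_mul_of_nonneg_left (hprod pq hpq) hCsec0
        _ = (((Finset.univ : Finset (Fin l')).offDiag.card : ℕ) : ℝ) * (Csec * (w ^ (l' - 2) * P)) := by
            rw [Finset.sum_const, nsmul_eq_mul]
        _ ≤ L ^ 2 * (Csec * (w ^ (l' - 2) * P)) :=
            mul_le_mul_of_nonneg_right hcardR (by positivity)
    -- the constant
    have hK : (4 / 3 : ℝ) ^ l' * (L ^ 2 * (6 * 10 ^ 15 * L ^ 6)) ≤ (2 ^ 60 : ℝ) ^ (l' + 1) := by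
      have h43 : (4 / 3 : ℝ) ^ l' ≤ 2 ^ l' := pow_le_pow_left₀ (by norm_num) (by norm_num) l'
      have hL2 : L ≤ 2 ^ l' := by
        have h : l' < 2 ^ l' := Nat.lt_two_pow_self
        have h' : ((l' : ℕ) : ℝ) + 1 ≤ ((2 ^ l' : ℕ) : ℝ) := by exact_mod_cast h
        rw [hLdef]; push_cast at h'; linarith
      have hL8 : L ^ 2 * (6 * 10 ^ 15 * L ^ 6) ≤ 2 ^ 53 * (2 ^ l') ^ 8 := by
        have h1 : L ^ 8 ≤ (2 ^ l') ^ 8 := pow_le_pow_left₀ (by linarith) hL2 8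
        have h2 : L ^ 2 * (6 * 10 ^ 15 * L ^ 6) = 6 * 10 ^ 15 * L ^ 8 := by ring
        rw [h2]
        nlinarith [pow_nonneg (by linarith : (0 : ℝ) ≤ L) 8]
      calc (4 / 3 : ℝ) ^ l' * (L ^ 2 * (6 * 10 ^ 15 * L ^ 6)) ≤ 2 ^ l' * (2 ^ 53 * (2 ^ l') ^ 8) :=
            mul_le_mul h43 hL8 (by positivity) (by positivity)
        _ = 2 ^ (9 * l' + 53) := by
            rw [← pow_mul, ← pow_add, ← pow_add]; congr 1; ring
        _ ≤ 2 ^ (60 * (l' + 1)) := pow_le_pow_right₀ (by norm_num) (by omega)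
        _ = (2 ^ 60) ^ (l' + 1) := by rw [pow_mul]
    -- assemble
    have hwpow : w ^ 2 * w ^ (l' - 2) = w ^ l' := by
      rw [← pow_add, Nat.add_sub_cancel' (by omega : 2 ≤ l')]
    have hmain : ((4 / 3) * α ^ (1 / 4 : ℝ)) ^ l' * ∫ θ in box, u θ ≤
        ((4 / 3) * α ^ (1 / 4 : ℝ)) ^ l' * (L ^ 2 * (Csec * (w ^ (l' - 2) * P))) :=
      mul_le_mul_of_nonneg_left (hint.trans hsum) (by positivity)
    have halg : ((4 / 3) * α ^ (1 / 4 : ℝ)) ^ l' * (L ^ 2 * (Csec * (w ^ (l' - 2) * P))) =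
        (4 / 3 : ℝ) ^ l' * (L ^ 2 * (6 * 10 ^ 15 * L ^ 6)) * (α ^ (1 / 4 : ℝ) * w) ^ l' * P := by
      have : Csec * (w ^ (l' - 2) * P) = 6 * 10 ^ 15 * L ^ 6 * (w ^ 2 * w ^ (l' - 2)) * P := by
        rw [hCsec]; ring
      rw [this, hwpow]; ring
    rw [halg, hαw, one_pow, mul_one] at hmain
    exact hmain.trans (mul_le_mul_of_nonneg_right hK hP0)

end Main

end Literature.MathematicalPhysics.QuantumLattice.FermiRG.DR2000
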